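import Mathlib
import HarnessLib
import Summits.Parity.GeneralizedHardyLittlewood.Theses.LiouvilleShiftedTables
import Literature.NumberTheory.LFunctions.SiegelWalfiszLiouville
import Literature.NumberTheory.LFunctions.SiegelWalfiszMoebiusProofs

/-!
# Disproof work file for crux `DilatedTableChowla` (stmt-Parity-14271) — cdisprove (gen-1/2 seats §0–§15, gen-3 seat §16)

Crux (route LiouvilleShiftedTables, X1): for every `c ≠ 0`, `0 < δ ≤ 1/12`, `C > 0`, all large
`x`, uniformly for `x^δ ≤ A ≤ x^{1/3+δ}` and all class choices `u v : ℕ → ℕ`,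
`Σ_{q ≤ x^{δ/2}} q³ · Σ_{a,a' ∈ (A,2A], a ≡ a' ≡ u q (q)} (Σ_{b ≤ x/A, b ≡ v q (q)} λ(ab+c)λ(a'b+c))²
≤ x²/(log x)^C`. In the notation of §0: `lhs c δ x A u v ≤ x² / (log x)^C` (`crux_iff_lhs`, `Iff.rfl`).

VERDICT SO FAR (gen-1 seat v1–v8 + this seat): the crux RESISTS every cheap attack; no formal
loophole (elaborates, no junk operators bite: `Int.toNat` only meets positive arguments once
`A > |c|`; `x₀` may depend on `c, δ, C`; classes are arbitrary naturals). A substantive refutation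
would be an Ω-result for 2-point correlations of λ on the rank-one family {ab+c, a'b+c} — nothing
of the kind is in print. What IS proved here (all `sorry`-free unless marked):

* §4 (a) LOAD-BEARING: dropping any one of `c ≠ 0` (`false_without_shift_ne_zero`: at `c = 0`
  the fourth moment equals the trivial bound, `F_zero_shift`), `0 < δ` (`false_without_delta_pos`:
  one-row table), `δ ≤ 1/12` i.e. SOME upper bound on δ (`false_without_delta_le`: one-column table,
  the stmt-Parity-4218 pattern), the lower window (`false_without_lower_window`), the upper window
  (`false_without_upper_window`) makes the statement FALSE; `0 < C` is decoration
  (`withoutCPos_of_crux`).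
* §5 CONTENT: the crux implies its `q = 1` slice `TableChowla` (`crux_imp_tableChowla`) and, for
  every FIXED modulus `q₀`, the pointwise bound `q₀³ F(q₀,u,v) ≤ x²/(log x)^C` for ALL classes
  (`crux_imp_fixedModulus`): the ℓ¹-average protects no single small modulus.
* §6 (b) TIGHTNESS (diagonal): the window cannot start at `x^{δ/2}`
  (`false_with_lower_window_halved`), the dilations cannot reach `x^δ`
  (`false_with_dilations_to_delta`), the weight cannot be `q⁴` (`false_with_weight_four`): the claim
  sits exactly `x^{δ/2}` above its own diagonal, so the saving must come from DISTINCT rows.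
* §7 (d) λ-SENSITIVITY: for EVERY `m`-periodic `f` with `f 1 = 1` (constant 1, χ₃, χ₄, every real
  character) both table statements are FALSE (`not_tableChowlaFor_periodic`,
  `not_dilatedTableChowlaFor_periodic`): any proof must use λ's aperiodicity quantitatively and
  uniformly in conductors — the formal content of the Siegel-exceptional worry.
* §8 (e) QUANTIFIER ORDER: `x₀` cannot be uniform in `δ` (`false_uniform_in_delta`).
* §9 (f) STRUCTURE: `DilatedTableChowla ↔ OffDiagonalTableChowla` (`crux_iff_offDiagonal`): the
  weighted diagonal is `≤ 12x²/x^{δ/2}` uniformly (`lhsDiag_le`, with the reusable `window_counts`),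
  so ALL content is two-point cancellation `Σ_b λ(ab+c)λ(a'b+c)` over distinct rows `a ≠ a'` of a
  class: a binary-form Chowla/Elliott sum (determinant `c(a−a') ≠ 0`) of length `≥ x^{7/12}` with
  large coefficients `a, a' ≤ x^{5/12}`, on average over pairs and dilations.
* §10 (h) SUFFICIENCY: `crux_of_pointwiseOffExceptional` — it suffices to prove the pointwise bound
  `q⁴ Foff(q,u,v) ≤ x²/(log x)^{C+2}` for the dilations outside ANY exceptional set `E` with
  `Σ_{q∈E} 1/q ≤ (log x)^{-C}/200` (room for the multiples of a Siegel modulus `q₁ ≫ (log x)^{C+1}`).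
* §11 (k') NECESSITY (Markov): `crux_imp_pointwise_markov` — conversely the crux forces
  `q⁴F_q ≤ K x²/(log x)^C` off a set of harmonic mass `≤ 1/K`.
* §11b (k'') `crux_iff_pointwiseOffSparse : DilatedTableChowla ↔ PointwiseOffSparse` — EXACT
  equivalence (not only up to logs): the crux IS "pointwise `q⁴F ≤ x²/(log x)^C` off a prover-chosen
  set of dilations of harmonic mass `≤ (log x)^{-C}`" (the skeleton stub (C⁺) minus its hypothesis).
* §12 (l) `S_eq_twoPoint`: `S(a,a') = λ(a)λ(a') Σ_b λ(aa'b + a'c)λ(aa'b + ac)` — a two-point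
  Chowla sum along the progression `0 mod aa'` (modulus `≍ A²`, `x/A` terms; nearest theorem for a
  fixed pair: Tao arXiv:1509.05422 Thm 1.2, log-averaged, `o(1)`), and `entries_pos` (`A ≥ |c|` ⇒
  no `Int.toNat` truncation).
* §13 (m) `x0_large`: any admissible `x₀` for `(c,δ,C) = (1,1/12,1)` exceeds `2¹⁴⁴ ≈ 2·10⁴³` (the
  diagonal beats `x²/log x` at `x = 2¹⁴⁴`): numerics can probe structure only, never the claim.
  (Numerics on worst classes: kit job j006586, queued at prio 79 behind a 3000-job backlog.)
* §14 (h') `sum_inv_multiples_le`, `multiples_admissible`: the multiples of ONE modulus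
  `q₁ ≥ 200(1+log x)(log x)^C` are an admissible exceptional set for §10 (Siegel division of labour).
* §15 (g) `false_at_delta_half`: with the crux's own dilation range, `δ = 1/2` is refuted by
  counting (single-column classes for `N² < q ≤ N³` at `x = N¹²`, `A = N¹⁰`); the cheap frontier is
  `δ > 4/9`, and `1/12 < δ ≤ 4/9` is as hard as the crux.

* §16 (n) TARGETS = the four stubs of the registered skeleton `Lines/positivity-quarantine.lean`
  (gen-3, cycle 3; definitions copied verbatim under `PQ`): `crux_imp_genericAffineTable :
  DilatedTableChowla → GenericAffineTable` (the hardest stub C⁺ is crux-implied OUTRIGHT, one-point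
  hypothesis unused — `crux_imp_pointwiseOffSparse`), `genericAffineTable_imp_tableChowla :
  GenericAffineTable → TableChowla` UNCONDITIONALLY (its `q = 1` hypothesis `onePointData_one` is
  Siegel–Walfisz for `λ`, a tree theorem), so `crux → C⁺ → TableChowla` and, with the skeleton's
  composition, `C⁺ ↔ crux` modulo the in-print stubs (Z1), (Z2), (★); degenerate-parameter probes of
  (Z1), (Z2), (★) (`K' ≤ 0`, `θ ≤ 0`: provable slices, no loophole); and a constant-bookkeeping note
  for (★): Borel–Carathéodory centred at `1 + εη` as in the stub's docstring closes with net saving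
  `(log x)^{-K'/12}` at `ε = 1/2` (centring at `1 + η` only ties); the MV Thm 6.7/11.4 differencing
  argument gives `(log x)^{-5K'/32+O(1)}` using only the local box.  Targets broken 0/4; near-misses none.

* §17 (o) `crux_iff_table_and_largeDilations : DilatedTableChowla ↔ TableChowla ∧ LargeDilations B`
  for every `B ≥ 0` (positivity lever (P) of card positivity-quarantine, `F_le_of_dvd`/`F_le_table`,
  proofs credited to triage r1-2 and skeleton §7): beyond the sibling crux stmt-Parity-14270 the
  WHOLE content of this crux is the band of dilations `(log x)^B < q ≤ x^{δ/2}` above every fixed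
  power of `log x`; the route's `SmallDilations` node is empty.

LANDING (gen-3): the sections are being landed as importable modules under
`Theorems/DilatedTableChowla/Negative/` (`DilatedTableChowlaBlocks` = §0, §1, §3-counts, §5
`F_one_eq_table`, §11; further files by topic, ≤ 400 lines each) — import those rather than copying.

How to read: `rows/cols/S/F/lhs` (§0) factor the crux; §1–§3 are bookkeeping lemmas provers may
reuse (`diag_le_F`, `F_le_trivial`, `card_rows_bounds`, `card_cols_bounds`, the scale `x = N²⁴`).
-/

namespace Summit.Parity.GeneralizedHardyLittlewood.Cruxes.DilatedTableChowla.Disproof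

open Summit.Parity.GeneralizedHardyLittlewood.Theses.LiouvilleShiftedTables
open Finset

/-! ## §0 The crux, factored -/

/-- The entry function of the crux: `L n = λ(n.toNat)` as a real number (`L n = 0` for `n ≤ 0`,
since `ArithmeticFunction`s vanish at `0`). -/
noncomputable def L (n : ℤ) : ℝ := (ArithmeticFunction.liouville (Int.toNat n) : ℝ)

/-- Rows of the `(q;u)`-table at scale `A`: `a ∈ (⌊A⌋, ⌊2A⌋]`, `a ≡ u (mod q)`. -/
noncomputable def rows (A : ℝ) (q u : ℕ) : Finset ℕ :=
  (Finset.Ioc ⌊A⌋₊ ⌊2 * A⌋₊).filter (fun a : ℕ => a ≡ u [MOD q])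

/-- Columns: `b ∈ [1, ⌊x/A⌋]`, `b ≡ v (mod q)`. -/
noncomputable def cols (x A : ℝ) (q v : ℕ) : Finset ℕ :=
  (Finset.Icc 1 ⌊x / A⌋₊).filter (fun b : ℕ => b ≡ v [MOD q])

/-- The two-row correlation `S(a,a') = Σ_{b ∈ cols} λ(ab+c) λ(a'b+c)` (an entry of `M Mᵀ`). -/
noncomputable def S (c : ℤ) (x A : ℝ) (q v a a' : ℕ) : ℝ :=
  ∑ b ∈ cols x A q v, L ((a : ℤ) * b + c) * L ((a' : ℤ) * b + c)

/-- The fourth moment `F(q,u,v) = tr (M Mᵀ)² = Σ_{a,a' ∈ rows} S(a,a')²`. -/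
noncomputable def F (c : ℤ) (x A : ℝ) (q u v : ℕ) : ℝ :=
  ∑ a ∈ rows A q u, ∑ a' ∈ rows A q u, (S c x A q v a a') ^ 2

/-- The left-hand side of the crux: `Σ_{1 ≤ q ≤ ⌊x^{δ/2}⌋} q³ · F(q, u q, v q)`. -/
noncomputable def lhs (c : ℤ) (δ x A : ℝ) (u v : ℕ → ℕ) : ℝ :=
  ∑ q ∈ Finset.Icc 1 ⌊x ^ (δ / 2)⌋₊, (q : ℝ) ^ 3 * F c x A q (u q) (v q)

/-- The crux, verbatim, in the factored notation (definitional: `Iff.rfl`). -/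
theorem crux_iff_lhs : DilatedTableChowla ↔
    ∀ c : ℤ, c ≠ 0 → ∀ δ : ℝ, 0 < δ → δ ≤ 1 / 12 → ∀ C : ℝ, 0 < C → ∃ x₀ : ℝ, ∀ x : ℝ, x₀ ≤ x →
      ∀ A : ℝ, x ^ δ ≤ A → A ≤ x ^ (1 / 3 + δ) → ∀ u v : ℕ → ℕ,
        lhs c δ x A u v ≤ x ^ 2 / Real.log x ^ C :=
  Iff.rfl

/-! ## §1 Elementary facts about the entries and the pieces -/

/-- A positive integer has nonzero `toNat`. -/
theorem toNat_ne_zero_of_pos {n : ℤ} (hn : 0 < n) : n.toNat ≠ 0 := by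
  omega

/-- On positive arguments `L n = (-1)^{Ω(n)}`. -/
theorem L_of_pos {n : ℤ} (hn : 0 < n) :
    L n = (-1 : ℝ) ^ (ArithmeticFunction.cardFactors n.toNat) := by
  unfold L
  rw [ArithmeticFunction.liouville_apply (toNat_ne_zero_of_pos hn)]
  push_cast
  rfl

/-- On positive arguments `L n ^ 2 = 1`. -/
theorem L_sq_of_pos {n : ℤ} (hn : 0 < n) : L n ^ 2 = 1 := by
  rw [L_of_pos hn, ← pow_mul, mul_comm, pow_mul]
  norm_num

/-- On positive arguments `L n * L n = 1`. -/
theorem L_mul_self_of_pos {n : ℤ} (hn : 0 < n) : L n * L n = 1 := by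
  rw [← sq]; exact L_sq_of_pos hn

/-- On nonpositive arguments `L n = 0` (truncation by `Int.toNat`). -/
theorem L_nonpos_arg {n : ℤ} (hn : n ≤ 0) : L n = 0 := by
  unfold L
  have : n.toNat = 0 := by omega
  rw [this]; simp

/-- `|L n| ≤ 1` for every integer `n`. -/
theorem abs_L_le_one (n : ℤ) : |L n| ≤ 1 := by
  rcases le_or_gt n 0 with h | h
  · rw [L_nonpos_arg h]; simp
  · rw [L_of_pos h]; simp

/-- `L` on a natural number is the Liouville function. -/
theorem L_natCast (n : ℕ) : L (n : ℤ) = (ArithmeticFunction.liouville n : ℝ) := by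
  unfold L; rw [Int.toNat_natCast]

/-- Complete multiplicativity on naturals: `λ(mn) = λ(m) λ(n)`. -/
theorem L_natCast_mul (m n : ℕ) : L ((m : ℤ) * n) = L m * L n := by
  rw [show ((m : ℤ) * n) = ((m * n : ℕ) : ℤ) by push_cast; ring, L_natCast, L_natCast, L_natCast,
    ArithmeticFunction.liouville_apply_mul]
  push_cast; ring

/-- Membership in `rows`: the dyadic interval and the class condition. -/
theorem mem_rows {A : ℝ} {q u a : ℕ} :
    a ∈ rows A q u ↔ (⌊A⌋₊ < a ∧ a ≤ ⌊2 * A⌋₊) ∧ a ≡ u [MOD q] := by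
  simp [rows, Finset.mem_filter, Finset.mem_Ioc]

/-- Membership in `cols`: `1 ≤ b ≤ ⌊x/A⌋` and the class condition. -/
theorem mem_cols {x A : ℝ} {q v b : ℕ} :
    b ∈ cols x A q v ↔ (1 ≤ b ∧ b ≤ ⌊x / A⌋₊) ∧ b ≡ v [MOD q] := by
  simp [cols, Finset.mem_filter, Finset.mem_Icc]

/-- Rows are positive naturals. -/
theorem one_le_of_mem_rows {A : ℝ} {q u a : ℕ} (h : a ∈ rows A q u) : 1 ≤ a := by
  rw [mem_rows] at h; omega

/-- Columns are positive naturals. -/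
theorem one_le_of_mem_cols {x A : ℝ} {q v b : ℕ} (h : b ∈ cols x A q v) : 1 ≤ b := by
  rw [mem_cols] at h; exact h.1.1

/-- `|S(a,a')| ≤ #cols` for every shift. -/
theorem abs_S_le (c : ℤ) (x A : ℝ) (q v a a' : ℕ) :
    |S c x A q v a a'| ≤ ((cols x A q v).card : ℝ) := by
  unfold S
  calc |∑ b ∈ cols x A q v, L ((a : ℤ) * b + c) * L ((a' : ℤ) * b + c)|
        ≤ ∑ b ∈ cols x A q v, |L ((a : ℤ) * b + c) * L ((a' : ℤ) * b + c)| :=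
          Finset.abs_sum_le_sum_abs _ _
    _ ≤ ∑ b ∈ cols x A q v, (1 : ℝ) := by
          refine Finset.sum_le_sum fun b _ => ?_
          rw [abs_mul]
          have h1 := abs_L_le_one ((a : ℤ) * b + c)
          have h2 := abs_L_le_one ((a' : ℤ) * b + c)
          have h3 := abs_nonneg (L ((a : ℤ) * b + c))
          nlinarith
    _ = ((cols x A q v).card : ℝ) := by simp

/-- `S(a,a')² ≤ #cols²`. -/
theorem S_sq_le (c : ℤ) (x A : ℝ) (q v a a' : ℕ) :
    (S c x A q v a a') ^ 2 ≤ ((cols x A q v).card : ℝ) ^ 2 := by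
  have h := abs_S_le c x A q v a a'
  have h0 : 0 ≤ |S c x A q v a a'| := abs_nonneg _
  calc (S c x A q v a a') ^ 2 = |S c x A q v a a'| ^ 2 := (sq_abs _).symm
    _ ≤ ((cols x A q v).card : ℝ) ^ 2 := by gcongr

/-- On the diagonal there is never cancellation: `S(a,a) = #cols` as soon as every entry
`ab + c` is positive (automatic for `c ≥ 0`; for `c < 0` as soon as `a > |c|`). -/
theorem S_self {c : ℤ} {x A : ℝ} {q v a : ℕ} (h : ∀ b ∈ cols x A q v, 0 < (a : ℤ) * b + c) :
    S c x A q v a a = ((cols x A q v).card : ℝ) := by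
  unfold S
  rw [Finset.sum_congr rfl fun b hb => L_mul_self_of_pos (h b hb)]
  simp

/-- For `c ≥ 0` and `a ≥ 1` the diagonal correlation is `S(a,a) = #cols`. -/
theorem S_self_of_nonneg {c : ℤ} (hc : 0 ≤ c) (x A : ℝ) (q v : ℕ) {a : ℕ} (ha : 1 ≤ a) :
    S c x A q v a a = ((cols x A q v).card : ℝ) := by
  refine S_self fun b hb => ?_
  have hb1 : (1 : ℤ) ≤ b := by exact_mod_cast one_le_of_mem_cols hb
  have ha1 : (1 : ℤ) ≤ a := by exact_mod_cast ha
  nlinarith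

/-- The fourth moment is a sum of squares. -/
theorem F_nonneg (c : ℤ) (x A : ℝ) (q u v : ℕ) : 0 ≤ F c x A q u v :=
  Finset.sum_nonneg fun _ _ => Finset.sum_nonneg fun _ _ => sq_nonneg _

/-- Each weighted term `q³ F(q,u,v)` is nonnegative. -/
theorem term_nonneg (c : ℤ) (x A : ℝ) (q u v : ℕ) : 0 ≤ (q : ℝ) ^ 3 * F c x A q u v :=
  mul_nonneg (by positivity) (F_nonneg c x A q u v)

/-- The left-hand side of the crux is nonnegative. -/
theorem lhs_nonneg (c : ℤ) (δ x A : ℝ) (u v : ℕ → ℕ) : 0 ≤ lhs c δ x A u v :=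
  Finset.sum_nonneg fun q _ => term_nonneg c x A q (u q) (v q)

/-- A single dilation minorises the left side (all terms are nonnegative). -/
theorem term_le_lhs (c : ℤ) (δ x A : ℝ) (u v : ℕ → ℕ) {q₀ : ℕ} (h1 : 1 ≤ q₀)
    (h2 : q₀ ≤ ⌊x ^ (δ / 2)⌋₊) :
    (q₀ : ℝ) ^ 3 * F c x A q₀ (u q₀) (v q₀) ≤ lhs c δ x A u v := by
  unfold lhs
  exact Finset.single_le_sum (f := fun q : ℕ => (q : ℝ) ^ 3 * F c x A q (u q) (v q))
    (fun q _ => term_nonneg c x A q (u q) (v q)) (Finset.mem_Icc.2 ⟨h1, h2⟩)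

/-- The `q = 1` table minorises the left side as soon as `x ≥ 1`. -/
theorem F_one_le_lhs (c : ℤ) {δ x : ℝ} (hδ : 0 ≤ δ) (hx : 1 ≤ x) (A : ℝ) (u v : ℕ → ℕ) :
    F c x A 1 (u 1) (v 1) ≤ lhs c δ x A u v := by
  have h : (1 : ℕ) ≤ ⌊x ^ (δ / 2)⌋₊ := by
    apply Nat.le_floor
    simpa using Real.one_le_rpow hx (by linarith : 0 ≤ δ / 2)
  simpa using term_le_lhs c δ x A u v le_rfl h

/-- The diagonal minorises the fourth moment. -/
theorem diag_le_F (c : ℤ) (x A : ℝ) (q u v : ℕ) :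
    ∑ a ∈ rows A q u, (S c x A q v a a) ^ 2 ≤ F c x A q u v := by
  unfold F
  refine Finset.sum_le_sum fun a ha => ?_
  exact Finset.single_le_sum (f := fun a' => (S c x A q v a a') ^ 2) (fun _ _ => sq_nonneg _) ha

/-- For `c ≥ 0` the diagonal is exactly `#rows · #cols²`. -/
theorem diag_eq_of_nonneg {c : ℤ} (hc : 0 ≤ c) (x A : ℝ) (q u v : ℕ) :
    ∑ a ∈ rows A q u, (S c x A q v a a) ^ 2
      = ((rows A q u).card : ℝ) * ((cols x A q v).card : ℝ) ^ 2 := by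
  rw [Finset.sum_congr rfl fun a ha => by rw [S_self_of_nonneg hc x A q v (one_le_of_mem_rows ha)]]
  simp

/-- For `c ≥ 0` the diagonal `#rows · #cols²` minorises `F`. -/
theorem rows_mul_cols_sq_le_F {c : ℤ} (hc : 0 ≤ c) (x A : ℝ) (q u v : ℕ) :
    ((rows A q u).card : ℝ) * ((cols x A q v).card : ℝ) ^ 2 ≤ F c x A q u v := by
  rw [← diag_eq_of_nonneg hc]; exact diag_le_F c x A q u v

/-- Trivial bound: `F ≤ #rows² #cols²`. -/
theorem F_le_trivial (c : ℤ) (x A : ℝ) (q u v : ℕ) :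
    F c x A q u v ≤ ((rows A q u).card : ℝ) ^ 2 * ((cols x A q v).card : ℝ) ^ 2 := by
  unfold F
  calc ∑ a ∈ rows A q u, ∑ a' ∈ rows A q u, (S c x A q v a a') ^ 2
        ≤ ∑ a ∈ rows A q u, ∑ a' ∈ rows A q u, ((cols x A q v).card : ℝ) ^ 2 :=
          Finset.sum_le_sum fun a _ => Finset.sum_le_sum fun a' _ => S_sq_le c x A q v a a'
    _ = _ := by simp; ring

/-- `q = 1`: no congruence restriction. -/
theorem rows_one (A : ℝ) (u : ℕ) : rows A 1 u = Finset.Ioc ⌊A⌋₊ ⌊2 * A⌋₊ := by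
  unfold rows; exact Finset.filter_true_of_mem fun a _ => Nat.modEq_one

/-- `q = 1`: the column class condition is vacuous. -/
theorem cols_one (x A : ℝ) (v : ℕ) : cols x A 1 v = Finset.Icc 1 ⌊x / A⌋₊ := by
  unfold cols; exact Finset.filter_true_of_mem fun b _ => Nat.modEq_one

/-! ## §2 The shift `c = 0`: the fourth moment IS the trivial bound -/

/-- At `c = 0` every two-row correlation is `± #cols`: `λ(ab)λ(a'b) = λ(a)λ(a')`. -/
theorem S_zero_shift (x A : ℝ) (q v : ℕ) {a a' : ℕ} :
    S 0 x A q v a a' = ((cols x A q v).card : ℝ) * (L a * L a') := by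
  unfold S
  have : ∀ b ∈ cols x A q v, L ((a : ℤ) * b + 0) * L ((a' : ℤ) * b + 0) = L a * L a' := by
    intro b hb
    have hb : (1 : ℤ) ≤ b := by exact_mod_cast one_le_of_mem_cols hb
    rw [add_zero, add_zero, L_natCast_mul, L_natCast_mul]
    have := L_mul_self_of_pos (n := (b : ℤ)) (by linarith)
    linear_combination (L a * L a') * this
  rw [Finset.sum_congr rfl this]; simp

/-- At the shift `c = 0` the fourth moment EQUALS the trivial bound `#rows² · #cols²` (`λ(ab)λ(a'b) = λ(a)λ(a')`). -/
theorem F_zero_shift (x A : ℝ) (q u v : ℕ) :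
    F 0 x A q u v = ((rows A q u).card : ℝ) ^ 2 * ((cols x A q v).card : ℝ) ^ 2 := by
  unfold F
  have : ∀ a ∈ rows A q u, ∀ a' ∈ rows A q u,
      (S 0 x A q v a a') ^ 2 = ((cols x A q v).card : ℝ) ^ 2 := by
    intro a ha a' ha'
    have h1 : (1 : ℤ) ≤ a := by exact_mod_cast one_le_of_mem_rows ha
    have h2 : (1 : ℤ) ≤ a' := by exact_mod_cast one_le_of_mem_rows ha'
    rw [S_zero_shift, mul_pow, mul_pow, L_sq_of_pos (by linarith), L_sq_of_pos (by linarith)]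
    ring
  rw [Finset.sum_congr rfl fun a ha => Finset.sum_congr rfl fun a' ha' => this a ha a' ha']
  simp; ring


/-! ## §3 Counting classes in intervals, power sums, and the scale `x = N²⁴` -/

/-- Two-sided real bounds for the number of `n ∈ (L, M]` in a residue class mod `q`. -/
theorem card_modEq_Ioc_bounds (L M q v : ℕ) (hq : 0 < q) (hLM : L ≤ M) :
    ((M : ℝ) - L) / q - 1 ≤ (((Finset.Ioc L M).filter (fun n : ℕ => n ≡ v [MOD q])).card : ℝ) ∧
    (((Finset.Ioc L M).filter (fun n : ℕ => n ≡ v [MOD q])).card : ℝ) ≤ ((M : ℝ) - L) / q + 1 := by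
  have h := Nat.Ioc_filter_modEq_card L M hq v
  set k := ((Finset.Ioc L M).filter (fun n : ℕ => n ≡ v [MOD q])).card with hk
  have hq' : (0 : ℚ) < q := by exact_mod_cast hq
  have hB1 := Int.floor_le (((M : ℚ) - v) / q)
  have hB2 := Int.lt_floor_add_one (((M : ℚ) - v) / q)
  have hA1 := Int.floor_le (((L : ℚ) - v) / q)
  have hA2 := Int.lt_floor_add_one (((L : ℚ) - v) / q)
  have hdiff : ((M : ℚ) - v) / q - ((L : ℚ) - v) / q = ((M : ℚ) - L) / q := by
    field_simp; ring
  have hLM' : (0 : ℚ) ≤ ((M : ℚ) - L) / q := by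
    apply div_nonneg _ hq'.le
    have : (L : ℚ) ≤ M := by exact_mod_cast hLM
    linarith
  -- work in ℚ, then cast
  have hkQ : ((M : ℚ) - L) / q - 1 ≤ (k : ℚ) ∧ (k : ℚ) ≤ ((M : ℚ) - L) / q + 1 := by
    have hkZ : (k : ℤ) = max (⌊((M : ℚ) - v) / q⌋ - ⌊((L : ℚ) - v) / q⌋) 0 := h
    constructor
    · have : (⌊((M : ℚ) - v) / q⌋ : ℚ) - ⌊((L : ℚ) - v) / q⌋ ≤ (k : ℚ) := by
        have : ⌊((M : ℚ) - v) / q⌋ - ⌊((L : ℚ) - v) / q⌋ ≤ (k : ℤ) := by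
          rw [hkZ]; exact le_max_left _ _
        exact_mod_cast this
      linarith
    · rcases le_or_gt (⌊((M : ℚ) - v) / q⌋ - ⌊((L : ℚ) - v) / q⌋) 0 with hle | hgt
      · have : (k : ℤ) = 0 := by rw [hkZ]; exact max_eq_right hle
        have hk0 : (k : ℚ) = 0 := by exact_mod_cast this
        rw [hk0]; linarith
      · have : (k : ℤ) = ⌊((M : ℚ) - v) / q⌋ - ⌊((L : ℚ) - v) / q⌋ := by
          rw [hkZ]; exact max_eq_left hgt.le
        have hk1 : (k : ℚ) = (⌊((M : ℚ) - v) / q⌋ : ℚ) - ⌊((L : ℚ) - v) / q⌋ := by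
          exact_mod_cast this
        rw [hk1]; linarith
  constructor
  · have := (Rat.cast_le (K := ℝ)).2 hkQ.1
    push_cast at this
    exact this
  · have := (Rat.cast_le (K := ℝ)).2 hkQ.2
    push_cast at this
    exact this

/-- `(⌊2A⌋ − ⌊A⌋)/q − 1 ≤ #rows ≤ (⌊2A⌋ − ⌊A⌋)/q + 1`. -/
theorem card_rows_bounds (A : ℝ) (hA : 0 ≤ A) (q u : ℕ) (hq : 0 < q) :
    ((⌊2 * A⌋₊ : ℝ) - ⌊A⌋₊) / q - 1 ≤ ((rows A q u).card : ℝ) ∧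
      ((rows A q u).card : ℝ) ≤ ((⌊2 * A⌋₊ : ℝ) - ⌊A⌋₊) / q + 1 := by
  unfold rows
  exact card_modEq_Ioc_bounds _ _ q u hq (Nat.floor_le_floor (by linarith))

/-- `cols` as a filtered `Ioc 0 ⌊x/A⌋`. -/
theorem cols_eq_Ioc (x A : ℝ) (q v : ℕ) :
    cols x A q v = (Finset.Ioc 0 ⌊x / A⌋₊).filter (fun b : ℕ => b ≡ v [MOD q]) := by
  unfold cols; rfl

/-- `⌊x/A⌋/q − 1 ≤ #cols ≤ ⌊x/A⌋/q + 1`. -/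
theorem card_cols_bounds (x A : ℝ) (q v : ℕ) (hq : 0 < q) :
    (⌊x / A⌋₊ : ℝ) / q - 1 ≤ ((cols x A q v).card : ℝ) ∧
      ((cols x A q v).card : ℝ) ≤ (⌊x / A⌋₊ : ℝ) / q + 1 := by
  rw [cols_eq_Ioc]
  have := card_modEq_Ioc_bounds 0 ⌊x / A⌋₊ q v hq (Nat.zero_le _)
  simpa using this

/-- `a` itself lies in its own class of rows when `⌊A⌋ < a ≤ ⌊2A⌋`. -/
theorem self_mem_rows {A : ℝ} {q a : ℕ} (h1 : ⌊A⌋₊ < a) (h2 : a ≤ ⌊2 * A⌋₊) : a ∈ rows A q a :=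
  mem_rows.2 ⟨⟨h1, h2⟩, Nat.ModEq.refl a⟩

/-- The class of an element of the window is a nonempty row set. -/
theorem one_le_card_rows_self {A : ℝ} {q a : ℕ} (h1 : ⌊A⌋₊ < a) (h2 : a ≤ ⌊2 * A⌋₊) :
    (1 : ℝ) ≤ ((rows A q a).card : ℝ) := by
  have : 1 ≤ (rows A q a).card := Finset.card_pos.2 ⟨a, self_mem_rows h1 h2⟩
  exact_mod_cast this

/-- `Σ_{q=1}^{n} q³ ≥ n⁴/4`. -/
theorem sum_Icc_pow_three_ge (n : ℕ) : ((n : ℝ)) ^ 4 / 4 ≤ ∑ q ∈ Finset.Icc 1 n, ((q : ℝ)) ^ 3 := by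
  induction n with
  | zero => simp
  | succ k ih =>
    rw [Finset.sum_Icc_succ_top (Nat.succ_le_succ (Nat.zero_le k))]
    push_cast
    nlinarith [sq_nonneg ((k : ℝ)), sq_nonneg ((k : ℝ) + 1), (Nat.cast_nonneg k : (0:ℝ) ≤ k)]

/-- `Σ_{q=1}^{n} q⁴ ≥ n⁵/5`. -/
theorem sum_Icc_pow_four_ge (n : ℕ) : ((n : ℝ)) ^ 5 / 5 ≤ ∑ q ∈ Finset.Icc 1 n, ((q : ℝ)) ^ 4 := by
  induction n with
  | zero => simp
  | succ k ih =>
    rw [Finset.sum_Icc_succ_top (Nat.succ_le_succ (Nat.zero_le k))]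
    push_cast
    nlinarith [sq_nonneg ((k : ℝ)), sq_nonneg ((k : ℝ) + 1), (Nat.cast_nonneg k : (0:ℝ) ≤ k),
      pow_nonneg (Nat.cast_nonneg k : (0:ℝ) ≤ k) 3, pow_nonneg (Nat.cast_nonneg k : (0:ℝ) ≤ k) 4]

/-- `Σ_{q=1}^{n} q ≥ n²/2`. -/
theorem sum_Icc_pow_one_ge (n : ℕ) : ((n : ℝ)) ^ 2 / 2 ≤ ∑ q ∈ Finset.Icc 1 n, ((q : ℝ)) := by
  induction n with
  | zero => simp
  | succ k ih =>
    rw [Finset.sum_Icc_succ_top (Nat.succ_le_succ (Nat.zero_le k))]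
    push_cast
    nlinarith

/-! ### The scale `x = N²⁴` (`δ = 1/12`: `x^δ = N²`, `x^{δ/2} = N`, `x^{1/3+δ} = N¹⁰`) -/

/-- `(N²⁴)^e = N^{24e}` (real powers). -/
theorem rpow_pow24 (N : ℕ) (e : ℝ) : (((N : ℝ) ^ 24) : ℝ) ^ e = (N : ℝ) ^ (24 * e) := by
  rw [show ((N : ℝ) ^ 24 : ℝ) = (N : ℝ) ^ ((24 : ℕ) : ℝ) by rw [Real.rpow_natCast],
    ← Real.rpow_mul (Nat.cast_nonneg N)]
  norm_num

/-- `(N²⁴)^e = N^k` when `24e = k`. -/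
theorem pow24_rpow_eq_pow (N : ℕ) {e : ℝ} {k : ℕ} (h : 24 * e = k) :
    (((N : ℝ) ^ 24) : ℝ) ^ e = (N : ℝ) ^ k := by
  rw [rpow_pow24, h, Real.rpow_natCast]

/-- `⌊N^k⌋₊ = N^k`. -/
theorem floor_natCast_pow (N k : ℕ) : ⌊((N : ℝ)) ^ k⌋₊ = N ^ k := by
  rw [← Nat.cast_pow, Nat.floor_natCast]

/-- `⌊2 N^k⌋₊ = 2 N^k`. -/
theorem floor_two_mul_natCast_pow (N k : ℕ) : ⌊2 * ((N : ℝ)) ^ k⌋₊ = 2 * N ^ k := by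
  rw [show (2 : ℝ) * (N : ℝ) ^ k = ((2 * N ^ k : ℕ) : ℝ) by push_cast; ring, Nat.floor_natCast]

/-- `N²⁴ / N^j = N^{24−j}` for `j ≤ 24`, `N ≠ 0`. -/
theorem pow24_div_pow (N : ℕ) (hN : N ≠ 0) {j : ℕ} (hj : j ≤ 24) :
    ((N : ℝ)) ^ 24 / (N : ℝ) ^ j = (N : ℝ) ^ (24 - j) := by
  have hN' : (N : ℝ) ≠ 0 := by exact_mod_cast hN
  rw [div_eq_iff (pow_ne_zero _ hN'), ← pow_add, Nat.sub_add_cancel hj]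

/-- `log (N²⁴) = 24 log N`. -/
theorem log_pow24 (N : ℕ) : Real.log (((N : ℝ)) ^ 24) = 24 * Real.log N := by
  rw [Real.log_pow]; norm_num

/-- `16 < log (N²⁴)` for `N ≥ 2`. -/
theorem sixteen_lt_log_pow24 {N : ℕ} (hN : 2 ≤ N) : 16 < Real.log (((N : ℝ)) ^ 24) := by
  rw [log_pow24]
  have h2 : Real.log 2 ≤ Real.log N := Real.log_le_log two_pos (by exact_mod_cast hN)
  have := Real.log_two_gt_d9
  linarith

/-- `1 ≤ N²⁴` for `N ≥ 1`. -/
theorem one_le_pow24 {N : ℕ} (hN : 1 ≤ N) : (1 : ℝ) ≤ ((N : ℝ)) ^ 24 :=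
  one_le_pow₀ (by exact_mod_cast hN)

/-- `N ≤ N²⁴` for `N ≥ 1`. -/
theorem self_le_pow24 {N : ℕ} (hN : 1 ≤ N) : (N : ℝ) ≤ ((N : ℝ)) ^ 24 :=
  le_self_pow₀ (by exact_mod_cast hN) (by norm_num)

/-- With `C = 1` the right-hand side at `x = N²⁴` is `< N⁴⁸/16`. -/
theorem rhs_pow24_lt {N : ℕ} (hN : 2 ≤ N) :
    (((N : ℝ)) ^ 24) ^ 2 / Real.log (((N : ℝ)) ^ 24) ^ (1 : ℝ) < ((N : ℝ)) ^ 48 / 16 := by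
  rw [Real.rpow_one, ← pow_mul, log_pow24]
  norm_num
  have hlog : (16 : ℝ) < 24 * Real.log N := by
    have := sixteen_lt_log_pow24 hN; rwa [log_pow24] at this
  have hpos : (0 : ℝ) < (N : ℝ) ^ 48 := by
    have : (0 : ℝ) < N := by exact_mod_cast (by omega : 0 < N)
    positivity
  exact div_lt_div_of_pos_left hpos (by norm_num) hlog

/-- Choosing the scale: a natural number `N ≥ m` with `N ≥ x₀` (hence `N²⁴ ≥ x₀`). -/
theorem exists_scale (x₀ : ℝ) (m : ℕ) (hm : 1 ≤ m) :
    ∃ N : ℕ, m ≤ N ∧ x₀ ≤ (N : ℝ) ∧ x₀ ≤ ((N : ℝ)) ^ 24 := by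
  obtain ⟨N, hN⟩ := exists_nat_ge (max x₀ m)
  have h1 : (m : ℝ) ≤ N := le_trans (le_max_right _ _) hN
  have h2 : x₀ ≤ N := le_trans (le_max_left _ _) hN
  have hmN : m ≤ N := by exact_mod_cast h1
  exact ⟨N, hmN, h2, h2.trans (self_le_pow24 (hm.trans hmN))⟩

/-! ## §4 (a) LOAD-BEARING hypotheses: the crux with one hypothesis dropped is FALSE

Every stated hypothesis except `0 < C` is used by any proof. -/

/-- The crux with the hypothesis `c ≠ 0` dropped. -/
def WithoutShiftNeZero : Prop :=
  ∀ c : ℤ, ∀ δ : ℝ, 0 < δ → δ ≤ 1 / 12 → ∀ C : ℝ, 0 < C → ∃ x₀ : ℝ, ∀ x : ℝ, x₀ ≤ x →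
    ∀ A : ℝ, x ^ δ ≤ A → A ≤ x ^ (1 / 3 + δ) → ∀ u v : ℕ → ℕ,
      lhs c δ x A u v ≤ x ^ 2 / Real.log x ^ C

/-- The crux with `0 < δ` dropped. -/
def WithoutDeltaPos : Prop :=
  ∀ c : ℤ, c ≠ 0 → ∀ δ : ℝ, δ ≤ 1 / 12 → ∀ C : ℝ, 0 < C → ∃ x₀ : ℝ, ∀ x : ℝ, x₀ ≤ x →
    ∀ A : ℝ, x ^ δ ≤ A → A ≤ x ^ (1 / 3 + δ) → ∀ u v : ℕ → ℕ,
      lhs c δ x A u v ≤ x ^ 2 / Real.log x ^ C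

/-- The crux with `δ ≤ 1/12` dropped. -/
def WithoutDeltaLe : Prop :=
  ∀ c : ℤ, c ≠ 0 → ∀ δ : ℝ, 0 < δ → ∀ C : ℝ, 0 < C → ∃ x₀ : ℝ, ∀ x : ℝ, x₀ ≤ x →
    ∀ A : ℝ, x ^ δ ≤ A → A ≤ x ^ (1 / 3 + δ) → ∀ u v : ℕ → ℕ,
      lhs c δ x A u v ≤ x ^ 2 / Real.log x ^ C

/-- The crux with the lower window `x^δ ≤ A` dropped. -/
def WithoutLowerWindow : Prop :=
  ∀ c : ℤ, c ≠ 0 → ∀ δ : ℝ, 0 < δ → δ ≤ 1 / 12 → ∀ C : ℝ, 0 < C → ∃ x₀ : ℝ, ∀ x : ℝ, x₀ ≤ x →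
    ∀ A : ℝ, A ≤ x ^ (1 / 3 + δ) → ∀ u v : ℕ → ℕ,
      lhs c δ x A u v ≤ x ^ 2 / Real.log x ^ C

/-- The crux with the upper window `A ≤ x^{1/3+δ}` dropped. -/
def WithoutUpperWindow : Prop :=
  ∀ c : ℤ, c ≠ 0 → ∀ δ : ℝ, 0 < δ → δ ≤ 1 / 12 → ∀ C : ℝ, 0 < C → ∃ x₀ : ℝ, ∀ x : ℝ, x₀ ≤ x →
    ∀ A : ℝ, x ^ δ ≤ A → ∀ u v : ℕ → ℕ,
      lhs c δ x A u v ≤ x ^ 2 / Real.log x ^ C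

/-- The crux with `0 < C` dropped (all real `C`). -/
def WithoutCPos : Prop :=
  ∀ c : ℤ, c ≠ 0 → ∀ δ : ℝ, 0 < δ → δ ≤ 1 / 12 → ∀ C : ℝ, ∃ x₀ : ℝ, ∀ x : ℝ, x₀ ≤ x →
    ∀ A : ℝ, x ^ δ ≤ A → A ≤ x ^ (1 / 3 + δ) → ∀ u v : ℕ → ℕ,
      lhs c δ x A u v ≤ x ^ 2 / Real.log x ^ C

/-- (a1) `c ≠ 0` is load-bearing: at `c = 0`, `λ(ab)λ(a'b) = λ(a)λ(a')` and the `q = 1` table alone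
has fourth moment `#rows² #cols² = x²` exactly (witness `δ = 1/12`, `C = 1`, `x = N²⁴`, `A = N²`). -/
theorem false_without_shift_ne_zero : ¬ WithoutShiftNeZero := by
  intro h
  obtain ⟨x₀, hx₀⟩ := h 0 (1 / 12) (by norm_num) le_rfl 1 one_pos
  obtain ⟨N, hN2, -, hxN⟩ := exists_scale x₀ 2 (by norm_num)
  have hN1 : 1 ≤ N := by omega
  have hN0 : N ≠ 0 := by omega
  set x : ℝ := ((N : ℝ)) ^ 24 with hx
  have hA1 : x ^ (1 / 12 : ℝ) ≤ (N : ℝ) ^ 2 := (pow24_rpow_eq_pow N (by norm_num)).le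
  have hA2 : ((N : ℝ)) ^ 2 ≤ x ^ (1 / 3 + 1 / 12 : ℝ) := by
    rw [hx, pow24_rpow_eq_pow N (k := 10) (by norm_num)]
    exact pow_le_pow_right₀ (by exact_mod_cast hN1) (by norm_num)
  have key := hx₀ x hxN ((N : ℝ) ^ 2) hA1 hA2 (fun _ => 0) (fun _ => 0)
  have hF : F 0 x ((N : ℝ) ^ 2) 1 0 0 = ((N : ℝ)) ^ 48 := by
    rw [F_zero_shift, rows_one, cols_one, floor_natCast_pow, floor_two_mul_natCast_pow,
      Nat.card_Ioc, hx, pow24_div_pow N hN0 (by norm_num), floor_natCast_pow, Nat.card_Icc]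
    rw [show 2 * N ^ 2 - N ^ 2 = N ^ 2 by omega, show N ^ (24 - 2) + 1 - 1 = N ^ 22 by norm_num]
    push_cast; ring
  have hlow : ((N : ℝ)) ^ 48 ≤ lhs 0 (1 / 12) x ((N : ℝ) ^ 2) (fun _ => 0) (fun _ => 0) := by
    rw [← hF]
    exact F_one_le_lhs 0 (by norm_num) (one_le_pow24 hN1) _ (fun _ => 0) (fun _ => 0)
  have hrhs := rhs_pow24_lt hN2
  have hpos : (0 : ℝ) ≤ (N : ℝ) ^ 48 := by positivity
  linarith

/-- (a2) `0 < δ` is load-bearing: at `δ = 0` the window admits `A = 1`, a one-row table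
(`a = 2`), whose fourth moment is `#cols² = x²` (witness `c = 1`, `C = 1`, `x = N²⁴`). -/
theorem false_without_delta_pos : ¬ WithoutDeltaPos := by
  intro h
  obtain ⟨x₀, hx₀⟩ := h 1 one_ne_zero 0 (by norm_num) 1 one_pos
  obtain ⟨N, hN2, -, hxN⟩ := exists_scale x₀ 2 (by norm_num)
  have hN1 : 1 ≤ N := by omega
  set x : ℝ := ((N : ℝ)) ^ 24 with hx
  have hx1 : 1 ≤ x := one_le_pow24 hN1
  have hA1 : x ^ (0 : ℝ) ≤ (1 : ℝ) := by rw [Real.rpow_zero]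
  have hA2 : (1 : ℝ) ≤ x ^ (1 / 3 + 0 : ℝ) := Real.one_le_rpow hx1 (by norm_num)
  have key := hx₀ x hxN 1 hA1 hA2 (fun _ => 2) (fun _ => 0)
  have hrows : rows 1 1 2 = {2} := by
    rw [rows_one]; norm_num
  have hcols : (cols x 1 1 0).card = N ^ 24 := by
    rw [cols_one, div_one, hx, floor_natCast_pow, Nat.card_Icc]; omega
  have hlow : ((N : ℝ)) ^ 48 ≤ lhs 1 0 x 1 (fun _ => 2) (fun _ => 0) := by
    have h1 := rows_mul_cols_sq_le_F (c := 1) (by norm_num) x 1 1 2 0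
    rw [hrows, hcols, Finset.card_singleton] at h1
    push_cast at h1
    rw [one_mul, ← pow_mul] at h1
    have h2 : F 1 x 1 1 2 0 ≤ lhs 1 0 x 1 (fun _ => 2) (fun _ => 0) :=
      F_one_le_lhs 1 (le_refl (0:ℝ)) hx1 1 (fun _ => 2) (fun _ => 0)
    exact h1.trans h2
  have hrhs := rhs_pow24_lt hN2
  have hpos : (0 : ℝ) ≤ (N : ℝ) ^ 48 := by positivity
  linarith

/-- With one column (`⌊x/A⌋ = 1`) every `S(a,a')² = 1` for `c ≥ 0`: no cancellation at all. -/
theorem F_one_col {c : ℤ} (hc : 0 ≤ c) {x A : ℝ} (hxA : ⌊x / A⌋₊ = 1) (u : ℕ) :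
    F c x A 1 u 0 = (((rows A 1 u).card : ℝ)) ^ 2 := by
  unfold F
  have hcols : cols x A 1 0 = {1} := by rw [cols_one, hxA]; rfl
  have : ∀ a ∈ rows A 1 u, ∀ a' ∈ rows A 1 u, (S c x A 1 0 a a') ^ 2 = 1 := by
    intro a ha a' ha'
    have h1 : (1 : ℤ) ≤ a := by exact_mod_cast one_le_of_mem_rows ha
    have h2 : (1 : ℤ) ≤ a' := by exact_mod_cast one_le_of_mem_rows ha'
    unfold S
    rw [hcols, Finset.sum_singleton, mul_pow, L_sq_of_pos (by push_cast; linarith),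
      L_sq_of_pos (by push_cast; linarith), mul_one]
  rw [Finset.sum_congr rfl fun a ha => Finset.sum_congr rfl fun a' ha' => this a ha a' ha']
  simp; ring

/-- (a3) `δ ≤ 1/12` (some upper bound on `δ`) is load-bearing: at `δ = 1`, `A = x` is admissible,
the table has one column and `F = #rows² = x²` (the negatives-index pattern of stmt-Parity-4218). -/
theorem false_without_delta_le : ¬ WithoutDeltaLe := by
  intro h
  obtain ⟨x₀, hx₀⟩ := h 1 one_ne_zero 1 one_pos 1 one_pos
  obtain ⟨N, hN2, -, hxN⟩ := exists_scale x₀ 2 (by norm_num)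
  have hN1 : 1 ≤ N := by omega
  have hN0 : N ≠ 0 := by omega
  set x : ℝ := ((N : ℝ)) ^ 24 with hx
  have hx1 : 1 ≤ x := one_le_pow24 hN1
  have hxpos : 0 < x := by linarith
  have hA1 : x ^ (1 : ℝ) ≤ x := by rw [Real.rpow_one]
  have hA2 : x ≤ x ^ (1 / 3 + 1 : ℝ) := by
    calc x = x ^ (1 : ℝ) := (Real.rpow_one x).symm
      _ ≤ x ^ (1 / 3 + 1 : ℝ) := Real.rpow_le_rpow_of_exponent_le hx1 (by norm_num)
  have key := hx₀ x hxN x hA1 hA2 (fun _ => 0) (fun _ => 0)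
  have hxA : ⌊x / x⌋₊ = 1 := by rw [div_self hxpos.ne', Nat.floor_one]
  have hF : F 1 x x 1 0 0 = ((N : ℝ)) ^ 48 := by
    rw [F_one_col (by norm_num) hxA, rows_one, hx, floor_natCast_pow, floor_two_mul_natCast_pow,
      Nat.card_Ioc, show 2 * N ^ 24 - N ^ 24 = N ^ 24 by omega]
    push_cast; ring
  have hlow : ((N : ℝ)) ^ 48 ≤ lhs 1 1 x x (fun _ => 0) (fun _ => 0) := by
    rw [← hF]; exact F_one_le_lhs 1 (by norm_num) hx1 x (fun _ => 0) (fun _ => 0)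
  have hrhs := rhs_pow24_lt hN2
  have hpos : (0 : ℝ) ≤ (N : ℝ) ^ 48 := by positivity
  linarith

/-- (a4) the lower window `x^δ ≤ A` is load-bearing: `A = 1` gives the one-row table `a = 2`
with `x` columns and `F ≥ x²` (witness `c = 1`, `δ = 1/12`, `C = 1`, `x = N²⁴`). -/
theorem false_without_lower_window : ¬ WithoutLowerWindow := by
  intro h
  obtain ⟨x₀, hx₀⟩ := h 1 one_ne_zero (1 / 12) (by norm_num) le_rfl 1 one_pos
  obtain ⟨N, hN2, -, hxN⟩ := exists_scale x₀ 2 (by norm_num)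
  have hN1 : 1 ≤ N := by omega
  set x : ℝ := ((N : ℝ)) ^ 24 with hx
  have hx1 : 1 ≤ x := one_le_pow24 hN1
  have hA2 : (1 : ℝ) ≤ x ^ (1 / 3 + 1 / 12 : ℝ) := Real.one_le_rpow hx1 (by norm_num)
  have key := hx₀ x hxN 1 hA2 (fun _ => 2) (fun _ => 0)
  have hrows : rows 1 1 2 = {2} := by
    rw [rows_one]; norm_num
  have hcols : (cols x 1 1 0).card = N ^ 24 := by
    rw [cols_one, div_one, hx, floor_natCast_pow, Nat.card_Icc]; omega
  have hlow : ((N : ℝ)) ^ 48 ≤ lhs 1 (1 / 12) x 1 (fun _ => 2) (fun _ => 0) := by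
    have h1 := rows_mul_cols_sq_le_F (c := 1) (by norm_num) x 1 1 2 0
    rw [hrows, hcols, Finset.card_singleton] at h1
    push_cast at h1
    rw [one_mul, ← pow_mul] at h1
    have h2 : F 1 x 1 1 2 0 ≤ lhs 1 (1 / 12) x 1 (fun _ => 2) (fun _ => 0) :=
      F_one_le_lhs 1 (by norm_num : (0:ℝ) ≤ 1 / 12) hx1 1 (fun _ => 2) (fun _ => 0)
    exact h1.trans h2
  have hrhs := rhs_pow24_lt hN2
  have hpos : (0 : ℝ) ≤ (N : ℝ) ^ 48 := by positivity
  linarith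

/-- (a5) the upper window `A ≤ x^{1/3+δ}` is load-bearing: `A = x` gives one column, `F = x²`
(witness `c = 1`, `δ = 1/12`, `C = 1`, `x = N²⁴`). -/
theorem false_without_upper_window : ¬ WithoutUpperWindow := by
  intro h
  obtain ⟨x₀, hx₀⟩ := h 1 one_ne_zero (1 / 12) (by norm_num) le_rfl 1 one_pos
  obtain ⟨N, hN2, -, hxN⟩ := exists_scale x₀ 2 (by norm_num)
  have hN1 : 1 ≤ N := by omega
  set x : ℝ := ((N : ℝ)) ^ 24 with hx
  have hx1 : 1 ≤ x := one_le_pow24 hN1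
  have hxpos : 0 < x := by linarith
  have hA1 : x ^ (1 / 12 : ℝ) ≤ x := by
    calc x ^ (1 / 12 : ℝ) ≤ x ^ (1 : ℝ) := Real.rpow_le_rpow_of_exponent_le hx1 (by norm_num)
      _ = x := Real.rpow_one x
  have key := hx₀ x hxN x hA1 (fun _ => 0) (fun _ => 0)
  have hxA : ⌊x / x⌋₊ = 1 := by rw [div_self hxpos.ne', Nat.floor_one]
  have hF : F 1 x x 1 0 0 = ((N : ℝ)) ^ 48 := by
    rw [F_one_col (by norm_num) hxA, rows_one, hx, floor_natCast_pow, floor_two_mul_natCast_pow,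
      Nat.card_Ioc, show 2 * N ^ 24 - N ^ 24 = N ^ 24 by omega]
    push_cast; ring
  have hlow : ((N : ℝ)) ^ 48 ≤ lhs 1 (1 / 12) x x (fun _ => 0) (fun _ => 0) := by
    rw [← hF]; exact F_one_le_lhs 1 (by norm_num) hx1 x (fun _ => 0) (fun _ => 0)
  have hrhs := rhs_pow24_lt hN2
  have hpos : (0 : ℝ) ≤ (N : ℝ) ^ 48 := by positivity
  linarith

/-- (a6) `0 < C` is NOT load-bearing: the crux implies its `C`-unrestricted form
(the claim is monotone in `C` once `log x ≥ 1`). -/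
theorem withoutCPos_of_crux (h : DilatedTableChowla) : WithoutCPos := by
  rw [crux_iff_lhs] at h
  intro c hc δ hδ hδ' C
  rcases lt_or_ge 0 C with hC | hC
  · exact h c hc δ hδ hδ' C hC
  · obtain ⟨x₀, hx₀⟩ := h c hc δ hδ hδ' 1 one_pos
    refine ⟨max x₀ 3, fun x hx A hA1 hA2 u v => ?_⟩
    have hx0 : x₀ ≤ x := le_trans (le_max_left _ _) hx
    have hx3 : (3 : ℝ) ≤ x := le_trans (le_max_right _ _) hx
    have key := hx₀ x hx0 A hA1 hA2 u v
    have hlog : 1 ≤ Real.log x := by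
      rw [Real.le_log_iff_exp_le (by linarith)]
      have := Real.exp_one_lt_d9
      linarith
    refine key.trans (div_le_div_of_nonneg_left (by positivity) (Real.rpow_pos_of_pos (by linarith) C) ?_)
    calc Real.log x ^ C ≤ Real.log x ^ (1 : ℝ) := Real.rpow_le_rpow_of_exponent_le hlog (by linarith)
      _ = Real.log x ^ (1 : ℝ) := rfl

/-! ## §5 What the crux contains: the `q = 1` slice (`TableChowla`) and every FIXED modulus -/

/-- The `q = 1` block (any classes) is the plain table sum of `TableChowla`. -/
theorem F_one_eq_table (c : ℤ) (x A : ℝ) (u v : ℕ) :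
    F c x A 1 u v = ∑ a ∈ Finset.Ioc ⌊A⌋₊ ⌊2 * A⌋₊, ∑ a' ∈ Finset.Ioc ⌊A⌋₊ ⌊2 * A⌋₊,
      (∑ b ∈ Finset.Icc 1 ⌊x / A⌋₊, (ArithmeticFunction.liouville (Int.toNat ((a : ℤ) * b + c)) : ℝ) *
        (ArithmeticFunction.liouville (Int.toNat ((a' : ℤ) * b + c)) : ℝ)) ^ 2 := by
  unfold F S
  rw [rows_one, cols_one]
  rfl

/-- (i) The `[deps: TableChowla]` edge: the crux implies its `q = 1` slice `TableChowla`
(stmt-Parity-14270) — drop the dilations `q ≥ 2`. -/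
theorem crux_imp_tableChowla (h : DilatedTableChowla) : TableChowla := by
  rw [crux_iff_lhs] at h
  intro c hc δ hδ hδ' C hC
  obtain ⟨x₀, hx₀⟩ := h c hc δ hδ hδ' C hC
  refine ⟨max x₀ 1, fun x hx A hA1 hA2 => ?_⟩
  have hx0 : x₀ ≤ x := le_trans (le_max_left _ _) hx
  have hx1 : (1 : ℝ) ≤ x := le_trans (le_max_right _ _) hx
  have key := hx₀ x hx0 A hA1 hA2 (fun _ => 0) (fun _ => 0)
  have h1 := F_one_le_lhs c hδ.le hx1 A (fun _ => 0) (fun _ => 0)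
  rw [F_one_eq_table] at h1
  exact h1.trans key

/-- (k) NECESSITY OF BEATING EVERY CLASS AT EVERY FIXED MODULUS. For each fixed `q₀ ≥ 1` the crux
forces `q₀³ F(q₀,u,v) ≤ x²/(log x)^C` for ALL classes `(u,v)` and all large `x`: the `ℓ¹`-average
over dilations gives no protection to any single small modulus (only to sparse sets of large ones,
see §10). In particular a Siegel-type obstruction at ONE bounded conductor would refute the crux. -/
theorem crux_imp_fixedModulus (h : DilatedTableChowla) {q₀ : ℕ} (hq₀ : 1 ≤ q₀) :
    ∀ c : ℤ, c ≠ 0 → ∀ δ : ℝ, 0 < δ → δ ≤ 1 / 12 → ∀ C : ℝ, 0 < C → ∃ x₀ : ℝ, ∀ x : ℝ, x₀ ≤ x →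
      ∀ A : ℝ, x ^ δ ≤ A → A ≤ x ^ (1 / 3 + δ) → ∀ u₀ v₀ : ℕ,
        (q₀ : ℝ) ^ 3 * F c x A q₀ u₀ v₀ ≤ x ^ 2 / Real.log x ^ C := by
  rw [crux_iff_lhs] at h
  intro c hc δ hδ hδ' C hC
  obtain ⟨x₀, hx₀⟩ := h c hc δ hδ hδ' C hC
  refine ⟨max x₀ ((q₀ : ℝ) ^ (2 / δ)), fun x hx A hA1 hA2 u₀ v₀ => ?_⟩
  have hx0 : x₀ ≤ x := le_trans (le_max_left _ _) hx
  have hxq : (q₀ : ℝ) ^ (2 / δ) ≤ x := le_trans (le_max_right _ _) hx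
  have hq0' : (0 : ℝ) ≤ q₀ := Nat.cast_nonneg q₀
  have hq : q₀ ≤ ⌊x ^ (δ / 2)⌋₊ := by
    apply Nat.le_floor
    have h1 : ((q₀ : ℝ) ^ (2 / δ)) ^ (δ / 2) ≤ x ^ (δ / 2) :=
      Real.rpow_le_rpow (by positivity) hxq (by linarith)
    rwa [← Real.rpow_mul hq0', show 2 / δ * (δ / 2) = 1 by field_simp, Real.rpow_one] at h1
  have key := hx₀ x hx0 A hA1 hA2 (fun _ => u₀) (fun _ => v₀)
  exact (term_le_lhs c δ x A (fun _ => u₀) (fun _ => v₀) hq₀ hq).trans key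


/-! ## §6 (b) TIGHTNESS of the normalisation: three natural strengthenings are FALSE by the diagonal

The claim `x²/(log x)^C` sits exactly a factor `x^{δ/2}` (up to constants) above the diagonal
`Σ_q q³ · #rows_q · #cols_q² ≍ x^{δ/2} · x²/A`; so the (log x)^{-C} must come entirely from
DISTINCT rows, and none of the three parameters (window bottom, dilation range, weight) can be
pushed: each of the following variants is refuted by the diagonal alone (`c = 1`). -/

/-- `⌊2N⌋₊ = 2N`. -/
theorem floor_two_mul_natCast (N : ℕ) : ⌊2 * (N : ℝ)⌋₊ = 2 * N := by
  rw [show (2 : ℝ) * (N : ℝ) = ((2 * N : ℕ) : ℝ) by push_cast; ring, Nat.floor_natCast]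

/-- `N²⁴ / N = N²³` for `N ≠ 0`. -/
theorem pow24_div_self (N : ℕ) (hN : N ≠ 0) : ((N : ℝ)) ^ 24 / (N : ℝ) = (N : ℝ) ^ 23 := by
  have hN' : (N : ℝ) ≠ 0 := by exact_mod_cast hN
  rw [div_eq_iff hN', ← pow_succ]

/-- Lower bound for `F` from lower bounds on the class sizes (`c ≥ 0`). -/
theorem F_ge_of_bounds {c : ℤ} (hc : 0 ≤ c) (x A : ℝ) (q u v : ℕ) {r k : ℝ}
    (hk0 : 0 ≤ k) (hr : r ≤ ((rows A q u).card : ℝ)) (hk : k ≤ ((cols x A q v).card : ℝ)) :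
    r * k ^ 2 ≤ F c x A q u v := by
  refine le_trans ?_ (rows_mul_cols_sq_le_F hc x A q u v)
  gcongr

/-- The crux with the lower window halved: `x^{δ/2} ≤ A` instead of `x^δ ≤ A`. -/
def WithLowerWindowHalved : Prop :=
  ∀ c : ℤ, c ≠ 0 → ∀ δ : ℝ, 0 < δ → δ ≤ 1 / 12 → ∀ C : ℝ, 0 < C → ∃ x₀ : ℝ, ∀ x : ℝ, x₀ ≤ x →
    ∀ A : ℝ, x ^ (δ / 2) ≤ A → A ≤ x ^ (1 / 3 + δ) → ∀ u v : ℕ → ℕ,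
      lhs c δ x A u v ≤ x ^ 2 / Real.log x ^ C

/-- (b1) The window cannot start at `x^{δ/2}` (= the dilation range): at `A = x^{δ/2} = N` every
class `u q := 2N` has the row `a = 2N`, the columns `b ≡ 0 (q)` number `≥ N²³/(2q)`, and the diagonal
gives `lhs ≥ Σ_{q ≤ N} q³ (N²³/(2q))² ≥ N⁴⁸/8 > x²/log x`. -/
theorem false_with_lower_window_halved : ¬ WithLowerWindowHalved := by
  intro h
  obtain ⟨x₀, hx₀⟩ := h 1 one_ne_zero (1 / 12) (by norm_num) le_rfl 1 one_pos
  obtain ⟨N, hN2, -, hxN⟩ := exists_scale x₀ 2 (by norm_num)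
  have hN1 : 1 ≤ N := by omega
  have hN0 : N ≠ 0 := by omega
  have hNpos : (0 : ℝ) < N := by exact_mod_cast (by omega : 0 < N)
  set x : ℝ := ((N : ℝ)) ^ 24 with hx
  have hQ1 : x ^ ((1 / 12 : ℝ) / 2) = N := by
    rw [hx, pow24_rpow_eq_pow N (k := 1) (by norm_num), pow_one]
  have hA1 : x ^ ((1 / 12 : ℝ) / 2) ≤ (N : ℝ) := hQ1.le
  have hA2 : (N : ℝ) ≤ x ^ (1 / 3 + 1 / 12 : ℝ) := by
    rw [hx, pow24_rpow_eq_pow N (k := 10) (by norm_num)]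
    exact le_self_pow₀ (by exact_mod_cast hN1) (by norm_num)
  have key := hx₀ x hxN N hA1 hA2 (fun _ => 2 * N) (fun _ => 0)
  have hQ : ⌊x ^ ((1 / 12 : ℝ) / 2)⌋₊ = N := by rw [hQ1, Nat.floor_natCast]
  have hfl1 : ⌊(N : ℝ)⌋₊ = N := Nat.floor_natCast N
  have hfl2 : ⌊2 * (N : ℝ)⌋₊ = 2 * N := floor_two_mul_natCast N
  have hxA : ⌊x / N⌋₊ = N ^ 23 := by rw [hx, pow24_div_self N hN0, floor_natCast_pow]
  have hterm : ∀ q ∈ Finset.Icc 1 N,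
      (q : ℝ) * ((N : ℝ) ^ 46 / 4) ≤ (q : ℝ) ^ 3 * F 1 x N q (2 * N) 0 := by
    intro q hq
    obtain ⟨hq1, hqN⟩ := Finset.mem_Icc.1 hq
    have hqpos : (0 : ℝ) < q := by exact_mod_cast hq1
    have hqN' : (q : ℝ) ≤ N := by exact_mod_cast hqN
    have hrows : (1 : ℝ) ≤ ((rows (N : ℝ) q (2 * N)).card : ℝ) :=
      one_le_card_rows_self (by rw [hfl1]; omega) (by rw [hfl2])
    have hcols := (card_cols_bounds x N q 0 hq1).1
    rw [hxA] at hcols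
    push_cast at hcols
    -- `N²³/q ≥ N²² ≥ 2`, so `N²³/q - 1 ≥ N²³/(2q)`
    have hbig : (2 : ℝ) ≤ (N : ℝ) ^ 23 / q := by
      rw [le_div_iff₀ hqpos]
      have : (2 : ℝ) * q ≤ 2 * N := by linarith
      have h22 : (2 : ℝ) * N ≤ (N : ℝ) ^ 23 := by
        have : (2 : ℝ) ≤ (N : ℝ) ^ 22 := by
          calc (2 : ℝ) ≤ N := by exact_mod_cast hN2
            _ ≤ (N : ℝ) ^ 22 := le_self_pow₀ (by exact_mod_cast hN1) (by norm_num)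
        calc (2 : ℝ) * N ≤ (N : ℝ) ^ 22 * N := by gcongr
          _ = (N : ℝ) ^ 23 := by ring
      linarith
    have hcols' : (N : ℝ) ^ 23 / (2 * q) ≤ ((cols x (N : ℝ) q 0).card : ℝ) := by
      have : (N : ℝ) ^ 23 / (2 * q) = ((N : ℝ) ^ 23 / q) / 2 := by field_simp
      rw [this]; linarith
    have hF := F_ge_of_bounds (c := 1) (by norm_num) x N q (2 * N) 0 (by positivity)
      hrows hcols'
    calc (q : ℝ) * ((N : ℝ) ^ 46 / 4) = (q : ℝ) ^ 3 * (1 * ((N : ℝ) ^ 23 / (2 * q)) ^ 2) := by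
          field_simp; ring
      _ ≤ (q : ℝ) ^ 3 * F 1 x N q (2 * N) 0 := by gcongr
  have hlow : (N : ℝ) ^ 48 / 8 ≤ lhs 1 (1 / 12) x N (fun _ => 2 * N) (fun _ => 0) := by
    unfold lhs
    rw [hQ]
    calc (N : ℝ) ^ 48 / 8 = ((N : ℝ) ^ 2 / 2) * ((N : ℝ) ^ 46 / 4) := by ring
      _ ≤ (∑ q ∈ Finset.Icc 1 N, (q : ℝ)) * ((N : ℝ) ^ 46 / 4) := by
          gcongr; exact sum_Icc_pow_one_ge N
      _ = ∑ q ∈ Finset.Icc 1 N, (q : ℝ) * ((N : ℝ) ^ 46 / 4) := by rw [Finset.sum_mul]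
      _ ≤ _ := Finset.sum_le_sum hterm
  have hrhs := rhs_pow24_lt hN2
  have hpos : (0 : ℝ) ≤ (N : ℝ) ^ 48 := by positivity
  linarith

/-- Dilations up to `x^δ` instead of `x^{δ/2}`. -/
noncomputable def lhsDil (c : ℤ) (δ x A : ℝ) (u v : ℕ → ℕ) : ℝ :=
  ∑ q ∈ Finset.Icc 1 ⌊x ^ δ⌋₊, (q : ℝ) ^ 3 * F c x A q (u q) (v q)

/-- The crux with the dilation range doubled on the log scale: `q ≤ x^δ`. -/
def WithDilationsToDelta : Prop :=
  ∀ c : ℤ, c ≠ 0 → ∀ δ : ℝ, 0 < δ → δ ≤ 1 / 12 → ∀ C : ℝ, 0 < C → ∃ x₀ : ℝ, ∀ x : ℝ, x₀ ≤ x →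
    ∀ A : ℝ, x ^ δ ≤ A → A ≤ x ^ (1 / 3 + δ) → ∀ u v : ℕ → ℕ,
      lhsDil c δ x A u v ≤ x ^ 2 / Real.log x ^ C

/-- (b2) The dilation range cannot reach the window bottom: with `q ≤ x^δ = N² = A`, classes
`u q := 2N²`, `v q := 0`, the diagonal gives `Σ_{q ≤ N²} q³ (N²²/(2q))² ≥ N⁴⁸/8 > x²/log x`. -/
theorem false_with_dilations_to_delta : ¬ WithDilationsToDelta := by
  intro h
  obtain ⟨x₀, hx₀⟩ := h 1 one_ne_zero (1 / 12) (by norm_num) le_rfl 1 one_pos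
  obtain ⟨N, hN2, -, hxN⟩ := exists_scale x₀ 2 (by norm_num)
  have hN1 : 1 ≤ N := by omega
  have hN0 : N ≠ 0 := by omega
  have hNpos : (0 : ℝ) < N := by exact_mod_cast (by omega : 0 < N)
  set x : ℝ := ((N : ℝ)) ^ 24 with hx
  have hQ1 : x ^ (1 / 12 : ℝ) = (N : ℝ) ^ 2 := by rw [hx, pow24_rpow_eq_pow N (k := 2) (by norm_num)]
  have hA1 : x ^ (1 / 12 : ℝ) ≤ (N : ℝ) ^ 2 := hQ1.le
  have hA2 : ((N : ℝ)) ^ 2 ≤ x ^ (1 / 3 + 1 / 12 : ℝ) := by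
    rw [hx, pow24_rpow_eq_pow N (k := 10) (by norm_num)]
    exact pow_le_pow_right₀ (by exact_mod_cast hN1) (by norm_num)
  have key := hx₀ x hxN ((N : ℝ) ^ 2) hA1 hA2 (fun _ => 2 * N ^ 2) (fun _ => 0)
  have hQ : ⌊x ^ (1 / 12 : ℝ)⌋₊ = N ^ 2 := by rw [hQ1, floor_natCast_pow]
  have hfl1 : ⌊((N : ℝ)) ^ 2⌋₊ = N ^ 2 := floor_natCast_pow N 2
  have hfl2 : ⌊2 * ((N : ℝ)) ^ 2⌋₊ = 2 * N ^ 2 := floor_two_mul_natCast_pow N 2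
  have hxA : ⌊x / (N : ℝ) ^ 2⌋₊ = N ^ 22 := by
    rw [hx, pow24_div_pow N hN0 (by norm_num), floor_natCast_pow]
  have hN2sq : 1 ≤ N ^ 2 := Nat.one_le_pow _ _ (by omega)
  have hterm : ∀ q ∈ Finset.Icc 1 (N ^ 2),
      (q : ℝ) * ((N : ℝ) ^ 44 / 4) ≤ (q : ℝ) ^ 3 * F 1 x ((N : ℝ) ^ 2) q (2 * N ^ 2) 0 := by
    intro q hq
    obtain ⟨hq1, hqN⟩ := Finset.mem_Icc.1 hq
    have hqpos : (0 : ℝ) < q := by exact_mod_cast hq1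
    have hqN' : (q : ℝ) ≤ (N : ℝ) ^ 2 := by exact_mod_cast hqN
    have hrows : (1 : ℝ) ≤ ((rows ((N : ℝ) ^ 2) q (2 * N ^ 2)).card : ℝ) :=
      one_le_card_rows_self (by rw [hfl1]; omega) (by rw [hfl2])
    have hcols := (card_cols_bounds x ((N : ℝ) ^ 2) q 0 hq1).1
    rw [hxA] at hcols
    push_cast at hcols
    have hbig : (2 : ℝ) ≤ (N : ℝ) ^ 22 / q := by
      rw [le_div_iff₀ hqpos]
      have h1 : (2 : ℝ) * q ≤ 2 * (N : ℝ) ^ 2 := by linarith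
      have h2 : (2 : ℝ) ≤ (N : ℝ) ^ 20 := by
        calc (2 : ℝ) ≤ N := by exact_mod_cast hN2
          _ ≤ (N : ℝ) ^ 20 := le_self_pow₀ (by exact_mod_cast hN1) (by norm_num)
      calc (2 : ℝ) * q ≤ 2 * (N : ℝ) ^ 2 := h1
        _ ≤ (N : ℝ) ^ 20 * (N : ℝ) ^ 2 := by gcongr
        _ = (N : ℝ) ^ 22 := by ring
    have hcols' : (N : ℝ) ^ 22 / (2 * q) ≤ ((cols x ((N : ℝ) ^ 2) q 0).card : ℝ) := by
      have : (N : ℝ) ^ 22 / (2 * q) = ((N : ℝ) ^ 22 / q) / 2 := by field_simp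
      rw [this]; linarith
    have hF := F_ge_of_bounds (c := 1) (by norm_num) x ((N : ℝ) ^ 2) q (2 * N ^ 2) 0
      (by positivity) hrows hcols'
    calc (q : ℝ) * ((N : ℝ) ^ 44 / 4)
          = (q : ℝ) ^ 3 * (1 * ((N : ℝ) ^ 22 / (2 * q)) ^ 2) := by field_simp; ring
      _ ≤ (q : ℝ) ^ 3 * F 1 x ((N : ℝ) ^ 2) q (2 * N ^ 2) 0 := by gcongr
  have hlow : (N : ℝ) ^ 48 / 8 ≤ lhsDil 1 (1 / 12) x ((N : ℝ) ^ 2) (fun _ => 2 * N ^ 2) (fun _ => 0) := by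
    unfold lhsDil
    rw [hQ]
    calc (N : ℝ) ^ 48 / 8 = (((N ^ 2 : ℕ) : ℝ) ^ 2 / 2) * ((N : ℝ) ^ 44 / 4) := by push_cast; ring
      _ ≤ (∑ q ∈ Finset.Icc 1 (N ^ 2), (q : ℝ)) * ((N : ℝ) ^ 44 / 4) := by
          gcongr; exact sum_Icc_pow_one_ge (N ^ 2)
      _ = ∑ q ∈ Finset.Icc 1 (N ^ 2), (q : ℝ) * ((N : ℝ) ^ 44 / 4) := by rw [Finset.sum_mul]
      _ ≤ _ := Finset.sum_le_sum hterm
  have hrhs := rhs_pow24_lt hN2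
  have hpos : (0 : ℝ) ≤ (N : ℝ) ^ 48 := by positivity
  linarith

/-- Weight `q⁴` instead of `q³`. -/
noncomputable def lhs4 (c : ℤ) (δ x A : ℝ) (u v : ℕ → ℕ) : ℝ :=
  ∑ q ∈ Finset.Icc 1 ⌊x ^ (δ / 2)⌋₊, (q : ℝ) ^ 4 * F c x A q (u q) (v q)

/-- The crux with weight `q⁴`. -/
def WithWeightFour : Prop :=
  ∀ c : ℤ, c ≠ 0 → ∀ δ : ℝ, 0 < δ → δ ≤ 1 / 12 → ∀ C : ℝ, 0 < C → ∃ x₀ : ℝ, ∀ x : ℝ, x₀ ≤ x →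
    ∀ A : ℝ, x ^ δ ≤ A → A ≤ x ^ (1 / 3 + δ) → ∀ u v : ℕ → ℕ,
      lhs4 c δ x A u v ≤ x ^ 2 / Real.log x ^ C

/-- (b3) The weight cannot be `q⁴`: with the UNIT classes `u = v = 1` (coprime to every `q`, i.e.
exactly the classes the sieve glue consumes) at `A = x^δ = N²`, rows `≥ N²/(2q)`, columns
`≥ N²²/(2q)`, the diagonal gives `Σ_{q ≤ N} q⁴ N⁴⁶/(8q³) ≥ N⁴⁸/16 > x²/log x`. So `q³` (making each
dilation's trivial bound `x²/q`) is the largest admissible weight. Class sizes do not depend on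
coprimality, so restricting the crux to coprime classes changes none of (b1)–(b3). -/
theorem false_with_weight_four : ¬ WithWeightFour := by
  intro h
  obtain ⟨x₀, hx₀⟩ := h 1 one_ne_zero (1 / 12) (by norm_num) le_rfl 1 one_pos
  obtain ⟨N, hN2, -, hxN⟩ := exists_scale x₀ 2 (by norm_num)
  have hN1 : 1 ≤ N := by omega
  have hN0 : N ≠ 0 := by omega
  have hNpos : (0 : ℝ) < N := by exact_mod_cast (by omega : 0 < N)
  set x : ℝ := ((N : ℝ)) ^ 24 with hx
  have hQ1 : x ^ ((1 / 12 : ℝ) / 2) = N := by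
    rw [hx, pow24_rpow_eq_pow N (k := 1) (by norm_num), pow_one]
  have hA1 : x ^ (1 / 12 : ℝ) ≤ (N : ℝ) ^ 2 := (pow24_rpow_eq_pow N (k := 2) (by norm_num)).le
  have hA2 : ((N : ℝ)) ^ 2 ≤ x ^ (1 / 3 + 1 / 12 : ℝ) := by
    rw [hx, pow24_rpow_eq_pow N (k := 10) (by norm_num)]
    exact pow_le_pow_right₀ (by exact_mod_cast hN1) (by norm_num)
  have key := hx₀ x hxN ((N : ℝ) ^ 2) hA1 hA2 (fun _ => 1) (fun _ => 1)
  have hQ : ⌊x ^ ((1 / 12 : ℝ) / 2)⌋₊ = N := by rw [hQ1, Nat.floor_natCast]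
  have hfl1 : ⌊((N : ℝ)) ^ 2⌋₊ = N ^ 2 := floor_natCast_pow N 2
  have hfl2 : ⌊2 * ((N : ℝ)) ^ 2⌋₊ = 2 * N ^ 2 := floor_two_mul_natCast_pow N 2
  have hxA : ⌊x / (N : ℝ) ^ 2⌋₊ = N ^ 22 := by
    rw [hx, pow24_div_pow N hN0 (by norm_num), floor_natCast_pow]
  have hterm : ∀ q ∈ Finset.Icc 1 N,
      (q : ℝ) * ((N : ℝ) ^ 46 / 8) ≤ (q : ℝ) ^ 4 * F 1 x ((N : ℝ) ^ 2) q 1 1 := by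
    intro q hq
    obtain ⟨hq1, hqN⟩ := Finset.mem_Icc.1 hq
    have hqpos : (0 : ℝ) < q := by exact_mod_cast hq1
    have hqN' : (q : ℝ) ≤ N := by exact_mod_cast hqN
    have hrows := (card_rows_bounds ((N : ℝ) ^ 2) (by positivity) q 1 hq1).1
    rw [hfl1, hfl2] at hrows
    push_cast at hrows
    have hcols := (card_cols_bounds x ((N : ℝ) ^ 2) q 1 hq1).1
    rw [hxA] at hcols
    push_cast at hcols
    have hbigr : (2 : ℝ) ≤ (N : ℝ) ^ 2 / q := by
      rw [le_div_iff₀ hqpos]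
      calc (2 : ℝ) * q ≤ N * q := by gcongr; exact_mod_cast hN2
        _ ≤ N * N := by gcongr
        _ = (N : ℝ) ^ 2 := by ring
    have hbigc : (2 : ℝ) ≤ (N : ℝ) ^ 22 / q := by
      rw [le_div_iff₀ hqpos]
      calc (2 : ℝ) * q ≤ N * q := by gcongr; exact_mod_cast hN2
        _ ≤ N * N := by gcongr
        _ = (N : ℝ) ^ 2 := by ring
        _ ≤ (N : ℝ) ^ 22 := pow_le_pow_right₀ (by exact_mod_cast hN1) (by norm_num)
    have hrows' : (N : ℝ) ^ 2 / (2 * q) ≤ ((rows ((N : ℝ) ^ 2) q 1).card : ℝ) := by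
      have e : (N : ℝ) ^ 2 / (2 * q) = ((N : ℝ) ^ 2 / q) / 2 := by field_simp
      have e2 : ((2 : ℝ) * (N : ℝ) ^ 2 - (N : ℝ) ^ 2) / q = (N : ℝ) ^ 2 / q := by ring
      rw [e2] at hrows
      rw [e]; linarith
    have hcols' : (N : ℝ) ^ 22 / (2 * q) ≤ ((cols x ((N : ℝ) ^ 2) q 1).card : ℝ) := by
      have e : (N : ℝ) ^ 22 / (2 * q) = ((N : ℝ) ^ 22 / q) / 2 := by field_simp
      rw [e]; linarith
    have hF := F_ge_of_bounds (c := 1) (by norm_num) x ((N : ℝ) ^ 2) q 1 1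
      (by positivity) hrows' hcols'
    calc (q : ℝ) * ((N : ℝ) ^ 46 / 8)
          = (q : ℝ) ^ 4 * (((N : ℝ) ^ 2 / (2 * q)) * ((N : ℝ) ^ 22 / (2 * q)) ^ 2) := by
            field_simp; ring
      _ ≤ (q : ℝ) ^ 4 * F 1 x ((N : ℝ) ^ 2) q 1 1 := by gcongr
  have hlow : (N : ℝ) ^ 48 / 16 ≤ lhs4 1 (1 / 12) x ((N : ℝ) ^ 2) (fun _ => 1) (fun _ => 1) := by
    unfold lhs4
    rw [hQ]
    calc (N : ℝ) ^ 48 / 16 = ((N : ℝ) ^ 2 / 2) * ((N : ℝ) ^ 46 / 8) := by ring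
      _ ≤ (∑ q ∈ Finset.Icc 1 N, (q : ℝ)) * ((N : ℝ) ^ 46 / 8) := by
          gcongr; exact sum_Icc_pow_one_ge N
      _ = ∑ q ∈ Finset.Icc 1 N, (q : ℝ) * ((N : ℝ) ^ 46 / 8) := by rw [Finset.sum_mul]
      _ ≤ _ := Finset.sum_le_sum hterm
  have hrhs := rhs_pow24_lt hN2
  linarith

/-! ## §7 (d) λ-SENSITIVITY: the table statements are FALSE for every periodic model of λ

For ANY `m`-periodic `f : ℕ → ℝ` with `f 1 = 1` — every real Dirichlet character (principal or
not, e.g. `χ₃`, `χ₄`, the Kronecker symbols), every periodic `±1` pattern — the `q = 1` table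
statement (hence the dilated one) is false: the rows `a ≡ 0 (mod m)` see the constant entry
`f(ab+1) = f(1) = 1`, so `Σ_{a,a'} S² ≥ (#rows₀)² #cols² ≈ x²/m²`. Any proof must therefore use the
APERIODICITY of λ quantitatively (a `(log x)^{-C}` saving needs non-pretentiousness uniformly in
conductors up to the relevant range) — the formal content of the "Siegel-exceptional class" worry. -/

/-- The two-row correlation for a general entry function `f` in place of `λ`. -/
noncomputable def SF (f : ℕ → ℝ) (c : ℤ) (x A : ℝ) (q v a a' : ℕ) : ℝ :=
  ∑ b ∈ cols x A q v, f (Int.toNat ((a : ℤ) * b + c)) * f (Int.toNat ((a' : ℤ) * b + c))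

/-- The fourth moment for a general entry function. -/
noncomputable def FF (f : ℕ → ℝ) (c : ℤ) (x A : ℝ) (q u v : ℕ) : ℝ :=
  ∑ a ∈ rows A q u, ∑ a' ∈ rows A q u, (SF f c x A q v a a') ^ 2

/-- The crux functional for a general entry function. -/
noncomputable def lhsF (f : ℕ → ℝ) (c : ℤ) (δ x A : ℝ) (u v : ℕ → ℕ) : ℝ :=
  ∑ q ∈ Finset.Icc 1 ⌊x ^ (δ / 2)⌋₊, (q : ℝ) ^ 3 * FF f c x A q (u q) (v q)

/-- `DilatedTableChowla` with `λ` replaced by an arbitrary `f : ℕ → ℝ`. -/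
def DilatedTableChowlaFor (f : ℕ → ℝ) : Prop :=
  ∀ c : ℤ, c ≠ 0 → ∀ δ : ℝ, 0 < δ → δ ≤ 1 / 12 → ∀ C : ℝ, 0 < C → ∃ x₀ : ℝ, ∀ x : ℝ, x₀ ≤ x →
    ∀ A : ℝ, x ^ δ ≤ A → A ≤ x ^ (1 / 3 + δ) → ∀ u v : ℕ → ℕ,
      lhsF f c δ x A u v ≤ x ^ 2 / Real.log x ^ C

/-- `TableChowla` (stmt-Parity-14270) with `λ` replaced by an arbitrary `f : ℕ → ℝ`. -/
def TableChowlaFor (f : ℕ → ℝ) : Prop :=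
  ∀ c : ℤ, c ≠ 0 → ∀ δ : ℝ, 0 < δ → δ ≤ 1 / 12 → ∀ C : ℝ, 0 < C → ∃ x₀ : ℝ, ∀ x : ℝ, x₀ ≤ x →
    ∀ A : ℝ, x ^ δ ≤ A → A ≤ x ^ (1 / 3 + δ) →
      (∑ a ∈ Finset.Ioc ⌊A⌋₊ ⌊2 * A⌋₊, ∑ a' ∈ Finset.Ioc ⌊A⌋₊ ⌊2 * A⌋₊,
        (∑ b ∈ Finset.Icc 1 ⌊x / A⌋₊, f (Int.toNat ((a : ℤ) * b + c)) * f (Int.toNat ((a' : ℤ) * b + c))) ^ 2)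
        ≤ x ^ 2 / Real.log x ^ C

/-- READ-BACK: the crux is literally `DilatedTableChowlaFor λ`. -/
theorem dilatedTableChowlaFor_liouville_iff :
    DilatedTableChowlaFor (fun n => (ArithmeticFunction.liouville n : ℝ)) ↔ DilatedTableChowla :=
  Iff.rfl

/-- READ-BACK: `TableChowla` is literally `TableChowlaFor λ`. -/
theorem tableChowlaFor_liouville_iff :
    TableChowlaFor (fun n => (ArithmeticFunction.liouville n : ℝ)) ↔ TableChowla :=
  Iff.rfl

/-- The generic fourth moment is a sum of squares. -/
theorem FF_nonneg (f : ℕ → ℝ) (c : ℤ) (x A : ℝ) (q u v : ℕ) : 0 ≤ FF f c x A q u v :=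
  Finset.sum_nonneg fun _ _ => Finset.sum_nonneg fun _ _ => sq_nonneg _

/-- The generic `q = 1` block is the generic plain table. -/
theorem FF_one_eq_table (f : ℕ → ℝ) (c : ℤ) (x A : ℝ) (u v : ℕ) :
    FF f c x A 1 u v = ∑ a ∈ Finset.Ioc ⌊A⌋₊ ⌊2 * A⌋₊, ∑ a' ∈ Finset.Ioc ⌊A⌋₊ ⌊2 * A⌋₊,
      (∑ b ∈ Finset.Icc 1 ⌊x / A⌋₊, f (Int.toNat ((a : ℤ) * b + c)) * f (Int.toNat ((a' : ℤ) * b + c))) ^ 2 := by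
  unfold FF SF
  rw [rows_one, cols_one]

/-- The generic `q = 1` block minorises the generic left-hand side (`x ≥ 1`). -/
theorem FF_one_le_lhsF (f : ℕ → ℝ) (c : ℤ) {δ x : ℝ} (hδ : 0 ≤ δ) (hx : 1 ≤ x) (A : ℝ)
    (u v : ℕ → ℕ) : FF f c x A 1 (u 1) (v 1) ≤ lhsF f c δ x A u v := by
  have h : (1 : ℕ) ≤ ⌊x ^ (δ / 2)⌋₊ := by
    apply Nat.le_floor
    simpa using Real.one_le_rpow hx (by linarith : 0 ≤ δ / 2)
  unfold lhsF
  have := Finset.single_le_sum (f := fun q : ℕ => (q : ℝ) ^ 3 * FF f c x A q (u q) (v q))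
    (fun q _ => mul_nonneg (by positivity) (FF_nonneg f c x A q (u q) (v q))) (Finset.mem_Icc.2 ⟨le_rfl, h⟩)
  simpa using this

/-- Generic `q = 1` slice. -/
theorem dilatedFor_imp_tableFor (f : ℕ → ℝ) (h : DilatedTableChowlaFor f) : TableChowlaFor f := by
  intro c hc δ hδ hδ' C hC
  obtain ⟨x₀, hx₀⟩ := h c hc δ hδ hδ' C hC
  refine ⟨max x₀ 1, fun x hx A hA1 hA2 => ?_⟩
  have hx0 : x₀ ≤ x := le_trans (le_max_left _ _) hx
  have hx1 : (1 : ℝ) ≤ x := le_trans (le_max_right _ _) hx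
  have key := hx₀ x hx0 A hA1 hA2 (fun _ => 0) (fun _ => 0)
  have h1 := FF_one_le_lhsF f c hδ.le hx1 A (fun _ => 0) (fun _ => 0)
  rw [FF_one_eq_table] at h1
  exact h1.trans key

/-- The key pretender computation: on rows divisible by the period, the entries at shift `1`
are the constant `f 1`. -/
theorem pretender_entry {m : ℕ} {f : ℕ → ℝ} (hf : Function.Periodic f m) {a : ℕ} (hma : m ∣ a)
    (b : ℕ) : f (Int.toNat ((a : ℤ) * b + 1)) = f 1 := by
  obtain ⟨k, rfl⟩ := hma
  rw [show ((m * k : ℕ) : ℤ) * b + 1 = (((k * b) * m + 1 : ℕ) : ℤ) by push_cast; ring,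
    Int.toNat_natCast, ← hf.map_mod_nat, add_comm, Nat.add_mul_mod_self_right, hf.map_mod_nat]

/-- (d) For every `m`-periodic `f` with `f 1 = 1`, `TableChowlaFor f` is FALSE
(witness `c = 1`, `δ = 1/12`, `C = 1`, `x = N²⁴` with `m ∣ N` and `log N ≥ m² log 2`). -/
theorem not_tableChowlaFor_periodic {m : ℕ} (hm : 1 ≤ m) {f : ℕ → ℝ} (hf : Function.Periodic f m)
    (h1 : f 1 = 1) : ¬ TableChowlaFor f := by
  intro h
  obtain ⟨x₀, hx₀⟩ := h 1 one_ne_zero (1 / 12) (by norm_num) le_rfl 1 one_pos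
  -- the scale: N = m * K with K ≥ max x₀ 2 + 2^(m²)
  obtain ⟨K₀, hK₀⟩ := exists_nat_ge (max x₀ 2)
  set K : ℕ := K₀ + 2 ^ (m ^ 2) with hK
  set N : ℕ := m * K with hN
  have hK2 : 2 ≤ K := by
    have : (2 : ℝ) ≤ K₀ := le_trans (le_max_right _ _) hK₀
    have : 2 ≤ K₀ := by exact_mod_cast this
    have : 1 ≤ 2 ^ (m ^ 2) := Nat.one_le_two_pow
    omega
  have hKN : K ≤ N := by rw [hN]; exact Nat.le_mul_of_pos_left K (by omega)
  have hN2 : 2 ≤ N := hK2.trans hKN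
  have hN1 : 1 ≤ N := by omega
  have hN0 : N ≠ 0 := by omega
  have hNpos : (0 : ℝ) < N := by exact_mod_cast (by omega : 0 < N)
  have hxN : x₀ ≤ ((N : ℝ)) ^ 24 := by
    have h1 : x₀ ≤ K₀ := le_trans (le_max_left _ _) hK₀
    have h2 : (K₀ : ℝ) ≤ K := by rw [hK]; push_cast; linarith [pow_nonneg (by norm_num : (0:ℝ) ≤ 2) (m ^ 2)]
    have h3 : (K : ℝ) ≤ N := by exact_mod_cast hKN
    exact h1.trans (h2.trans (h3.trans (self_le_pow24 hN1)))
  set x : ℝ := ((N : ℝ)) ^ 24 with hx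
  have hA1 : x ^ (1 / 12 : ℝ) ≤ (N : ℝ) ^ 2 := (pow24_rpow_eq_pow N (k := 2) (by norm_num)).le
  have hA2 : ((N : ℝ)) ^ 2 ≤ x ^ (1 / 3 + 1 / 12 : ℝ) := by
    rw [hx, pow24_rpow_eq_pow N (k := 10) (by norm_num)]
    exact pow_le_pow_right₀ (by exact_mod_cast hN1) (by norm_num)
  have key := hx₀ x hxN ((N : ℝ) ^ 2) hA1 hA2
  rw [floor_natCast_pow, floor_two_mul_natCast_pow, hx, pow24_div_pow N hN0 (by norm_num),
    floor_natCast_pow] at key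
  -- restrict both row sums to the multiples of m
  set R : Finset ℕ := (Finset.Ioc (N ^ 2) (2 * N ^ 2)).filter (fun a : ℕ => a ≡ 0 [MOD m]) with hR
  have hRsub : R ⊆ Finset.Ioc (N ^ 2) (2 * N ^ 2) := Finset.filter_subset _ _
  have hinner : ∀ a ∈ R, ∀ a' ∈ R,
      (∑ b ∈ Finset.Icc 1 (N ^ (24 - 2)),
        f (Int.toNat ((a : ℤ) * b + 1)) * f (Int.toNat ((a' : ℤ) * b + 1))) ^ 2
        = ((N ^ 22 : ℕ) : ℝ) ^ 2 := by
    intro a ha a' ha'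
    have hma : m ∣ a := (Nat.modEq_zero_iff_dvd).1 (Finset.mem_filter.1 ha).2
    have hma' : m ∣ a' := (Nat.modEq_zero_iff_dvd).1 (Finset.mem_filter.1 ha').2
    rw [Finset.sum_congr rfl fun b _ => by rw [pretender_entry hf hma, pretender_entry hf hma', h1]]
    simp
  have hcardR : ((N : ℝ)) ^ 2 / m - 1 ≤ (R.card : ℝ) := by
    have := (card_modEq_Ioc_bounds (N ^ 2) (2 * N ^ 2) m 0 (by omega) (by omega)).1
    rw [← hR] at this
    push_cast at this
    have e : ((2 : ℝ) * (N : ℝ) ^ 2 - (N : ℝ) ^ 2) / m = (N : ℝ) ^ 2 / m := by ring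
    linarith [e.symm.le, e.le]
  have hmpos : (0 : ℝ) < m := by exact_mod_cast hm
  have hcardR' : ((N : ℝ)) ^ 2 / (2 * m) ≤ (R.card : ℝ) := by
    -- N²/m = m K² ≥ 2
    have hbig : (2 : ℝ) ≤ (N : ℝ) ^ 2 / m := by
      rw [le_div_iff₀ hmpos, hN]; push_cast
      have hK2' : (2 : ℝ) ≤ K := by exact_mod_cast hK2
      have hm1 : (1 : ℝ) ≤ m := by exact_mod_cast hm
      have hm0 : (0 : ℝ) ≤ m := by linarith
      have h1 : (2 : ℝ) * m ≤ m * K := by nlinarith [mul_le_mul_of_nonneg_left hK2' hm0]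
      calc (2 : ℝ) * m ≤ 4 * (m : ℝ) ^ 2 := by nlinarith
        _ = (2 * (m : ℝ)) ^ 2 := by ring
        _ ≤ ((m : ℝ) * K) ^ 2 := by gcongr
    have e : (N : ℝ) ^ 2 / (2 * m) = ((N : ℝ) ^ 2 / m) / 2 := by field_simp
    rw [e]; linarith
  have hlow : ((N : ℝ) ^ 2 / (2 * m)) ^ 2 * ((N : ℝ) ^ 22) ^ 2 ≤
      ∑ a ∈ Finset.Ioc (N ^ 2) (2 * N ^ 2), ∑ a' ∈ Finset.Ioc (N ^ 2) (2 * N ^ 2),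
        (∑ b ∈ Finset.Icc 1 (N ^ (24 - 2)),
          f (Int.toNat ((a : ℤ) * b + 1)) * f (Int.toNat ((a' : ℤ) * b + 1))) ^ 2 := by
    calc ((N : ℝ) ^ 2 / (2 * m)) ^ 2 * ((N : ℝ) ^ 22) ^ 2
          ≤ (R.card : ℝ) ^ 2 * ((N : ℝ) ^ 22) ^ 2 := by gcongr
      _ = ∑ a ∈ R, ∑ a' ∈ R, ((N ^ 22 : ℕ) : ℝ) ^ 2 := by simp; ring
      _ = ∑ a ∈ R, ∑ a' ∈ R, (∑ b ∈ Finset.Icc 1 (N ^ (24 - 2)),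
            f (Int.toNat ((a : ℤ) * b + 1)) * f (Int.toNat ((a' : ℤ) * b + 1))) ^ 2 := by
          refine Finset.sum_congr rfl fun a ha => Finset.sum_congr rfl fun a' ha' => ?_
          rw [hinner a ha a' ha']
      _ ≤ ∑ a ∈ R, ∑ a' ∈ Finset.Ioc (N ^ 2) (2 * N ^ 2), (∑ b ∈ Finset.Icc 1 (N ^ (24 - 2)),
            f (Int.toNat ((a : ℤ) * b + 1)) * f (Int.toNat ((a' : ℤ) * b + 1))) ^ 2 := by
          refine Finset.sum_le_sum fun a _ => ?_
          exact Finset.sum_le_sum_of_subset_of_nonneg hRsub fun _ _ _ => sq_nonneg _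
      _ ≤ _ := Finset.sum_le_sum_of_subset_of_nonneg hRsub fun _ _ _ =>
            Finset.sum_nonneg fun _ _ => sq_nonneg _
  -- compare with the right-hand side: x²/log x = N⁴⁸/(24 log N) and log N ≥ m² log 2
  have hlogN : (m : ℝ) ^ 2 * Real.log 2 ≤ Real.log N := by
    have h2K : (2 : ℝ) ^ (m ^ 2) ≤ K := by rw [hK]; push_cast; linarith [(Nat.cast_nonneg K₀ : (0:ℝ) ≤ K₀)]
    have hKN' : (K : ℝ) ≤ N := by exact_mod_cast hKN
    calc (m : ℝ) ^ 2 * Real.log 2 = Real.log ((2 : ℝ) ^ (m ^ 2)) := by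
            rw [Real.log_pow]; push_cast; ring
      _ ≤ Real.log N := Real.log_le_log (by positivity) (h2K.trans hKN')
  have hlog2 := Real.log_two_gt_d9
  have hrhs : (((N : ℝ)) ^ 24) ^ 2 / Real.log (((N : ℝ)) ^ 24) ^ (1 : ℝ)
      < ((N : ℝ) ^ 2 / (2 * m)) ^ 2 * ((N : ℝ) ^ 22) ^ 2 := by
    rw [Real.rpow_one, log_pow24]
    have hpos48 : (0 : ℝ) < (N : ℝ) ^ 48 := by positivity
    have e1 : (((N : ℝ)) ^ 24) ^ 2 = (N : ℝ) ^ 48 := by ring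
    have e2 : ((N : ℝ) ^ 2 / (2 * m)) ^ 2 * ((N : ℝ) ^ 22) ^ 2 = (N : ℝ) ^ 48 / (4 * m ^ 2) := by
      field_simp; ring
    rw [e1, e2]
    apply div_lt_div_of_pos_left hpos48 (by positivity)
    nlinarith
  rw [← hx] at hrhs
  have : x = ((N : ℝ)) ^ 24 := hx
  linarith [key, hlow, hrhs]

/-- … hence `DilatedTableChowlaFor f` is false for every such `f` as well. -/
theorem not_dilatedTableChowlaFor_periodic {m : ℕ} (hm : 1 ≤ m) {f : ℕ → ℝ}
    (hf : Function.Periodic f m) (h1 : f 1 = 1) : ¬ DilatedTableChowlaFor f :=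
  fun h => not_tableChowlaFor_periodic hm hf h1 (dilatedFor_imp_tableFor f h)

/-- Selberg's ghost / the principal character: the constant function `1`. -/
theorem not_dilatedTableChowlaFor_one : ¬ DilatedTableChowlaFor (fun _ => 1) :=
  not_dilatedTableChowlaFor_periodic (m := 1) le_rfl (fun _ => rfl) rfl

/-- The non-principal character mod 3 as a `3`-periodic `±1, 0` pattern. -/
def chi3 (n : ℕ) : ℝ := if n % 3 = 1 then 1 else if n % 3 = 2 then -1 else 0

/-- `χ₃` is `3`-periodic. -/
theorem chi3_periodic : Function.Periodic chi3 3 := fun n => by simp [chi3]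

/-- The crux shape FAILS for the character `χ₃`. -/
theorem not_dilatedTableChowlaFor_chi3 : ¬ DilatedTableChowlaFor chi3 :=
  not_dilatedTableChowlaFor_periodic (m := 3) (by norm_num) chi3_periodic (by simp [chi3])

/-- The non-principal character mod 4 (the "λ ≈ χ₋₄" Siegel-type model). -/
def chi4 (n : ℕ) : ℝ := if n % 4 = 1 then 1 else if n % 4 = 3 then -1 else 0

/-- `χ₄` is `4`-periodic. -/
theorem chi4_periodic : Function.Periodic chi4 4 := fun n => by simp [chi4]

/-- The crux shape FAILS for the character `χ₄`. -/
theorem not_dilatedTableChowlaFor_chi4 : ¬ DilatedTableChowlaFor chi4 :=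
  not_dilatedTableChowlaFor_periodic (m := 4) (by norm_num) chi4_periodic (by simp [chi4])

/-! ## §8 (e) QUANTIFIER ORDER: `x₀` cannot be chosen uniformly in `δ` -/

/-- The crux with `∃ x₀` moved in front of `∀ δ`. -/
def UniformInDelta : Prop :=
  ∀ c : ℤ, c ≠ 0 → ∀ C : ℝ, 0 < C → ∃ x₀ : ℝ, ∀ δ : ℝ, 0 < δ → δ ≤ 1 / 12 → ∀ x : ℝ, x₀ ≤ x →
    ∀ A : ℝ, x ^ δ ≤ A → A ≤ x ^ (1 / 3 + δ) → ∀ u v : ℕ → ℕ,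
      lhs c δ x A u v ≤ x ^ 2 / Real.log x ^ C

/-- (e) `x₀` must depend on `δ`: given `x₀`, take `x = N ≥ max(x₀, 2¹²)` even and `δ = log 2/log N`,
so that `x^δ = 2`, `A = 2` is admissible, the table has the two rows `{3,4}` and `N/2` columns, and
the diagonal `2 (N/2)²` beats `N²/log N` as soon as `log N > 2`. -/
theorem false_uniform_in_delta : ¬ UniformInDelta := by
  intro h
  obtain ⟨x₀, hx₀⟩ := h 1 one_ne_zero 1 one_pos
  obtain ⟨M, hM⟩ := exists_nat_ge (max x₀ (2 ^ 11))
  have hM11 : (2 : ℝ) ^ 11 ≤ M := le_trans (le_max_right _ _) hM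
  have hMx : x₀ ≤ M := le_trans (le_max_left _ _) hM
  set N : ℕ := 2 * M with hN
  have hNM : (N : ℝ) = 2 * M := by rw [hN]; push_cast; ring
  have hN12 : (2 : ℝ) ^ 12 ≤ N := by rw [hNM]; nlinarith
  have hMpos : (0 : ℝ) < M := by nlinarith
  have hNpos : (0 : ℝ) < N := by rw [hNM]; linarith
  have hN1 : (1 : ℝ) ≤ N := by linarith
  have hxN : x₀ ≤ N := by rw [hNM]; linarith
  have hlogN : 12 * Real.log 2 ≤ Real.log N := by
    calc 12 * Real.log 2 = Real.log ((2 : ℝ) ^ 12) := by rw [Real.log_pow]; norm_num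
      _ ≤ Real.log N := Real.log_le_log (by positivity) hN12
  have hlog2 := Real.log_two_gt_d9
  have hlog2pos : 0 < Real.log 2 := by linarith
  have hlogNpos : 0 < Real.log N := by linarith
  set δ : ℝ := Real.log 2 / Real.log N with hδ
  have hδpos : 0 < δ := div_pos hlog2pos hlogNpos
  have hδle : δ ≤ 1 / 12 := by
    rw [hδ, div_le_iff₀ hlogNpos]; linarith
  have hxδ : (N : ℝ) ^ δ = 2 := by
    rw [Real.rpow_def_of_pos hNpos, hδ, mul_div_cancel₀ _ hlogNpos.ne', Real.exp_log two_pos]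
  have hA1 : (N : ℝ) ^ δ ≤ 2 := hxδ.le
  have hA2 : (2 : ℝ) ≤ (N : ℝ) ^ (1 / 3 + δ) := by
    calc (2 : ℝ) = (N : ℝ) ^ δ := hxδ.symm
      _ ≤ (N : ℝ) ^ (1 / 3 + δ) := Real.rpow_le_rpow_of_exponent_le hN1 (by linarith)
  have key := hx₀ δ hδpos hδle N hxN 2 hA1 hA2 (fun _ => 0) (fun _ => 0)
  have hrows : (rows (2 : ℝ) 1 0).card = 2 := by
    rw [rows_one, show (2 : ℝ) * 2 = ((4 : ℕ) : ℝ) by norm_num, Nat.floor_natCast,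
      show (2 : ℝ) = ((2 : ℕ) : ℝ) by norm_num, Nat.floor_natCast, Nat.card_Ioc]
  have hcols : (cols (N : ℝ) 2 1 0).card = M := by
    rw [cols_one, show (N : ℝ) / 2 = (M : ℝ) by rw [hNM]; ring, Nat.floor_natCast, Nat.card_Icc]
    omega
  have hF := rows_mul_cols_sq_le_F (c := 1) (by norm_num) (N : ℝ) 2 1 0 0
  rw [hrows, hcols] at hF
  push_cast at hF
  have h2 : F 1 (N : ℝ) 2 1 0 0 ≤ lhs 1 δ N 2 (fun _ => 0) (fun _ => 0) :=
    F_one_le_lhs 1 hδpos.le hN1 2 (fun _ => 0) (fun _ => 0)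
  -- right-hand side: N²/log N < 2 M² since log N > 2
  have hlogN2 : 2 < Real.log N := by
    rw [Real.lt_log_iff_exp_lt hNpos]
    have he := Real.exp_one_lt_d9
    have : Real.exp 2 = Real.exp 1 * Real.exp 1 := by rw [← Real.exp_add]; norm_num
    rw [this]
    have h8 : (8 : ℝ) ≤ N := le_trans (by norm_num) hN12
    nlinarith [Real.exp_pos 1]
  have hrhs : (N : ℝ) ^ 2 / Real.log N ^ (1 : ℝ) < 2 * (M : ℝ) ^ 2 := by
    have e : (N : ℝ) ^ 2 = 4 * (M : ℝ) ^ 2 := by rw [hNM]; ring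
    rw [Real.rpow_one, div_lt_iff₀ hlogNpos, e]
    have := mul_lt_mul_of_pos_left hlogN2 (show (0 : ℝ) < 2 * (M : ℝ) ^ 2 by positivity)
    linarith
  linarith [key, hF, h2, hrhs]


/-! ## §9 (f) STRUCTURAL REDUCTION: the crux is EQUIVALENT to its off-diagonal part

`F = diagF + Foff` with `diagF = Σ_a S(a,a)² ≤ #rows · #cols²`; uniformly in the classes the weighted
diagonal mass is `≤ 12 x²/x^{δ/2}` (`lhsDiag_le`), which is eventually `≤ x²/(2(log x)^C)`. Hence
`DilatedTableChowla ↔ OffDiagonalTableChowla` (`crux_iff_offDiagonal`): ALL the content of the crux is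
cancellation in `S(a,a') = Σ_b λ(ab+c)λ(a'b+c)` for DISTINCT rows `a ≠ a'` of a common class — a
two-point Chowla/Elliott sum for the pair of binary forms `(ab+c, a'b+c)` (determinant `c(a−a') ≠ 0`)
of length `x/A ≥ x^{7/12}` with LARGE coefficients `a, a' ≍ A ≤ x^{5/12}`, averaged over the pairs. -/

/-- The diagonal part of the fourth moment. -/
noncomputable def diagF (c : ℤ) (x A : ℝ) (q u v : ℕ) : ℝ :=
  ∑ a ∈ rows A q u, (S c x A q v a a) ^ 2

/-- The off-diagonal part of the fourth moment (`a ≠ a'`). -/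
noncomputable def Foff (c : ℤ) (x A : ℝ) (q u v : ℕ) : ℝ :=
  ∑ a ∈ rows A q u, ∑ a' ∈ (rows A q u).erase a, (S c x A q v a a') ^ 2

/-- `F = diagF + Foff`. -/
theorem F_eq_diag_add_off (c : ℤ) (x A : ℝ) (q u v : ℕ) :
    F c x A q u v = diagF c x A q u v + Foff c x A q u v := by
  unfold F diagF Foff
  rw [← Finset.sum_add_distrib]
  refine Finset.sum_congr rfl fun a ha => ?_
  rw [Finset.add_sum_erase _ (fun a' => (S c x A q v a a') ^ 2) ha]

/-- `Foff ≥ 0`. -/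
theorem Foff_nonneg (c : ℤ) (x A : ℝ) (q u v : ℕ) : 0 ≤ Foff c x A q u v :=
  Finset.sum_nonneg fun _ _ => Finset.sum_nonneg fun _ _ => sq_nonneg _

/-- `diagF ≥ 0`. -/
theorem diagF_nonneg (c : ℤ) (x A : ℝ) (q u v : ℕ) : 0 ≤ diagF c x A q u v :=
  Finset.sum_nonneg fun _ _ => sq_nonneg _

/-- `Foff ≤ F`. -/
theorem Foff_le_F (c : ℤ) (x A : ℝ) (q u v : ℕ) : Foff c x A q u v ≤ F c x A q u v := by
  rw [F_eq_diag_add_off]; linarith [diagF_nonneg c x A q u v]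

/-- `diagF ≤ #rows · #cols²`. -/
theorem diagF_le (c : ℤ) (x A : ℝ) (q u v : ℕ) :
    diagF c x A q u v ≤ ((rows A q u).card : ℝ) * ((cols x A q v).card : ℝ) ^ 2 := by
  unfold diagF
  calc ∑ a ∈ rows A q u, (S c x A q v a a) ^ 2
      ≤ ∑ a ∈ rows A q u, ((cols x A q v).card : ℝ) ^ 2 :=
        Finset.sum_le_sum fun a _ => S_sq_le c x A q v a a
    _ = _ := by simp

/-- The weighted off-diagonal functional. -/
noncomputable def lhsOff (c : ℤ) (δ x A : ℝ) (u v : ℕ → ℕ) : ℝ :=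
  ∑ q ∈ Finset.Icc 1 ⌊x ^ (δ / 2)⌋₊, (q : ℝ) ^ 3 * Foff c x A q (u q) (v q)

/-- The weighted diagonal functional. -/
noncomputable def lhsDiag (c : ℤ) (δ x A : ℝ) (u v : ℕ → ℕ) : ℝ :=
  ∑ q ∈ Finset.Icc 1 ⌊x ^ (δ / 2)⌋₊, (q : ℝ) ^ 3 * diagF c x A q (u q) (v q)

/-- `lhs = lhsDiag + lhsOff`. -/
theorem lhs_eq_diag_add_off (c : ℤ) (δ x A : ℝ) (u v : ℕ → ℕ) :
    lhs c δ x A u v = lhsDiag c δ x A u v + lhsOff c δ x A u v := by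
  unfold lhs lhsDiag lhsOff
  rw [← Finset.sum_add_distrib]
  refine Finset.sum_congr rfl fun q _ => ?_
  rw [F_eq_diag_add_off]; ring

/-- `lhsOff ≥ 0`. -/
theorem lhsOff_nonneg (c : ℤ) (δ x A : ℝ) (u v : ℕ → ℕ) : 0 ≤ lhsOff c δ x A u v :=
  Finset.sum_nonneg fun q _ => mul_nonneg (by positivity) (Foff_nonneg c x A q (u q) (v q))

/-- `lhsDiag ≥ 0`. -/
theorem lhsDiag_nonneg (c : ℤ) (δ x A : ℝ) (u v : ℕ → ℕ) : 0 ≤ lhsDiag c δ x A u v :=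
  Finset.sum_nonneg fun q _ => mul_nonneg (by positivity) (diagF_nonneg c x A q (u q) (v q))

/-- `lhsOff ≤ lhs`. -/
theorem lhsOff_le_lhs (c : ℤ) (δ x A : ℝ) (u v : ℕ → ℕ) : lhsOff c δ x A u v ≤ lhs c δ x A u v := by
  rw [lhs_eq_diag_add_off]; linarith [lhsDiag_nonneg c δ x A u v]

/-- The crux with `F` replaced by its off-diagonal part `Foff`. -/
def OffDiagonalTableChowla : Prop :=
  ∀ c : ℤ, c ≠ 0 → ∀ δ : ℝ, 0 < δ → δ ≤ 1 / 12 → ∀ C : ℝ, 0 < C → ∃ x₀ : ℝ, ∀ x : ℝ, x₀ ≤ x →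
    ∀ A : ℝ, x ^ δ ≤ A → A ≤ x ^ (1 / 3 + δ) → ∀ u v : ℕ → ℕ,
      lhsOff c δ x A u v ≤ x ^ 2 / Real.log x ^ C

/-- (f) The crux implies its off-diagonal part. -/
theorem crux_imp_offDiagonal (h : DilatedTableChowla) : OffDiagonalTableChowla := by
  rw [crux_iff_lhs] at h
  intro c hc δ hδ hδ' C hC
  obtain ⟨x₀, hx₀⟩ := h c hc δ hδ hδ' C hC
  exact ⟨x₀, fun x hx A hA1 hA2 u v => (lhsOff_le_lhs c δ x A u v).trans (hx₀ x hx A hA1 hA2 u v)⟩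

/-- Window bookkeeping: in the crux's range, `1 ≤ q ≤ x^{δ/2} ≤ A`, `A q ≤ x`, hence
`#rows ≤ 3A/q` and `#cols ≤ 2x/(Aq)`. -/
theorem window_counts {δ x A : ℝ} (hδ : 0 < δ) (hδ' : δ ≤ 1 / 12) (hx : 1 ≤ x) (hA1 : x ^ δ ≤ A)
    (hA2 : A ≤ x ^ (1 / 3 + δ)) {q : ℕ} (hq1 : 1 ≤ q) (hq2 : q ≤ ⌊x ^ (δ / 2)⌋₊) (u v : ℕ) :
    ((rows A q u).card : ℝ) ≤ 3 * A / q ∧ ((cols x A q v).card : ℝ) ≤ 2 * x / (A * q) ∧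
      (q : ℝ) ≤ x ^ (δ / 2) ∧ (q : ℝ) ≤ A ∧ A * q ≤ x ∧ 1 ≤ A := by
  have hxpos : 0 < x := by linarith
  have hqpos : (0 : ℝ) < q := by exact_mod_cast hq1
  have hqx : (q : ℝ) ≤ x ^ (δ / 2) := by
    have := Nat.floor_le (Real.rpow_nonneg hxpos.le (δ / 2))
    exact le_trans (by exact_mod_cast hq2) this
  have hxd : x ^ (δ / 2) ≤ x ^ δ := Real.rpow_le_rpow_of_exponent_le hx (by linarith)
  have h1A : 1 ≤ A := le_trans (Real.one_le_rpow hx hδ.le) hA1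
  have hApos : 0 < A := by linarith
  have hqA : (q : ℝ) ≤ A := hqx.trans (hxd.trans hA1)
  have hAq : A * q ≤ x := by
    calc A * q ≤ x ^ (1 / 3 + δ) * x ^ (δ / 2) := by gcongr
      _ = x ^ (1 / 3 + δ + δ / 2) := by rw [← Real.rpow_add hxpos]
      _ ≤ x ^ (1 : ℝ) := Real.rpow_le_rpow_of_exponent_le hx (by linarith)
      _ = x := Real.rpow_one x
  refine ⟨?_, ?_, hqx, hqA, hAq, h1A⟩
  · have hr := (card_rows_bounds A hApos.le q u hq1).2
    have hfl : ((⌊2 * A⌋₊ : ℝ) - ⌊A⌋₊) ≤ A + 1 := by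
      have h1 : (⌊2 * A⌋₊ : ℝ) ≤ 2 * A := Nat.floor_le (by linarith)
      have h2 : A - 1 < (⌊A⌋₊ : ℝ) := by
        have := Nat.lt_floor_add_one A; linarith
      linarith
    have : ((⌊2 * A⌋₊ : ℝ) - ⌊A⌋₊) / q + 1 ≤ 3 * A / q := by
      rw [div_add_one hqpos.ne', div_le_div_iff_of_pos_right hqpos]; linarith
    exact hr.trans this
  · have hc := (card_cols_bounds x A q v hq1).2
    have hfl : (⌊x / A⌋₊ : ℝ) ≤ x / A := Nat.floor_le (div_nonneg hxpos.le hApos.le)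
    have : (⌊x / A⌋₊ : ℝ) / q + 1 ≤ 2 * x / (A * q) := by
      have hAq' : 0 < A * q := by positivity
      rw [div_add_one hqpos.ne', div_le_div_iff₀ hqpos hAq']
      have : (⌊x / A⌋₊ : ℝ) * A ≤ x := by rwa [← le_div_iff₀ hApos]
      nlinarith
    exact hc.trans this

/-- Uniform bound for the weighted diagonal mass: `lhsDiag ≤ 12 x² / x^{δ/2}`. -/
theorem lhsDiag_le {c : ℤ} {δ x A : ℝ} (hδ : 0 < δ) (hδ' : δ ≤ 1 / 12) (hx : 1 ≤ x)
    (hA1 : x ^ δ ≤ A) (hA2 : A ≤ x ^ (1 / 3 + δ)) (u v : ℕ → ℕ) :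
    lhsDiag c δ x A u v ≤ 12 * x ^ 2 / x ^ (δ / 2) := by
  have hxpos : 0 < x := by linarith
  have hxd2 : 0 < x ^ (δ / 2) := Real.rpow_pos_of_pos hxpos _
  have hxd : 0 < x ^ δ := Real.rpow_pos_of_pos hxpos _
  have h1A : 1 ≤ A := le_trans (Real.one_le_rpow hx hδ.le) hA1
  have hApos : 0 < A := by linarith
  have hterm : ∀ q ∈ Finset.Icc 1 ⌊x ^ (δ / 2)⌋₊,
      (q : ℝ) ^ 3 * diagF c x A q (u q) (v q) ≤ 12 * x ^ 2 / A := by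
    intro q hq
    obtain ⟨hq1, hq2⟩ := Finset.mem_Icc.1 hq
    have hqpos : (0 : ℝ) < q := by exact_mod_cast hq1
    obtain ⟨hr, hcl, -, -, -, -⟩ := window_counts hδ hδ' hx hA1 hA2 hq1 hq2 (u q) (v q)
    have hd := diagF_le c x A q (u q) (v q)
    calc (q : ℝ) ^ 3 * diagF c x A q (u q) (v q)
        ≤ (q : ℝ) ^ 3 * ((3 * A / q) * (2 * x / (A * q)) ^ 2) := by
          gcongr
          exact hd.trans (by gcongr)
      _ = 12 * x ^ 2 / A := by field_simp; ring
  have hQ : ((Finset.Icc 1 ⌊x ^ (δ / 2)⌋₊).card : ℝ) ≤ x ^ (δ / 2) := by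
    rw [Nat.card_Icc, Nat.add_sub_cancel]
    exact Nat.floor_le hxd2.le
  calc lhsDiag c δ x A u v ≤ ∑ q ∈ Finset.Icc 1 ⌊x ^ (δ / 2)⌋₊, 12 * x ^ 2 / A :=
        Finset.sum_le_sum hterm
    _ = ((Finset.Icc 1 ⌊x ^ (δ / 2)⌋₊).card : ℝ) * (12 * x ^ 2 / A) := by
        rw [Finset.sum_const, nsmul_eq_mul]
    _ ≤ x ^ (δ / 2) * (12 * x ^ 2 / x ^ δ) := by gcongr
    _ = 12 * x ^ 2 / x ^ (δ / 2) := by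
        have : x ^ δ = x ^ (δ / 2) * x ^ (δ / 2) := by
          rw [← Real.rpow_add hxpos]; ring_nf
        rw [this]; field_simp

/-- Eventually `K (log x)^C ≤ x^{ε}` (from `isLittleO_log_rpow_rpow_atTop`). -/
theorem eventually_log_rpow_le (K C : ℝ) {ε : ℝ} (hε : 0 < ε) :
    ∃ x₁ : ℝ, ∀ x : ℝ, x₁ ≤ x → K * Real.log x ^ C ≤ x ^ ε := by
  rcases le_or_gt K 0 with hK | hK
  · refine ⟨1, fun x hx => ?_⟩
    have h1 : 0 ≤ Real.log x ^ C := Real.rpow_nonneg (Real.log_nonneg hx) C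
    have h2 : 0 ≤ x ^ ε := Real.rpow_nonneg (by linarith) ε
    nlinarith
  · have hlo := isLittleO_log_rpow_rpow_atTop C hε
    have hev := hlo.def (inv_pos.2 hK)
    obtain ⟨x₁, hx₁⟩ := Filter.eventually_atTop.1 hev
    refine ⟨max x₁ 1, fun x hx => ?_⟩
    have hx1 : x₁ ≤ x := le_trans (le_max_left _ _) hx
    have hx1' : 1 ≤ x := le_trans (le_max_right _ _) hx
    have h := hx₁ x hx1
    rw [Real.norm_of_nonneg (Real.rpow_nonneg (Real.log_nonneg hx1') C),
      Real.norm_of_nonneg (Real.rpow_nonneg (by linarith) ε)] at h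
    calc K * Real.log x ^ C ≤ K * (K⁻¹ * x ^ ε) := by gcongr
      _ = x ^ ε := by field_simp

/-- `2 ≤ log x` for `x ≥ 8`. -/
theorem two_le_log_of_ge_eight {x : ℝ} (hx : 8 ≤ x) : 2 ≤ Real.log x := by
  rw [Real.le_log_iff_exp_le (by linarith)]
  have he := Real.exp_one_lt_d9
  have : Real.exp 2 = Real.exp 1 * Real.exp 1 := by rw [← Real.exp_add]; norm_num
  rw [this]; nlinarith [Real.exp_pos 1]

/-- (f) The off-diagonal statement implies the crux (so they are EQUIVALENT, see below). -/
theorem offDiagonal_imp_crux (h : OffDiagonalTableChowla) : DilatedTableChowla := by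
  rw [crux_iff_lhs]
  intro c hc δ hδ hδ' C hC
  obtain ⟨x₁, hx₁⟩ := h c hc δ hδ hδ' (C + 1) (by linarith)
  obtain ⟨x₂, hx₂⟩ := eventually_log_rpow_le 24 C (half_pos hδ)
  refine ⟨max (max x₁ x₂) 8, fun x hx A hA1 hA2 u v => ?_⟩
  have hx1 : x₁ ≤ x := le_trans (le_trans (le_max_left _ _) (le_max_left _ _)) hx
  have hx2 : x₂ ≤ x := le_trans (le_trans (le_max_right _ _) (le_max_left _ _)) hx
  have hx8 : 8 ≤ x := le_trans (le_max_right _ _) hx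
  have hx1' : 1 ≤ x := by linarith
  have hxpos : 0 < x := by linarith
  have hlog : 2 ≤ Real.log x := two_le_log_of_ge_eight hx8
  have hlogpos : 0 < Real.log x := by linarith
  have hLC : 0 < Real.log x ^ C := Real.rpow_pos_of_pos hlogpos C
  have hoff := hx₁ x hx1 A hA1 hA2 u v
  have hdiag := lhsDiag_le (c := c) hδ hδ' hx1' hA1 hA2 u v
  have h24 := hx₂ x hx2
  have hxd2 : 0 < x ^ (δ / 2) := Real.rpow_pos_of_pos hxpos _
  rw [lhs_eq_diag_add_off]
  -- diagonal part ≤ x²/(2 (log x)^C)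
  have hd : lhsDiag c δ x A u v ≤ x ^ 2 / (2 * Real.log x ^ C) := by
    refine hdiag.trans ?_
    rw [div_le_div_iff₀ hxd2 (by positivity)]
    have : 12 * x ^ 2 * (2 * Real.log x ^ C) = x ^ 2 * (24 * Real.log x ^ C) := by ring
    rw [this]; gcongr
  -- off-diagonal part ≤ x²/(log x)^{C+1} ≤ x²/(2 (log x)^C)
  have ho : lhsOff c δ x A u v ≤ x ^ 2 / (2 * Real.log x ^ C) := by
    refine hoff.trans ?_
    rw [Real.rpow_add_one hlogpos.ne' C]
    apply div_le_div_of_nonneg_left (by positivity) (by positivity)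
    nlinarith
  have : x ^ 2 / (2 * Real.log x ^ C) + x ^ 2 / (2 * Real.log x ^ C) = x ^ 2 / Real.log x ^ C := by
    field_simp; ring
  linarith

/-- (f) **The crux is EQUIVALENT to its off-diagonal part.** -/
theorem crux_iff_offDiagonal : DilatedTableChowla ↔ OffDiagonalTableChowla :=
  ⟨crux_imp_offDiagonal, offDiagonal_imp_crux⟩


/-! ## §10 (h) DIVISION OF LABOUR: a pointwise bound OUTSIDE a sparse exceptional set of dilations suffices

`PointwiseOffExceptional`: for all large `x`, every window scale `A` and all classes there is an
exceptional set `E` of dilations with `Σ_{q∈E} 1/q ≤ (log x)^{-C}/200` such that for every other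
dilation `q ≤ x^{δ/2}` the POINTWISE bound `q⁴ · Foff(q,u q,v q) ≤ x²/(log x)^{C+2}` holds (a
`(log x)^{C+2}` saving over the trivial `x²/q⁴`, off-diagonal only). This implies the crux
(`crux_of_pointwiseOffExceptional`): on `E` the trivial bound costs `36 x² Σ_{q∈E} 1/q`, the generic
dilations cost `(1 + log x^{δ/2}) x²/(log x)^{C+2} ≤ x²/(log x)^{C+1}`, the diagonal `12x²/x^{δ/2}`.
`E` may depend on `x, A` and the classes. This is exactly the room a Siegel-exceptional modulus
`q₁` needs: its multiples `q₁ m ≤ x^{δ/2}` have `Σ 1/q ≤ (1 + log x)/q₁`, affordable iff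
`q₁ ≫ (log x)^{C+1}`; smaller exceptional conductors must be beaten INSIDE the pointwise bound
(Siegel's theorem, ineffectively — allowed, since only `∃ x₀` is asked). -/

/-- Pointwise fourth-moment bound outside a harmonically-sparse exceptional set of dilations. -/
def PointwiseOffExceptional : Prop :=
  ∀ c : ℤ, c ≠ 0 → ∀ δ : ℝ, 0 < δ → δ ≤ 1 / 12 → ∀ C : ℝ, 0 < C → ∃ x₀ : ℝ, ∀ x : ℝ, x₀ ≤ x →
    ∀ A : ℝ, x ^ δ ≤ A → A ≤ x ^ (1 / 3 + δ) → ∀ u v : ℕ → ℕ,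
      ∃ E : Finset ℕ, (∑ q ∈ E, ((q : ℝ))⁻¹) ≤ (Real.log x ^ C)⁻¹ / 200 ∧
        ∀ q : ℕ, 1 ≤ q → q ≤ ⌊x ^ (δ / 2)⌋₊ → q ∉ E →
          (q : ℝ) ^ 4 * Foff c x A q (u q) (v q) ≤ x ^ 2 / Real.log x ^ (C + 2)

/-- `Σ_{q ≤ Q} 1/q ≤ 1 + log Q`. -/
theorem harmonic_Icc_le (Q : ℕ) :
    ∑ q ∈ Finset.Icc 1 Q, ((q : ℝ))⁻¹ ≤ 1 + Real.log Q := by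
  have h := harmonic_le_one_add_log Q
  have e : ((harmonic Q : ℚ) : ℝ) = ∑ q ∈ Finset.Icc 1 Q, ((q : ℝ))⁻¹ := by
    rw [harmonic_eq_sum_Icc]; push_cast; rfl
  linarith [e.symm.le, e.le]

/-- `4 ≤ log x` for `x ≥ 64`. -/
theorem four_le_log_of_ge {x : ℝ} (hx : 64 ≤ x) : 4 ≤ Real.log x := by
  have h2 := Real.log_two_gt_d9
  calc (4 : ℝ) ≤ 6 * Real.log 2 := by linarith
    _ = Real.log ((2 : ℝ) ^ 6) := by rw [Real.log_pow]; norm_num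
    _ ≤ Real.log x := Real.log_le_log (by norm_num) (by norm_num; linarith)

/-- (h) Sufficiency of the pointwise-outside-`E` bound. -/
theorem crux_of_pointwiseOffExceptional (h : PointwiseOffExceptional) : DilatedTableChowla := by
  rw [crux_iff_lhs]
  intro c hc δ hδ hδ' C hC
  obtain ⟨x₁, hx₁⟩ := h c hc δ hδ hδ' C hC
  obtain ⟨x₂, hx₂⟩ := eventually_log_rpow_le 48 C (half_pos hδ)
  refine ⟨max (max x₁ x₂) 64, fun x hx A hA1 hA2 u v => ?_⟩
  have hx1 : x₁ ≤ x := le_trans (le_trans (le_max_left _ _) (le_max_left _ _)) hx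
  have hx2 : x₂ ≤ x := le_trans (le_trans (le_max_right _ _) (le_max_left _ _)) hx
  have hx64 : 64 ≤ x := le_trans (le_max_right _ _) hx
  have hx1' : 1 ≤ x := by linarith
  have hxpos : 0 < x := by linarith
  have hlog4 : 4 ≤ Real.log x := four_le_log_of_ge hx64
  have hlogpos : 0 < Real.log x := by linarith
  have hL : 0 < Real.log x ^ C := Real.rpow_pos_of_pos hlogpos C
  have hxd2 : 0 < x ^ (δ / 2) := Real.rpow_pos_of_pos hxpos _
  obtain ⟨E, hE, hpt⟩ := hx₁ x hx1 A hA1 hA2 u v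
  rw [lhs_eq_diag_add_off]
  -- (1) the diagonal
  have hd : lhsDiag c δ x A u v ≤ x ^ 2 / (4 * Real.log x ^ C) := by
    refine (lhsDiag_le (c := c) hδ hδ' hx1' hA1 hA2 u v).trans ?_
    rw [div_le_div_iff₀ hxd2 (by positivity)]
    have : 12 * x ^ 2 * (4 * Real.log x ^ C) = x ^ 2 * (48 * Real.log x ^ C) := by ring
    rw [this]; gcongr; exact hx₂ x hx2
  -- (2) split the off-diagonal functional at E
  set Q : ℕ := ⌊x ^ (δ / 2)⌋₊ with hQdef
  have hQ1 : 1 ≤ Q := Nat.le_floor (by simpa using Real.one_le_rpow hx1' (by linarith : 0 ≤ δ / 2))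
  have hsplit := Finset.sum_filter_add_sum_filter_not (Finset.Icc 1 Q) (fun q => q ∈ E)
    (fun q => (q : ℝ) ^ 3 * Foff c x A q (u q) (v q))
  -- (2a) exceptional dilations: trivial bound `q³ F ≤ 36 x²/q`
  have hexc : ∑ q ∈ (Finset.Icc 1 Q).filter (fun q => q ∈ E), (q : ℝ) ^ 3 * Foff c x A q (u q) (v q)
      ≤ 36 * x ^ 2 * ∑ q ∈ E, ((q : ℝ))⁻¹ := by
    calc ∑ q ∈ (Finset.Icc 1 Q).filter (fun q => q ∈ E), (q : ℝ) ^ 3 * Foff c x A q (u q) (v q)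
        ≤ ∑ q ∈ (Finset.Icc 1 Q).filter (fun q => q ∈ E), 36 * x ^ 2 * ((q : ℝ))⁻¹ := by
          refine Finset.sum_le_sum fun q hq => ?_
          obtain ⟨hq, -⟩ := Finset.mem_filter.1 hq
          obtain ⟨hq1, hq2⟩ := Finset.mem_Icc.1 hq
          have hqpos : (0 : ℝ) < q := by exact_mod_cast hq1
          obtain ⟨hr, hcl, -, -, -, h1A⟩ := window_counts hδ hδ' hx1' hA1 hA2 hq1 hq2 (u q) (v q)
          have hApos : 0 < A := by linarith
          have hF := (Foff_le_F c x A q (u q) (v q)).trans (F_le_trivial c x A q (u q) (v q))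
          calc (q : ℝ) ^ 3 * Foff c x A q (u q) (v q)
              ≤ (q : ℝ) ^ 3 * ((3 * A / q) ^ 2 * (2 * x / (A * q)) ^ 2) := by
                gcongr
                exact hF.trans (by gcongr)
            _ = 36 * x ^ 2 * ((q : ℝ))⁻¹ := by field_simp; ring
      _ ≤ ∑ q ∈ E, 36 * x ^ 2 * ((q : ℝ))⁻¹ :=
          Finset.sum_le_sum_of_subset_of_nonneg (fun q hq => (Finset.mem_filter.1 hq).2)
            fun q _ _ => by positivity
      _ = 36 * x ^ 2 * ∑ q ∈ E, ((q : ℝ))⁻¹ := by rw [Finset.mul_sum]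
  -- (2b) generic dilations: the pointwise hypothesis and the harmonic sum
  have hgen : ∑ q ∈ (Finset.Icc 1 Q).filter (fun q => ¬ q ∈ E), (q : ℝ) ^ 3 * Foff c x A q (u q) (v q)
      ≤ (1 + Real.log Q) * (x ^ 2 / Real.log x ^ (C + 2)) := by
    calc ∑ q ∈ (Finset.Icc 1 Q).filter (fun q => ¬ q ∈ E), (q : ℝ) ^ 3 * Foff c x A q (u q) (v q)
        ≤ ∑ q ∈ (Finset.Icc 1 Q).filter (fun q => ¬ q ∈ E), ((q : ℝ))⁻¹ * (x ^ 2 / Real.log x ^ (C + 2)) := by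
          refine Finset.sum_le_sum fun q hq => ?_
          obtain ⟨hq, hqE⟩ := Finset.mem_filter.1 hq
          obtain ⟨hq1, hq2⟩ := Finset.mem_Icc.1 hq
          have hqpos : (0 : ℝ) < q := by exact_mod_cast hq1
          have hp := hpt q hq1 hq2 hqE
          calc (q : ℝ) ^ 3 * Foff c x A q (u q) (v q)
              = ((q : ℝ))⁻¹ * ((q : ℝ) ^ 4 * Foff c x A q (u q) (v q)) := by field_simp
            _ ≤ ((q : ℝ))⁻¹ * (x ^ 2 / Real.log x ^ (C + 2)) := by gcongr
      _ ≤ ∑ q ∈ Finset.Icc 1 Q, ((q : ℝ))⁻¹ * (x ^ 2 / Real.log x ^ (C + 2)) :=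
          Finset.sum_le_sum_of_subset_of_nonneg (Finset.filter_subset _ _) fun q _ _ => by positivity
      _ = (∑ q ∈ Finset.Icc 1 Q, ((q : ℝ))⁻¹) * (x ^ 2 / Real.log x ^ (C + 2)) := by rw [Finset.sum_mul]
      _ ≤ (1 + Real.log Q) * (x ^ 2 / Real.log x ^ (C + 2)) := by
          gcongr; exact harmonic_Icc_le Q
  -- (3) numerics: 1 + log Q ≤ log x, (log x)^{C+2} = (log x)^C (log x)², log x ≥ 4
  have hQpos : (0 : ℝ) < Q := by exact_mod_cast hQ1
  have hlogQ : Real.log Q ≤ δ / 2 * Real.log x := by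
    have hQle : (Q : ℝ) ≤ x ^ (δ / 2) := Nat.floor_le hxd2.le
    calc Real.log Q ≤ Real.log (x ^ (δ / 2)) := Real.log_le_log hQpos hQle
      _ = δ / 2 * Real.log x := Real.log_rpow hxpos _
  have h1logQ : 1 + Real.log Q ≤ Real.log x := by nlinarith
  have hpow : Real.log x ^ (C + 2) = Real.log x ^ C * Real.log x ^ 2 := by
    rw [Real.rpow_add hlogpos, Real.rpow_two]
  have hgen' : (1 + Real.log Q) * (x ^ 2 / Real.log x ^ (C + 2)) ≤ x ^ 2 / (4 * Real.log x ^ C) := by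
    rw [hpow]
    calc (1 + Real.log Q) * (x ^ 2 / (Real.log x ^ C * Real.log x ^ 2))
        ≤ Real.log x * (x ^ 2 / (Real.log x ^ C * Real.log x ^ 2)) := by gcongr
      _ = x ^ 2 / (Real.log x ^ C * Real.log x) := by field_simp
      _ ≤ x ^ 2 / (4 * Real.log x ^ C) := by
          apply div_le_div_of_nonneg_left (by positivity) (by positivity)
          nlinarith
  have hexc' : 36 * x ^ 2 * ∑ q ∈ E, ((q : ℝ))⁻¹ ≤ x ^ 2 / (4 * Real.log x ^ C) := by
    calc 36 * x ^ 2 * ∑ q ∈ E, ((q : ℝ))⁻¹ ≤ 36 * x ^ 2 * ((Real.log x ^ C)⁻¹ / 200) := by gcongr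
      _ ≤ x ^ 2 / (4 * Real.log x ^ C) := by
          rw [div_eq_mul_inv (x ^ 2), mul_inv]
          nlinarith [inv_pos.2 hL, sq_nonneg x]
  have hoff : lhsOff c δ x A u v ≤ x ^ 2 / (4 * Real.log x ^ C) + x ^ 2 / (4 * Real.log x ^ C) := by
    unfold lhsOff
    rw [← hQdef, ← hsplit]
    linarith [hexc, hgen, hgen', hexc']
  have : x ^ 2 / (4 * Real.log x ^ C) + x ^ 2 / (4 * Real.log x ^ C) + x ^ 2 / (4 * Real.log x ^ C)
      ≤ x ^ 2 / Real.log x ^ C := by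
    rw [← add_div, ← add_div, div_le_div_iff₀ (by positivity) hL]
    nlinarith [sq_nonneg x, hL]
  linarith


/-! ## §11 (k') NECESSITY by Markov: the crux forces the pointwise bound off a harmonically small set

Converse companion of §10: from `Σ_q q³F_q ≤ R := x²/(log x)^C`, for every `K > 0` the dilations
with `q⁴ F_q > K·R` have harmonic mass `Σ 1/q ≤ 1/K` (`crux_imp_pointwise_markov`). So, up to the
powers of `log x` lost between the two directions, the crux IS a "pointwise bound outside a
harmonically-sparse exceptional set of dilations" statement. -/

/-- (k') **Markov necessity**: under the crux, for every `K > 0` the dilations `q ≤ x^{δ/2}` with `q⁴ F(q,u q,v q) > K · x²/(log x)^C` have harmonic mass `Σ 1/q ≤ 1/K`. -/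
theorem crux_imp_pointwise_markov (h : DilatedTableChowla) :
    ∀ c : ℤ, c ≠ 0 → ∀ δ : ℝ, 0 < δ → δ ≤ 1 / 12 → ∀ C : ℝ, 0 < C → ∃ x₀ : ℝ, ∀ x : ℝ, x₀ ≤ x →
      ∀ A : ℝ, x ^ δ ≤ A → A ≤ x ^ (1 / 3 + δ) → ∀ u v : ℕ → ℕ, ∀ K : ℝ, 0 < K →
        (∑ q ∈ (Finset.Icc 1 ⌊x ^ (δ / 2)⌋₊).filter
            (fun q : ℕ => K * (x ^ 2 / Real.log x ^ C) < (q : ℝ) ^ 4 * F c x A q (u q) (v q)),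
          ((q : ℝ))⁻¹) ≤ K⁻¹ := by
  rw [crux_iff_lhs] at h
  intro c hc δ hδ hδ' C hC
  obtain ⟨x₀, hx₀⟩ := h c hc δ hδ hδ' C hC
  refine ⟨max x₀ 3, fun x hx A hA1 hA2 u v K hK => ?_⟩
  have hx0 : x₀ ≤ x := le_trans (le_max_left _ _) hx
  have hx3 : (3 : ℝ) ≤ x := le_trans (le_max_right _ _) hx
  have hlog : 0 < Real.log x := Real.log_pos (by linarith)
  have hR : 0 < x ^ 2 / Real.log x ^ C := div_pos (by positivity) (Real.rpow_pos_of_pos hlog C)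
  set R : ℝ := x ^ 2 / Real.log x ^ C with hRdef
  set E := (Finset.Icc 1 ⌊x ^ (δ / 2)⌋₊).filter
    (fun q : ℕ => K * R < (q : ℝ) ^ 4 * F c x A q (u q) (v q)) with hE
  have key := hx₀ x hx0 A hA1 hA2 u v
  have hsum : K * R * ∑ q ∈ E, ((q : ℝ))⁻¹ ≤ lhs c δ x A u v := by
    rw [Finset.mul_sum]
    unfold lhs
    calc ∑ q ∈ E, K * R * ((q : ℝ))⁻¹ ≤ ∑ q ∈ E, (q : ℝ) ^ 3 * F c x A q (u q) (v q) := by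
          refine Finset.sum_le_sum fun q hq => ?_
          obtain ⟨hq, hqK⟩ := Finset.mem_filter.1 hq
          obtain ⟨hq1, -⟩ := Finset.mem_Icc.1 hq
          have hqpos : (0 : ℝ) < q := by exact_mod_cast hq1
          have : (q : ℝ) ^ 3 * F c x A q (u q) (v q) = ((q : ℝ))⁻¹ * ((q : ℝ) ^ 4 * F c x A q (u q) (v q)) := by
            field_simp
          rw [this, mul_comm (K * R)]
          gcongr
      _ ≤ ∑ q ∈ Finset.Icc 1 ⌊x ^ (δ / 2)⌋₊, (q : ℝ) ^ 3 * F c x A q (u q) (v q) :=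
          Finset.sum_le_sum_of_subset_of_nonneg (Finset.filter_subset _ _)
            fun q _ _ => term_nonneg c x A q (u q) (v q)
  have this : K * R * ∑ q ∈ E, ((q : ℝ))⁻¹ ≤ R := hsum.trans key
  have hKR : 0 < K * R := mul_pos hK hR
  have h2 : ∑ q ∈ E, ((q : ℝ))⁻¹ ≤ R / (K * R) := (le_div_iff₀' hKR).2 this
  calc ∑ q ∈ E, ((q : ℝ))⁻¹ ≤ R / (K * R) := h2
    _ = K⁻¹ := by field_simp


/-! ## §11b (k'') EXACT EQUIVALENCE: the crux IS the pointwise-off-sparse statement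

`PointwiseOffSparse` — the shape of the skeleton stub (C⁺) of `Lines/positivity-quarantine.lean`
with its one-point hypothesis dropped: for all large `x`, all `A`, `u`, `v` there is a set `E'` of
dilations with `Σ_{q∈E'} 1/q ≤ (log x)^{-C}` such that `q⁴ F(q,u q,v q) ≤ x²/(log x)^C` for every
other `q ≤ x^{δ/2}`.  Because both statements ask `∀ C`, the log-power losses of §10 (sufficiency at
`C+2` with mass `(log x)^{-C}/200`) and §11 (Markov) are absorbed:
`crux_iff_pointwiseOffSparse : DilatedTableChowla ↔ PointwiseOffSparse`. -/

/-- The pointwise block bound off a harmonically sparse exceptional set of dilations (the (C⁺) stub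
of the skeleton `positivity-quarantine` WITHOUT its one-point hypothesis). -/
def PointwiseOffSparse : Prop :=
  ∀ c : ℤ, c ≠ 0 → ∀ δ : ℝ, 0 < δ → δ ≤ 1 / 12 → ∀ C : ℝ, 0 < C →
    ∃ x₀ : ℝ, ∀ x : ℝ, x₀ ≤ x → ∀ A : ℝ, x ^ δ ≤ A → A ≤ x ^ (1 / 3 + δ) → ∀ u v : ℕ → ℕ,
      ∃ E' : Finset ℕ, (∑ q ∈ E', ((q : ℝ))⁻¹) ≤ (Real.log x ^ C)⁻¹ ∧
        ∀ q : ℕ, 1 ≤ q → q ≤ ⌊x ^ (δ / 2)⌋₊ → q ∉ E' →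
          (q : ℝ) ^ 4 * F c x A q (u q) (v q) ≤ x ^ 2 / Real.log x ^ C

/-- (k'') The crux implies the pointwise-off-sparse statement (Markov, §11, at exponent `2C` with
threshold `K = (log x)^C`). -/
theorem crux_imp_pointwiseOffSparse (h : DilatedTableChowla) : PointwiseOffSparse := by
  intro c hc δ hδ hδ' C hC
  obtain ⟨x₀, hx₀⟩ := crux_imp_pointwise_markov h c hc δ hδ hδ' (C + C) (by positivity)
  refine ⟨max x₀ 3, fun x hx A hA1 hA2 u v => ?_⟩
  have hx0 : x₀ ≤ x := le_trans (le_max_left _ _) hx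
  have hx3 : (3 : ℝ) ≤ x := le_trans (le_max_right _ _) hx
  have hlog : 0 < Real.log x := Real.log_pos (by linarith)
  have hLC : 0 < Real.log x ^ C := Real.rpow_pos_of_pos hlog C
  have hmass := hx₀ x hx0 A hA1 hA2 u v (Real.log x ^ C) hLC
  refine ⟨(Finset.Icc 1 ⌊x ^ (δ / 2)⌋₊).filter (fun q : ℕ =>
      Real.log x ^ C * (x ^ 2 / Real.log x ^ (C + C)) < (q : ℝ) ^ 4 * F c x A q (u q) (v q)),
    hmass, fun q hq1 hq2 hqE => ?_⟩
  have hle : (q : ℝ) ^ 4 * F c x A q (u q) (v q) ≤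
      Real.log x ^ C * (x ^ 2 / Real.log x ^ (C + C)) := by
    by_contra hlt
    exact hqE (Finset.mem_filter.2 ⟨Finset.mem_Icc.2 ⟨hq1, hq2⟩, lt_of_not_ge hlt⟩)
  have heq : Real.log x ^ C * (x ^ 2 / Real.log x ^ (C + C)) = x ^ 2 / Real.log x ^ C := by
    rw [Real.rpow_add hlog C C]
    field_simp
  exact hle.trans_eq heq

/-- (k'') Conversely the pointwise-off-sparse statement implies the crux (§10 at exponent `C`, fed
by `PointwiseOffSparse` at exponent `C + 3`: `(log x)^{-3} ≤ 1/200` once `log x ≥ 6`). -/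
theorem pointwiseOffSparse_imp_crux (h : PointwiseOffSparse) : DilatedTableChowla := by
  apply crux_of_pointwiseOffExceptional
  intro c hc δ hδ hδ' C hC
  obtain ⟨x₀, hx₀⟩ := h c hc δ hδ hδ' (C + 3) (by linarith)
  refine ⟨max x₀ (Real.exp 6), fun x hx A hA1 hA2 u v => ?_⟩
  have hx0 : x₀ ≤ x := le_trans (le_max_left _ _) hx
  have hxe : Real.exp 6 ≤ x := le_trans (le_max_right _ _) hx
  have hxpos : 0 < x := lt_of_lt_of_le (Real.exp_pos 6) hxe
  have hlog6 : 6 ≤ Real.log x := by rwa [Real.le_log_iff_exp_le hxpos]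
  have hlogpos : 0 < Real.log x := by linarith
  obtain ⟨E, hE, hpt⟩ := hx₀ x hx0 A hA1 hA2 u v
  refine ⟨E, ?_, fun q hq1 hq2 hqE => ?_⟩
  · have hsplit : Real.log x ^ (C + 3) = Real.log x ^ C * Real.log x ^ (3 : ℝ) :=
      Real.rpow_add hlogpos C 3
    have h3 : (200 : ℝ) ≤ Real.log x ^ (3 : ℝ) := by
      rw [show (3 : ℝ) = ((3 : ℕ) : ℝ) by norm_num, Real.rpow_natCast]
      have h63 : (6 : ℝ) ^ 3 ≤ Real.log x ^ 3 := pow_le_pow_left₀ (by norm_num) hlog6 3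
      nlinarith [h63]
    have hLC : 0 < Real.log x ^ C := Real.rpow_pos_of_pos hlogpos C
    calc ∑ q ∈ E, ((q : ℝ))⁻¹ ≤ (Real.log x ^ (C + 3))⁻¹ := hE
      _ = (Real.log x ^ C)⁻¹ * (Real.log x ^ (3 : ℝ))⁻¹ := by rw [hsplit, mul_inv]
      _ ≤ (Real.log x ^ C)⁻¹ * (200 : ℝ)⁻¹ :=
          mul_le_mul_of_nonneg_left (inv_anti₀ (by norm_num) h3) (inv_pos.2 hLC).le
      _ = (Real.log x ^ C)⁻¹ / 200 := by rw [div_eq_mul_inv]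
  · have hp := hpt q hq1 hq2 hqE
    have hF : (q : ℝ) ^ 4 * Foff c x A q (u q) (v q) ≤ (q : ℝ) ^ 4 * F c x A q (u q) (v q) := by
      gcongr
      exact Foff_le_F c x A q (u q) (v q)
    have hmono : x ^ 2 / Real.log x ^ (C + 3) ≤ x ^ 2 / Real.log x ^ (C + 2) := by
      apply div_le_div_of_nonneg_left (by positivity) (Real.rpow_pos_of_pos hlogpos _)
      exact Real.rpow_le_rpow_of_exponent_le (by linarith) (by linarith)
    exact hF.trans (hp.trans hmono)

/-- (k'') **`DilatedTableChowla ↔ PointwiseOffSparse`**: the `ℓ¹`-over-dilations crux IS the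
statement "pointwise block bound `q⁴F ≤ x²/(log x)^C` off a prover-chosen exceptional set of
dilations of harmonic mass `≤ (log x)^{-C}`" — exactly, not only up to powers of `log x`. -/
theorem crux_iff_pointwiseOffSparse : DilatedTableChowla ↔ PointwiseOffSparse :=
  ⟨crux_imp_pointwiseOffSparse, pointwiseOffSparse_imp_crux⟩

/-! ## §12 (l) THE TWO-POINT CHOWLA FORM of the correlations (for provers)

Multiplying by `λ(a)λ(a')`: `λ(ab+c)λ(a'b+c) = λ(a)λ(a') · λ(aa'b + a'c) λ(aa'b + ac)`, so
`S(a,a') = λ(a)λ(a') Σ_{b ∈ cols} λ(n + a'c) λ(n + ac)` with `n = aa'b` running over the multiples of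
`aa'` (intersected with the column class): a genuine two-point Chowla sum `λ(n+h₁)λ(n+h₂)`,
`h₁ − h₂ = (a'−a)c ≠ 0`, along an arithmetic progression of modulus `aa' ≍ A²` with `x/A` terms —
for `A > x^{1/3}` FEWER terms than the modulus. Nearest theorem in print for a FIXED pair:
Tao, arXiv:1509.05422, Thm 1.2 (log-averaged two-point Chowla for `λ(a₁n+b₁)λ(a₂n+b₂)`,
`a₁b₂ − a₂b₁ ≠ 0`, saving `o(1)`); the crux needs it uniformly for `a, a' ≤ x^{5/12}` (length
`x/A ≥ x^{7/12}`), unweighted, with a `(log x)^{-C}` saving on average over pairs — far beyond print,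
but no Ω-result contradicts it. -/

/-- `L(m n) = L m · L n` for a natural `m` and an integer `n ≥ 0`. -/
theorem L_natCast_mul_of_nonneg (m : ℕ) {n : ℤ} (hn : 0 ≤ n) : L ((m : ℤ) * n) = L m * L n := by
  obtain ⟨k, rfl⟩ := Int.eq_ofNat_of_zero_le hn
  exact L_natCast_mul m k

/-- (l) `S(a,a') = λ(a)λ(a') · Σ_b λ(aa'b + a'c) λ(aa'b + ac)` for rows `a, a' ≥ 1` once all entries
are positive (automatic for `c ≥ 0`, and for `c < 0` as soon as `A ≥ |c|`, see `entries_pos`). -/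
theorem S_eq_twoPoint {c : ℤ} {x A : ℝ} {q v a a' : ℕ} (ha : 1 ≤ a) (ha' : 1 ≤ a')
    (hpos : ∀ b ∈ cols x A q v, 0 < (a : ℤ) * b + c ∧ 0 < (a' : ℤ) * b + c) :
    S c x A q v a a' = L a * L a' *
      ∑ b ∈ cols x A q v, L ((a : ℤ) * a' * b + a' * c) * L ((a : ℤ) * a' * b + a * c) := by
  unfold S
  rw [Finset.mul_sum]
  refine Finset.sum_congr rfl fun b hb => ?_
  obtain ⟨h1, h2⟩ := hpos b hb
  have e1 : L ((a : ℤ) * a' * b + a' * c) = L a' * L ((a : ℤ) * b + c) := by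
    rw [show (a : ℤ) * a' * b + a' * c = (a' : ℤ) * ((a : ℤ) * b + c) by ring]
    exact L_natCast_mul_of_nonneg a' h1.le
  have e2 : L ((a : ℤ) * a' * b + a * c) = L a * L ((a' : ℤ) * b + c) := by
    rw [show (a : ℤ) * a' * b + a * c = (a : ℤ) * ((a' : ℤ) * b + c) by ring]
    exact L_natCast_mul_of_nonneg a h2.le
  have sa : L a * L a = 1 := L_mul_self_of_pos (by exact_mod_cast ha)
  have sa' : L a' * L a' = 1 := L_mul_self_of_pos (by exact_mod_cast ha')
  rw [e1, e2]
  linear_combination (-(L ((a : ℤ) * b + c) * L ((a' : ℤ) * b + c) * (L a' * L a'))) * sa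
    + (-(L ((a : ℤ) * b + c) * L ((a' : ℤ) * b + c))) * sa'

/-- All entries are positive once `A ≥ |c|` (so `Int.toNat` never truncates inside the window). -/
theorem entries_pos {c : ℤ} {x A : ℝ} (hA : (|c| : ℝ) ≤ A) {q u v a b : ℕ} (ha : a ∈ rows A q u)
    (hb : b ∈ cols x A q v) : 0 < (a : ℤ) * b + c := by
  have ha1 := (mem_rows.1 ha).1.1
  have hb1 : (1 : ℤ) ≤ b := by exact_mod_cast one_le_of_mem_cols hb
  have hcA : |c| < (a : ℤ) := by
    have hfl : A - 1 < (⌊A⌋₊ : ℝ) := by have := Nat.lt_floor_add_one A; linarith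
    have hfa : ((⌊A⌋₊ : ℕ) : ℝ) + 1 ≤ a := by exact_mod_cast ha1
    have h' : ((|c| : ℤ) : ℝ) < ((a : ℤ) : ℝ) := by
      rw [Int.cast_abs]; push_cast; linarith
    exact_mod_cast h'
  have : -c ≤ |c| := neg_le_abs c
  nlinarith


/-! ## §13 (m) NUMERICS CANNOT REACH THE CLAIM: any admissible `x₀(c=1, δ=1/12, C=1)` exceeds `2¹⁴⁴`

At `x = 2¹⁴⁴ = 64²⁴` (`A = x^δ = 4096`, `x/A = 64²²`, dilations `q ≤ 64`) the DIAGONAL alone, with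
full classes `u = v = 0`, is `≥ 64 · 4032 · (4095/4096)² · 64⁴⁴ ≈ 2.6·10⁵ · 64⁴⁴`, while
`x²/log x = 64⁴⁸/(144 log 2) ≈ 1.7·10⁵ · 64⁴⁴`. So the crux inequality is FALSE at `x = 2¹⁴⁴ ≈ 2·10⁴³`
(and similarly at smaller dyadic scales): the threshold `x₀` lies beyond any computation; numerics
can only probe STRUCTURE (worst classes, the Bai–Yin edge of the table), never the claim itself.
For general `C` the same count pushes `x₀` past `2^{24j}` whenever `2^j < (24 j log 2)^C`
(e.g. `j ≈ 107` for `C = 10`). -/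

/-- (m) **Any admissible `x₀` for `(c, δ, C) = (1, 1/12, 1)` exceeds `2¹⁴⁴`**: at `x = 2¹⁴⁴` (`N = 64`) the diagonal alone beats `x²/log x`. -/
theorem x0_large {x₀ : ℝ}
    (hx₀ : ∀ x : ℝ, x₀ ≤ x → ∀ A : ℝ, x ^ (1 / 12 : ℝ) ≤ A → A ≤ x ^ (1 / 3 + 1 / 12 : ℝ) →
      ∀ u v : ℕ → ℕ, lhs 1 (1 / 12) x A u v ≤ x ^ 2 / Real.log x ^ (1 : ℝ)) :
    (2 : ℝ) ^ 144 < x₀ := by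
  by_contra hle
  rw [not_lt] at hle
  set x : ℝ := (((64 : ℕ) : ℝ)) ^ 24 with hx
  have hx2 : (2 : ℝ) ^ 144 = x := by rw [hx]; push_cast; norm_num
  have hxle : x₀ ≤ x := hle.trans hx2.le
  have hA1 : x ^ (1 / 12 : ℝ) ≤ (((64 : ℕ) : ℝ)) ^ 2 := (pow24_rpow_eq_pow 64 (k := 2) (by norm_num)).le
  have hA2 : (((64 : ℕ) : ℝ)) ^ 2 ≤ x ^ (1 / 3 + 1 / 12 : ℝ) := by
    rw [hx, pow24_rpow_eq_pow 64 (k := 10) (by norm_num)]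
    exact pow_le_pow_right₀ (by norm_num) (by norm_num)
  have key := hx₀ x hxle ((((64 : ℕ) : ℝ)) ^ 2) hA1 hA2 (fun _ => 0) (fun _ => 0)
  have hQ : ⌊x ^ ((1 / 12 : ℝ) / 2)⌋₊ = 64 := by
    rw [hx, pow24_rpow_eq_pow 64 (k := 1) (by norm_num), pow_one, Nat.floor_natCast]
  have hfl1 : ⌊(((64 : ℕ) : ℝ)) ^ 2⌋₊ = 64 ^ 2 := floor_natCast_pow 64 2
  have hfl2 : ⌊2 * (((64 : ℕ) : ℝ)) ^ 2⌋₊ = 2 * 64 ^ 2 := floor_two_mul_natCast_pow 64 2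
  have hxA : ⌊x / (((64 : ℕ) : ℝ)) ^ 2⌋₊ = 64 ^ 22 := by
    rw [hx, pow24_div_pow 64 (by norm_num) (by norm_num), floor_natCast_pow]
  -- the per-dilation diagonal bound (a constant `T`)
  set T : ℝ := 4032 * (4095 / 4096) ^ 2 * (64 : ℝ) ^ 44 with hT
  have hterm : ∀ q : ℕ, q ∈ Finset.Icc 1 64 →
      T ≤ (q : ℝ) ^ 3 * F 1 x ((((64 : ℕ) : ℝ)) ^ 2) q 0 0 := by
    intro q hq
    obtain ⟨hq1, hq64⟩ := Finset.mem_Icc.1 hq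
    have hqpos : (0 : ℝ) < q := by exact_mod_cast hq1
    have hq64' : (q : ℝ) ≤ 64 := by exact_mod_cast hq64
    have hrows := (card_rows_bounds ((((64 : ℕ) : ℝ)) ^ 2) (by positivity) q 0 hq1).1
    rw [hfl1, hfl2] at hrows
    have hcols := (card_cols_bounds x ((((64 : ℕ) : ℝ)) ^ 2) q 0 hq1).1
    rw [hxA] at hcols
    push_cast at hrows hcols
    -- rows ≥ 4096/q - 1 ≥ 4032/q
    have h64q : (1 : ℝ) ≤ 64 / q := by rw [one_le_div hqpos]; exact hq64'
    have erows : ((2 : ℝ) * 64 ^ 2 - 64 ^ 2) / q = 4032 / q + 64 / q := by ring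
    have hrows' : (4032 : ℝ) / q ≤ ((rows ((((64 : ℕ) : ℝ)) ^ 2) q 0).card : ℝ) := by
      linarith
    -- cols ≥ 64²²/q - 1 ≥ (4095/4096) 64²²/q
    have hbig : (1 : ℝ) ≤ (64 : ℝ) ^ 22 / (4096 * q) := by
      rw [one_le_div (by positivity)]
      calc (4096 : ℝ) * q ≤ 4096 * 64 := by gcongr
        _ ≤ (64 : ℝ) ^ 22 := by norm_num
    have ecols : (64 : ℝ) ^ 22 / (4096 * q) = (64 : ℝ) ^ 22 / q - (4095 / 4096) * ((64 : ℝ) ^ 22 / q) := by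
      field_simp; ring
    have hcols' : (4095 / 4096 : ℝ) * ((64 : ℝ) ^ 22 / q) ≤ ((cols x ((((64 : ℕ) : ℝ)) ^ 2) q 0).card : ℝ) := by
      linarith
    have hF := F_ge_of_bounds (c := 1) (by norm_num) x ((((64 : ℕ) : ℝ)) ^ 2) q 0 0 (by positivity)
      hrows' hcols'
    have hq0 : (q : ℝ) ≠ 0 := hqpos.ne'
    calc T = (q : ℝ) ^ 3 * ((4032 / q) * ((4095 / 4096 : ℝ) * ((64 : ℝ) ^ 22 / q)) ^ 2) := by
          rw [hT]; field_simp
      _ ≤ (q : ℝ) ^ 3 * F 1 x ((((64 : ℕ) : ℝ)) ^ 2) q 0 0 := by gcongr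
  have hlow : 64 * T ≤ lhs 1 (1 / 12) x ((((64 : ℕ) : ℝ)) ^ 2) (fun _ => 0) (fun _ => 0) := by
    unfold lhs
    rw [hQ]
    calc 64 * T = ∑ q ∈ Finset.Icc 1 64, T := by rw [Finset.sum_const, Nat.card_Icc]; norm_num
      _ ≤ _ := Finset.sum_le_sum hterm
  -- the right-hand side at x = 64²⁴: 64⁴⁸/(144 log 2) < 64 T
  have h2 := Real.log_two_gt_d9
  have hlog64 : Real.log (((64 : ℕ) : ℝ)) = 6 * Real.log 2 := by
    rw [show (((64 : ℕ) : ℝ)) = (2 : ℝ) ^ 6 by norm_num, Real.log_pow]; norm_num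
  have hrhs : x ^ 2 / Real.log x ^ (1 : ℝ) < 64 * T := by
    rw [Real.rpow_one, hx, ← pow_mul, log_pow24, hlog64]
    rw [div_lt_iff₀ (by linarith)]
    push_cast
    have hK : (16777216 : ℝ) < 64 * (4032 * (4095 / 4096) ^ 2) * (24 * (6 * Real.log 2)) := by
      linarith
    calc (64 : ℝ) ^ (24 * 2) = 64 ^ 44 * 16777216 := by norm_num
      _ < 64 ^ 44 * (64 * (4032 * (4095 / 4096) ^ 2) * (24 * (6 * Real.log 2))) := by gcongr
      _ = 64 * T * (24 * (6 * Real.log 2)) := by rw [hT]; ring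
  linarith


/-! ## §14 (h') Which exceptional moduli are affordable: multiples of `q₁` have harmonic mass `≤ (1+log Q)/q₁`

So in §10 one may take `E = {q ≤ x^{δ/2} : q₁ ∣ q}` for any single modulus
`q₁ ≥ 200 (1 + log x) (log x)^C` (`multiples_admissible`) — e.g. a Siegel-exceptional conductor beyond
`(log x)^{C+1+ε}`; exceptional conductors below that must be handled inside the pointwise bound. -/

/-- Harmonic mass of the multiples of `q₁` up to `Q`. -/
theorem sum_inv_multiples_le {q₁ : ℕ} (hq₁ : 1 ≤ q₁) (Q : ℕ) :
    ∑ q ∈ (Finset.Icc 1 Q).filter (fun q => q₁ ∣ q), ((q : ℝ))⁻¹ ≤ (1 + Real.log Q) / q₁ := by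
  have hq₁pos : (0 : ℝ) < q₁ := by exact_mod_cast hq₁
  -- the multiples of q₁ in [1, Q] are the image of [1, Q/q₁] under (· * q₁)
  have hsub : (Finset.Icc 1 Q).filter (fun q => q₁ ∣ q) ⊆
      (Finset.Icc 1 (Q / q₁)).image (fun k => k * q₁) := by
    intro q hq
    obtain ⟨hq, ⟨k, rfl⟩⟩ := Finset.mem_filter.1 hq
    obtain ⟨h1, h2⟩ := Finset.mem_Icc.1 hq
    refine Finset.mem_image.2 ⟨k, Finset.mem_Icc.2 ⟨?_, ?_⟩, by ring⟩
    · rcases Nat.eq_zero_or_pos k with hk | hk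
      · subst hk; simp at h1
      · exact hk
    · exact (Nat.le_div_iff_mul_le (by omega)).2 (by simpa [mul_comm] using h2)
  have hinj : Set.InjOn (fun k : ℕ => k * q₁) (Finset.Icc 1 (Q / q₁) : Set ℕ) :=
    fun a _ b _ hab => Nat.eq_of_mul_eq_mul_right (by omega) hab
  calc ∑ q ∈ (Finset.Icc 1 Q).filter (fun q => q₁ ∣ q), ((q : ℝ))⁻¹
      ≤ ∑ q ∈ (Finset.Icc 1 (Q / q₁)).image (fun k => k * q₁), ((q : ℝ))⁻¹ :=
        Finset.sum_le_sum_of_subset_of_nonneg hsub fun q _ _ => by positivity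
    _ = ∑ k ∈ Finset.Icc 1 (Q / q₁), (((k * q₁ : ℕ) : ℝ))⁻¹ := Finset.sum_image hinj
    _ = (∑ k ∈ Finset.Icc 1 (Q / q₁), ((k : ℝ))⁻¹) / q₁ := by
        rw [Finset.sum_div]
        refine Finset.sum_congr rfl fun k _ => ?_
        push_cast
        rw [mul_inv, div_eq_mul_inv]
    _ ≤ (1 + Real.log ((Q / q₁ : ℕ) : ℝ)) / q₁ := by
        gcongr; exact harmonic_Icc_le (Q / q₁)
    _ ≤ (1 + Real.log Q) / q₁ := by
        apply div_le_div_of_nonneg_right _ hq₁pos.le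
        have : Real.log ((Q / q₁ : ℕ) : ℝ) ≤ Real.log Q := by
          rcases Nat.eq_zero_or_pos (Q / q₁) with h0 | hpos
          · rw [h0, Nat.cast_zero, Real.log_zero]; exact Real.log_natCast_nonneg Q
          · exact Real.log_le_log (by exact_mod_cast hpos) (by exact_mod_cast Nat.div_le_self Q q₁)
        linarith

/-- (h') A single large modulus is affordable: its multiples satisfy the §10 condition. -/
theorem multiples_admissible {x : ℝ} (hx : 1 < x) {C δ : ℝ} (hδ2 : δ ≤ 2) {q₁ : ℕ}
    (hq₁ : 1 ≤ q₁) (hbig : 200 * (1 + Real.log x) * Real.log x ^ C ≤ q₁) :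
    ∑ q ∈ (Finset.Icc 1 ⌊x ^ (δ / 2)⌋₊).filter (fun q => q₁ ∣ q), ((q : ℝ))⁻¹
      ≤ (Real.log x ^ C)⁻¹ / 200 := by
  have hlog : 0 < Real.log x := Real.log_pos hx
  have hL : 0 < Real.log x ^ C := Real.rpow_pos_of_pos hlog C
  have hq₁pos : (0 : ℝ) < q₁ := by exact_mod_cast hq₁
  set Q : ℕ := ⌊x ^ (δ / 2)⌋₊ with hQ
  have hQx : (Q : ℝ) ≤ x := by
    calc (Q : ℝ) ≤ x ^ (δ / 2) := Nat.floor_le (Real.rpow_nonneg (by linarith) _)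
      _ ≤ x ^ (1 : ℝ) := Real.rpow_le_rpow_of_exponent_le hx.le (by linarith)
      _ = x := Real.rpow_one x
  have hlogQ : Real.log Q ≤ Real.log x := by
    rcases Nat.eq_zero_or_pos Q with h0 | hpos
    · rw [h0]; simp; exact hlog.le
    · exact Real.log_le_log (by exact_mod_cast hpos) hQx
  calc ∑ q ∈ (Finset.Icc 1 Q).filter (fun q => q₁ ∣ q), ((q : ℝ))⁻¹
      ≤ (1 + Real.log Q) / q₁ := sum_inv_multiples_le hq₁ Q
    _ ≤ (1 + Real.log x) / q₁ := by gcongr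
    _ ≤ (1 + Real.log x) / (200 * (1 + Real.log x) * Real.log x ^ C) :=
        div_le_div_of_nonneg_left (by linarith) (by positivity) hbig
    _ = (Real.log x ^ C)⁻¹ / 200 := by field_simp

/-! ## §15 (g) THE CHEAP δ-FRONTIER: with the crux's own dilation range, `δ = 1/2` dies by counting

At `δ = 1/2` the window reaches `A = x^{5/6}`: with `x = N¹²`, `A = N¹⁰`, only `N²` columns but
dilations up to `N³`; for `N² < q ≤ N³` the column class `b ≡ 1 (q)` is the single column `{1}`,
so `F(q,0,1) = #rows² ≥ (N¹⁰/(2q))²` with no cancellation possible, and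
`Σ_{N²<q≤N³} q³ (N¹⁰/(2q))² ≥ N²⁵/8 > x² ≥ x²/log x`. The same count works for every `δ > 4/9`
(`A²Q² > x²`, i.e. `1/3 + δ > 1 − δ/2`); for `1/12 < δ ≤ 4/9` nothing cheap is known — the honest
frontier of (a3). -/

/-- `(N^k)^e = N^{k e}` (real powers). -/
theorem rpow_natPow (N k : ℕ) (e : ℝ) : ((((N : ℝ)) ^ k) : ℝ) ^ e = (N : ℝ) ^ ((k : ℝ) * e) := by
  rw [show ((N : ℝ) ^ k : ℝ) = (N : ℝ) ^ ((k : ℕ) : ℝ) by rw [Real.rpow_natCast],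
    ← Real.rpow_mul (Nat.cast_nonneg N)]

/-- `(N^k)^e = N^j` when `k e = j`. -/
theorem natPow_rpow_eq_pow (N k : ℕ) {e : ℝ} {j : ℕ} (h : (k : ℝ) * e = j) :
    ((((N : ℝ)) ^ k) : ℝ) ^ e = (N : ℝ) ^ j := by
  rw [rpow_natPow, h, Real.rpow_natCast]

/-- `N^k / N^j = N^{k−j}` for `j ≤ k`, `N ≠ 0`. -/
theorem natPow_div_natPow (N : ℕ) (hN : N ≠ 0) {j k : ℕ} (hj : j ≤ k) :
    ((N : ℝ)) ^ k / (N : ℝ) ^ j = (N : ℝ) ^ (k - j) := by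
  have hN' : (N : ℝ) ≠ 0 := by exact_mod_cast hN
  rw [div_eq_iff (pow_ne_zero _ hN'), ← pow_add, Nat.sub_add_cancel hj]

/-- With a single column every `S(a,a')² = 1` (`c ≥ 0`): `F = #rows²`. -/
theorem F_of_cols_eq_singleton {c : ℤ} (hc : 0 ≤ c) {x A : ℝ} {q u v : ℕ}
    (h : cols x A q v = {1}) : F c x A q u v = (((rows A q u).card : ℝ)) ^ 2 := by
  unfold F
  have : ∀ a ∈ rows A q u, ∀ a' ∈ rows A q u, (S c x A q v a a') ^ 2 = 1 := by
    intro a ha a' ha'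
    have h1 : (1 : ℤ) ≤ a := by exact_mod_cast one_le_of_mem_rows ha
    have h2 : (1 : ℤ) ≤ a' := by exact_mod_cast one_le_of_mem_rows ha'
    unfold S
    rw [h, Finset.sum_singleton, mul_pow, L_sq_of_pos (by push_cast; linarith),
      L_sq_of_pos (by push_cast; linarith), mul_one]
  rw [Finset.sum_congr rfl fun a ha => Finset.sum_congr rfl fun a' ha' => this a ha a' ha']
  simp; ring

/-- The crux at the single value `δ = 1/2` (everything else unchanged). -/
def AtDeltaHalf : Prop :=
  ∀ c : ℤ, c ≠ 0 → ∀ C : ℝ, 0 < C → ∃ x₀ : ℝ, ∀ x : ℝ, x₀ ≤ x →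
    ∀ A : ℝ, x ^ (1 / 2 : ℝ) ≤ A → A ≤ x ^ (1 / 3 + 1 / 2 : ℝ) → ∀ u v : ℕ → ℕ,
      lhs c (1 / 2) x A u v ≤ x ^ 2 / Real.log x ^ C

/-- (g) `δ = 1/2` is refuted by counting alone. -/
theorem false_at_delta_half : ¬ AtDeltaHalf := by
  intro h
  obtain ⟨x₀, hx₀⟩ := h 1 one_ne_zero 1 one_pos
  obtain ⟨N, hN8, hxN1, -⟩ := exists_scale x₀ 8 (by norm_num)
  have hN1 : 1 ≤ N := by omega
  have hN0 : N ≠ 0 := by omega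
  have hNpos : (0 : ℝ) < N := by exact_mod_cast (by omega : 0 < N)
  have hN1' : (1 : ℝ) ≤ N := by exact_mod_cast hN1
  set x : ℝ := ((N : ℝ)) ^ 12 with hx
  have hxN : x₀ ≤ x := hxN1.trans (le_self_pow₀ hN1' (by norm_num))
  have hA1 : x ^ (1 / 2 : ℝ) ≤ (N : ℝ) ^ 10 := by
    rw [hx, natPow_rpow_eq_pow N 12 (j := 6) (by norm_num)]
    exact pow_le_pow_right₀ hN1' (by norm_num)
  have hA2 : ((N : ℝ)) ^ 10 ≤ x ^ (1 / 3 + 1 / 2 : ℝ) :=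
    (natPow_rpow_eq_pow N 12 (j := 10) (by norm_num)).symm.le
  have key := hx₀ x hxN ((N : ℝ) ^ 10) hA1 hA2 (fun _ => 0) (fun _ => 1)
  have hQ : ⌊x ^ ((1 / 2 : ℝ) / 2)⌋₊ = N ^ 3 := by
    rw [hx, natPow_rpow_eq_pow N 12 (j := 3) (by norm_num), floor_natCast_pow]
  have hfl1 : ⌊((N : ℝ)) ^ 10⌋₊ = N ^ 10 := floor_natCast_pow N 10
  have hfl2 : ⌊2 * ((N : ℝ)) ^ 10⌋₊ = 2 * N ^ 10 := floor_two_mul_natCast_pow N 10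
  have hxA : ⌊x / (N : ℝ) ^ 10⌋₊ = N ^ 2 := by
    rw [hx, natPow_div_natPow N hN0 (by norm_num), floor_natCast_pow]
  -- for N² < q the column class b ≡ 1 (q) is the single column {1}
  have hcols1 : ∀ q : ℕ, N ^ 2 < q → cols x ((N : ℝ) ^ 10) q 1 = {1} := by
    intro q hq
    ext b
    rw [mem_cols, hxA, Finset.mem_singleton]
    constructor
    · rintro ⟨⟨hb1, hb2⟩, hbq⟩
      have hbq' : b % q = 1 % q := hbq
      rw [Nat.mod_eq_of_lt (by omega), Nat.mod_eq_of_lt (by omega)] at hbq'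
      exact hbq'
    · rintro rfl
      exact ⟨⟨le_rfl, Nat.one_le_pow _ _ (by omega)⟩, Nat.ModEq.refl 1⟩
  have hterm : ∀ q : ℕ, q ∈ Finset.Icc (N ^ 2 + 1) (N ^ 3) →
      (N : ℝ) ^ 22 / 4 ≤ (q : ℝ) ^ 3 * F 1 x ((N : ℝ) ^ 10) q 0 1 := by
    intro q hq
    obtain ⟨hq1, hq2⟩ := Finset.mem_Icc.1 hq
    have hqpos : (0 : ℝ) < q := by exact_mod_cast (by omega : 0 < q)
    have hqN2 : (N : ℝ) ^ 2 ≤ q := by exact_mod_cast (by omega : N ^ 2 ≤ q)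
    have hqN3 : (q : ℝ) ≤ (N : ℝ) ^ 3 := by exact_mod_cast hq2
    rw [F_of_cols_eq_singleton (by norm_num) (hcols1 q (by omega))]
    have hrows := (card_rows_bounds ((N : ℝ) ^ 10) (by positivity) q 0 (by omega)).1
    rw [hfl1, hfl2] at hrows
    push_cast at hrows
    have e : ((2 : ℝ) * (N : ℝ) ^ 10 - (N : ℝ) ^ 10) / q = (N : ℝ) ^ 10 / q := by ring
    rw [e] at hrows
    have hbig : (2 : ℝ) ≤ (N : ℝ) ^ 10 / q := by
      rw [le_div_iff₀ hqpos]
      calc (2 : ℝ) * q ≤ 2 * (N : ℝ) ^ 3 := by linarith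
        _ ≤ (N : ℝ) ^ 7 * (N : ℝ) ^ 3 := by
            gcongr
            calc (2 : ℝ) ≤ N := by exact_mod_cast (by omega : 2 ≤ N)
              _ ≤ (N : ℝ) ^ 7 := le_self_pow₀ hN1' (by norm_num)
        _ = (N : ℝ) ^ 10 := by ring
    have hrows' : (N : ℝ) ^ 10 / (2 * q) ≤ ((rows ((N : ℝ) ^ 10) q 0).card : ℝ) := by
      have e2 : (N : ℝ) ^ 10 / (2 * q) = ((N : ℝ) ^ 10 / q) / 2 := by field_simp
      rw [e2]; linarith
    have h0 : (0 : ℝ) ≤ (N : ℝ) ^ 10 / (2 * q) := by positivity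
    calc (N : ℝ) ^ 22 / 4 = (N : ℝ) ^ 2 * ((N : ℝ) ^ 20 / 4) := by ring
      _ ≤ (q : ℝ) * ((N : ℝ) ^ 20 / 4) := by gcongr
      _ = (q : ℝ) ^ 3 * ((N : ℝ) ^ 10 / (2 * q)) ^ 2 := by field_simp; ring
      _ ≤ (q : ℝ) ^ 3 * (((rows ((N : ℝ) ^ 10) q 0).card : ℝ)) ^ 2 := by gcongr
  have hsub : Finset.Icc (N ^ 2 + 1) (N ^ 3) ⊆ Finset.Icc 1 (N ^ 3) :=
    Finset.Icc_subset_Icc (by omega) le_rfl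
  have hcard : ((N : ℝ)) ^ 3 / 2 ≤ ((Finset.Icc (N ^ 2 + 1) (N ^ 3)).card : ℝ) := by
    rw [Nat.card_Icc]
    have h23 : N ^ 2 ≤ N ^ 3 := Nat.pow_le_pow_right (by omega) (by norm_num)
    have : ((N ^ 3 + 1 - (N ^ 2 + 1) : ℕ) : ℝ) = (N : ℝ) ^ 3 - (N : ℝ) ^ 2 := by
      rw [show N ^ 3 + 1 - (N ^ 2 + 1) = N ^ 3 - N ^ 2 by omega]; push_cast [Nat.cast_sub h23]; ring
    rw [this]
    have : (2 : ℝ) * (N : ℝ) ^ 2 ≤ (N : ℝ) ^ 3 := by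
      calc (2 : ℝ) * (N : ℝ) ^ 2 ≤ N * (N : ℝ) ^ 2 := by gcongr; exact_mod_cast (by omega : 2 ≤ N)
        _ = (N : ℝ) ^ 3 := by ring
    linarith
  have hlow : (N : ℝ) ^ 25 / 8 ≤ lhs 1 (1 / 2) x ((N : ℝ) ^ 10) (fun _ => 0) (fun _ => 1) := by
    unfold lhs
    rw [hQ]
    calc (N : ℝ) ^ 25 / 8 = ((N : ℝ) ^ 3 / 2) * ((N : ℝ) ^ 22 / 4) := by ring
      _ ≤ ((Finset.Icc (N ^ 2 + 1) (N ^ 3)).card : ℝ) * ((N : ℝ) ^ 22 / 4) := by gcongr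
      _ = ∑ q ∈ Finset.Icc (N ^ 2 + 1) (N ^ 3), (N : ℝ) ^ 22 / 4 := by
          rw [Finset.sum_const, nsmul_eq_mul]
      _ ≤ ∑ q ∈ Finset.Icc (N ^ 2 + 1) (N ^ 3), (q : ℝ) ^ 3 * F 1 x ((N : ℝ) ^ 10) q 0 1 :=
          Finset.sum_le_sum hterm
      _ ≤ ∑ q ∈ Finset.Icc 1 (N ^ 3), (q : ℝ) ^ 3 * F 1 x ((N : ℝ) ^ 10) q 0 1 :=
          Finset.sum_le_sum_of_subset_of_nonneg hsub fun q _ _ => term_nonneg 1 x _ q 0 1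
  -- right-hand side: x²/log x = N²⁴/(12 log N) < N²⁴ ≤ N²⁵/8
  have hlogN : 2 < Real.log N := by
    have h8 : (8 : ℝ) ≤ N := by exact_mod_cast hN8
    exact lt_of_lt_of_le (by
      rw [Real.lt_log_iff_exp_lt (by norm_num)]
      have he := Real.exp_one_lt_d9
      have : Real.exp 2 = Real.exp 1 * Real.exp 1 := by rw [← Real.exp_add]; norm_num
      rw [this]; nlinarith [Real.exp_pos 1]) (Real.log_le_log (by norm_num) h8)
  have hrhs : x ^ 2 / Real.log x ^ (1 : ℝ) < (N : ℝ) ^ 25 / 8 := by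
    rw [Real.rpow_one, hx, ← pow_mul, Real.log_pow]
    push_cast
    have hpos : (0 : ℝ) < (N : ℝ) ^ 24 := by positivity
    calc ((N : ℝ)) ^ (12 * 2) / (12 * Real.log N) < (N : ℝ) ^ 24 / 1 := by
          rw [show 12 * 2 = 24 by norm_num]
          exact div_lt_div_of_pos_left hpos one_pos (by linarith)
      _ = (N : ℝ) ^ 24 := div_one _
      _ ≤ (N : ℝ) ^ 25 / 8 := by
          rw [le_div_iff₀ (by norm_num)]
          calc (N : ℝ) ^ 24 * 8 ≤ (N : ℝ) ^ 24 * N := by gcongr; exact_mod_cast hN8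
            _ = (N : ℝ) ^ 25 := by ring
  linarith


/-! ## §17 (o) BEYOND THE SIBLING CRUX, THE WHOLE CONTENT IS THE BAND OF LARGE DILATIONS

Lever (P) of the idea card `positivity-quarantine` — Gram fourth moments are monotone in the row
AND the column set (columns: the cross term `tr(G_T G_D) = ‖M_Tᵀ M_D‖_F²` is a sum of squares) —
kernel-checked by triage r1-1/r1-2/r1-3 (`TRIAGE-r1-2-GramMono.lean`) and skeleton §7; the proofs
are reproduced VERBATIM here (credit: triage 2 `cross_eq`, skeleton `gram_mono`, `F_le_of_dvd`).
Consequence: `F(q,u,v) ≤ F(q',u,v)` for `q' ∣ q`, in particular every block is at most the plain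
table (`F_le_table`), so the dilations `q ≤ (log x)^B` cost at most `(log x)^{4B} · F(1)`, which
`TableChowla` at exponent `C + 4B + 1` pays.  Hence for every `B ≥ 0`:
`crux_iff_table_and_largeDilations : DilatedTableChowla ↔ TableChowla ∧ LargeDilations B`, where
`LargeDilations B` is the crux restricted to the dilations `(log x)^B < q ≤ x^{δ/2}`.  The route's
foreseen `SmallDilations` node has no content of its own, and the open content of stmt-Parity-14271
BEYOND stmt-Parity-14270 is exactly the band of dilations above every fixed power of `log x` — where
no Siegel–Walfisz-type input reaches and where the one structured-bad-class-per-`q` worry lives. -/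

/-- Row monotonicity of Gram fourth moments: dropping rows drops nonnegative terms (skeleton §7). -/
theorem gram_rows_mono (f : ℕ → ℕ → ℝ) (S S' T : Finset ℕ) (hS : S ⊆ S') :
    (∑ a ∈ S, ∑ a' ∈ S, (∑ b ∈ T, f a b * f a' b) ^ 2) ≤
      ∑ a ∈ S', ∑ a' ∈ S', (∑ b ∈ T, f a b * f a' b) ^ 2 := by
  calc (∑ a ∈ S, ∑ a' ∈ S, (∑ b ∈ T, f a b * f a' b) ^ 2)
      ≤ ∑ a ∈ S, ∑ a' ∈ S', (∑ b ∈ T, f a b * f a' b) ^ 2 := by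
        apply Finset.sum_le_sum
        intro a _
        exact Finset.sum_le_sum_of_subset_of_nonneg hS (fun _ _ _ => sq_nonneg _)
    _ ≤ ∑ a ∈ S', ∑ a' ∈ S', (∑ b ∈ T, f a b * f a' b) ^ 2 :=
        Finset.sum_le_sum_of_subset_of_nonneg hS
          (fun _ _ _ => Finset.sum_nonneg (fun _ _ => sq_nonneg _))

/-- `tr(G_T G_D) = ‖M_Tᵀ M_D‖_F²`: the cross Gram term is a sum of squares (triage r1-2 `cross_eq`). -/
theorem gram_cross_eq (f : ℕ → ℕ → ℝ) (S T D : Finset ℕ) :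
    (∑ a ∈ S, ∑ a' ∈ S, (∑ b ∈ T, f a b * f a' b) * (∑ d ∈ D, f a d * f a' d)) =
      ∑ b ∈ T, ∑ d ∈ D, (∑ a ∈ S, f a b * f a d) ^ 2 := by
  have e1 : ∀ a a', (∑ b ∈ T, f a b * f a' b) * (∑ d ∈ D, f a d * f a' d) =
      ∑ b ∈ T, ∑ d ∈ D, (f a b * f a d) * (f a' b * f a' d) := by
    intro a a'
    rw [Finset.sum_mul_sum]
    refine Finset.sum_congr rfl fun b _ => Finset.sum_congr rfl fun d _ => ?_
    ring
  have e2 : ∀ b d, (∑ a ∈ S, f a b * f a d) ^ 2 =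
      ∑ a ∈ S, ∑ a' ∈ S, (f a b * f a d) * (f a' b * f a' d) := by
    intro b d
    rw [sq, Finset.sum_mul_sum]
  simp_rw [e1, e2]
  calc ∑ a ∈ S, ∑ a' ∈ S, ∑ b ∈ T, ∑ d ∈ D, (f a b * f a d) * (f a' b * f a' d)
      = ∑ a ∈ S, ∑ b ∈ T, ∑ a' ∈ S, ∑ d ∈ D, (f a b * f a d) * (f a' b * f a' d) := by
        refine Finset.sum_congr rfl fun a _ => ?_
        exact Finset.sum_comm
    _ = ∑ b ∈ T, ∑ a ∈ S, ∑ a' ∈ S, ∑ d ∈ D, (f a b * f a d) * (f a' b * f a' d) :=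
        Finset.sum_comm
    _ = ∑ b ∈ T, ∑ a ∈ S, ∑ d ∈ D, ∑ a' ∈ S, (f a b * f a d) * (f a' b * f a' d) := by
        refine Finset.sum_congr rfl fun b _ => Finset.sum_congr rfl fun a _ => ?_
        exact Finset.sum_comm
    _ = ∑ b ∈ T, ∑ d ∈ D, ∑ a ∈ S, ∑ a' ∈ S, (f a b * f a d) * (f a' b * f a' d) := by
        refine Finset.sum_congr rfl fun b _ => ?_
        exact Finset.sum_comm

/-- Column monotonicity of Gram fourth moments at a fixed row set (the PSD half of (P); skeleton §7). -/
theorem gram_cols_mono (f : ℕ → ℕ → ℝ) (S T T' : Finset ℕ) (hT : T ⊆ T') :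
    (∑ a ∈ S, ∑ a' ∈ S, (∑ b ∈ T, f a b * f a' b) ^ 2) ≤
      ∑ a ∈ S, ∑ a' ∈ S, (∑ b ∈ T', f a b * f a' b) ^ 2 := by
  have hU : T' = T ∪ (T' \ T) := (Finset.union_sdiff_of_subset hT).symm
  rw [hU]
  simp_rw [Finset.sum_union Finset.disjoint_sdiff]
  have hexp : ∀ a a', ((∑ b ∈ T, f a b * f a' b) + ∑ d ∈ T' \ T, f a d * f a' d) ^ 2 =
      (∑ b ∈ T, f a b * f a' b) ^ 2 +
        2 * ((∑ b ∈ T, f a b * f a' b) * (∑ d ∈ T' \ T, f a d * f a' d)) +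
        (∑ d ∈ T' \ T, f a d * f a' d) ^ 2 := fun a a' => by ring
  simp_rw [hexp, Finset.sum_add_distrib, ← Finset.mul_sum]
  have h1 : 0 ≤ ∑ a ∈ S, ∑ a' ∈ S, (∑ b ∈ T, f a b * f a' b) * (∑ d ∈ T' \ T, f a d * f a' d) := by
    rw [gram_cross_eq]
    exact Finset.sum_nonneg (fun _ _ => Finset.sum_nonneg (fun _ _ => sq_nonneg _))
  have h2 : 0 ≤ ∑ a ∈ S, ∑ a' ∈ S, (∑ d ∈ T' \ T, f a d * f a' d) ^ 2 :=
    Finset.sum_nonneg (fun _ _ => Finset.sum_nonneg (fun _ _ => sq_nonneg _))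
  linarith

/-- LEVER (P) of the idea card (`GramFourthMomentMonotone`): Gram fourth moments are monotone in
rows and columns (skeleton §7 `gram_mono`). -/
theorem gram_mono (f : ℕ → ℕ → ℝ) (S S' T T' : Finset ℕ) (hS : S ⊆ S') (hT : T ⊆ T') :
    (∑ a ∈ S, ∑ a' ∈ S, (∑ b ∈ T, f a b * f a' b) ^ 2) ≤
      ∑ a ∈ S', ∑ a' ∈ S', (∑ b ∈ T', f a b * f a' b) ^ 2 :=
  le_trans (gram_rows_mono f S S' T hS) (gram_cols_mono f S' T T' hT)

/-- Rows at dilation `q` are rows at every divisor `q' ∣ q` (same representative). -/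
theorem rows_subset_of_dvd (A : ℝ) {q q' : ℕ} (h : q' ∣ q) (u : ℕ) : rows A q u ⊆ rows A q' u := by
  intro a ha
  simp only [rows, Finset.mem_filter] at ha ⊢
  exact ⟨ha.1, Nat.ModEq.of_dvd h ha.2⟩

/-- Columns at dilation `q` are columns at every divisor `q' ∣ q` (same representative). -/
theorem cols_subset_of_dvd (x A : ℝ) {q q' : ℕ} (h : q' ∣ q) (v : ℕ) :
    cols x A q v ⊆ cols x A q' v := by
  intro b hb
  simp only [cols, Finset.mem_filter] at hb ⊢
  exact ⟨hb.1, Nat.ModEq.of_dvd h hb.2⟩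

/-- POSITIVITY ALONG DIVISORS (skeleton §7 `F_le_of_dvd`): `F(q,u,v) ≤ F(q',u,v)` for `q' ∣ q`. -/
theorem F_le_of_dvd (c : ℤ) (x A : ℝ) {q q' : ℕ} (h : q' ∣ q) (u v : ℕ) :
    F c x A q u v ≤ F c x A q' u v := by
  unfold F S
  exact gram_mono (fun a b => L ((a : ℤ) * b + c)) _ _ _ _ (rows_subset_of_dvd A h u)
    (cols_subset_of_dvd x A h v)

/-- Every block is at most the plain table: `F(q,u,v) ≤ F(1,0,0)`, uniformly in the classes. -/
theorem F_le_table (c : ℤ) (x A : ℝ) (q u v : ℕ) : F c x A q u v ≤ F c x A 1 0 0 := by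
  have h := F_le_of_dvd c x A (one_dvd q) u v
  rw [F_one_eq_table] at h
  rw [F_one_eq_table]
  exact h

/-- The crux restricted to the LARGE dilations `(log x)^B < q ≤ x^{δ/2}`. -/
def LargeDilations (B : ℝ) : Prop :=
  ∀ c : ℤ, c ≠ 0 → ∀ δ : ℝ, 0 < δ → δ ≤ 1 / 12 → ∀ C : ℝ, 0 < C → ∃ x₀ : ℝ, ∀ x : ℝ, x₀ ≤ x →
    ∀ A : ℝ, x ^ δ ≤ A → A ≤ x ^ (1 / 3 + δ) → ∀ u v : ℕ → ℕ,
      (∑ q ∈ (Finset.Icc 1 ⌊x ^ (δ / 2)⌋₊).filter (fun q : ℕ => Real.log x ^ B < (q : ℝ)),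
        (q : ℝ) ^ 3 * F c x A q (u q) (v q)) ≤ x ^ 2 / Real.log x ^ C

/-- (o) The crux implies its large-dilation part (drop nonnegative terms). -/
theorem crux_imp_largeDilations (h : DilatedTableChowla) (B : ℝ) : LargeDilations B := by
  rw [crux_iff_lhs] at h
  intro c hc δ hδ hδ' C hC
  obtain ⟨x₀, hx₀⟩ := h c hc δ hδ hδ' C hC
  refine ⟨x₀, fun x hx A hA1 hA2 u v => le_trans ?_ (hx₀ x hx A hA1 hA2 u v)⟩
  unfold lhs
  exact Finset.sum_le_sum_of_subset_of_nonneg (Finset.filter_subset _ _)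
    fun q _ _ => term_nonneg c x A q (u q) (v q)

/-- (o) `TableChowla` and the large-dilation part imply the crux: the dilations `q ≤ (log x)^B`
cost `≤ (log x)^{4B} · F(1,0,0)` by positivity (`F_le_table`), paid by `TableChowla` at exponent
`C + 4B + 1`. -/
theorem crux_of_table_and_largeDilations {B : ℝ} (hB : 0 ≤ B) (hT : TableChowla)
    (hL : LargeDilations B) : DilatedTableChowla := by
  rw [crux_iff_lhs]
  intro c hc δ hδ hδ' C hC
  obtain ⟨x₁, hx₁⟩ := hT c hc δ hδ hδ' (C + 4 * B + 1) (by linarith)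
  obtain ⟨x₂, hx₂⟩ := hL c hc δ hδ hδ' (C + 1) (by linarith)
  refine ⟨max (max x₁ x₂) 8, fun x hx A hA1 hA2 u v => ?_⟩
  have hx1 : x₁ ≤ x := le_trans (le_trans (le_max_left _ _) (le_max_left _ _)) hx
  have hx2 : x₂ ≤ x := le_trans (le_trans (le_max_right _ _) (le_max_left _ _)) hx
  have hx8 : (8 : ℝ) ≤ x := le_trans (le_max_right _ _) hx
  have hlog2 : 2 ≤ Real.log x := two_le_log_of_ge_eight hx8
  have hlogpos : 0 < Real.log x := by linarith
  have hLB : 0 ≤ Real.log x ^ B := (Real.rpow_pos_of_pos hlogpos B).le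
  -- the plain table, from `TableChowla` at exponent `C + 4B + 1`
  have htable : F c x A 1 0 0 ≤ x ^ 2 / Real.log x ^ (C + 4 * B + 1) := by
    rw [F_one_eq_table]; exact hx₁ x hx1 A hA1 hA2
  have hF1 : 0 ≤ F c x A 1 0 0 := F_nonneg c x A 1 0 0
  -- split the dilations at `(log x)^B`
  set Q : ℕ := ⌊x ^ (δ / 2)⌋₊ with hQ
  have hsplit := Finset.sum_filter_add_sum_filter_not (Finset.Icc 1 Q)
    (fun q : ℕ => Real.log x ^ B < (q : ℝ)) (fun q => (q : ℝ) ^ 3 * F c x A q (u q) (v q))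
  have hlarge : ∑ q ∈ (Finset.Icc 1 Q).filter (fun q : ℕ => Real.log x ^ B < (q : ℝ)),
      (q : ℝ) ^ 3 * F c x A q (u q) (v q) ≤ x ^ 2 / Real.log x ^ (C + 1) := hx₂ x hx2 A hA1 hA2 u v
  -- small dilations: at most `⌊(log x)^B⌋` of them, each `≤ (log x)^{3B} F(1,0,0)`
  have hcard : ((((Finset.Icc 1 Q).filter (fun q : ℕ => ¬ Real.log x ^ B < (q : ℝ))).card : ℕ) : ℝ)
      ≤ Real.log x ^ B := by
    have hsub : (Finset.Icc 1 Q).filter (fun q : ℕ => ¬ Real.log x ^ B < (q : ℝ)) ⊆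
        Finset.Icc 1 ⌊Real.log x ^ B⌋₊ := by
      intro q hq
      obtain ⟨hqI, hqP⟩ := Finset.mem_filter.1 hq
      obtain ⟨hq1, -⟩ := Finset.mem_Icc.1 hqI
      exact Finset.mem_Icc.2 ⟨hq1, Nat.le_floor (not_lt.1 hqP)⟩
    have h1 := Finset.card_le_card hsub
    rw [Nat.card_Icc, Nat.add_sub_cancel] at h1
    calc ((((Finset.Icc 1 Q).filter (fun q : ℕ => ¬ Real.log x ^ B < (q : ℝ))).card : ℕ) : ℝ)
        ≤ (⌊Real.log x ^ B⌋₊ : ℝ) := by exact_mod_cast h1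
      _ ≤ Real.log x ^ B := Nat.floor_le hLB
  have h3B : (Real.log x ^ B) ^ 3 = Real.log x ^ (3 * B) := by
    rw [← Real.rpow_natCast, ← Real.rpow_mul hlogpos.le]; norm_num; ring_nf
  have hsmall : ∑ q ∈ (Finset.Icc 1 Q).filter (fun q : ℕ => ¬ Real.log x ^ B < (q : ℝ)),
      (q : ℝ) ^ 3 * F c x A q (u q) (v q) ≤ Real.log x ^ (4 * B) * F c x A 1 0 0 := by
    calc ∑ q ∈ (Finset.Icc 1 Q).filter (fun q : ℕ => ¬ Real.log x ^ B < (q : ℝ)),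
          (q : ℝ) ^ 3 * F c x A q (u q) (v q)
        ≤ ∑ q ∈ (Finset.Icc 1 Q).filter (fun q : ℕ => ¬ Real.log x ^ B < (q : ℝ)),
          Real.log x ^ (3 * B) * F c x A 1 0 0 := by
          refine Finset.sum_le_sum fun q hq => ?_
          obtain ⟨-, hqP⟩ := Finset.mem_filter.1 hq
          have hqle : (q : ℝ) ≤ Real.log x ^ B := not_lt.1 hqP
          have hq3 : (q : ℝ) ^ 3 ≤ Real.log x ^ (3 * B) := by
            rw [← h3B]; exact pow_le_pow_left₀ (Nat.cast_nonneg q) hqle 3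
          exact mul_le_mul hq3 (F_le_table c x A q (u q) (v q)) (F_nonneg c x A q (u q) (v q))
            (Real.rpow_pos_of_pos hlogpos _).le
      _ = ((((Finset.Icc 1 Q).filter (fun q : ℕ => ¬ Real.log x ^ B < (q : ℝ))).card : ℕ) : ℝ) *
            (Real.log x ^ (3 * B) * F c x A 1 0 0) := by
          rw [Finset.sum_const, nsmul_eq_mul]
      _ ≤ Real.log x ^ B * (Real.log x ^ (3 * B) * F c x A 1 0 0) := by
          have h0 : 0 ≤ Real.log x ^ (3 * B) * F c x A 1 0 0 :=
            mul_nonneg (Real.rpow_pos_of_pos hlogpos _).le hF1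
          exact mul_le_mul_of_nonneg_right hcard h0
      _ = Real.log x ^ (4 * B) * F c x A 1 0 0 := by
          rw [← mul_assoc, ← Real.rpow_add hlogpos]; ring_nf
  -- numerics
  have hpow1 : Real.log x ^ (C + 4 * B + 1) = Real.log x ^ (4 * B) * Real.log x ^ (C + 1) := by
    rw [← Real.rpow_add hlogpos]; ring_nf
  have hpow2 : Real.log x ^ (C + 1) = Real.log x ^ C * Real.log x := by
    rw [Real.rpow_add hlogpos, Real.rpow_one]
  have hLC : 0 < Real.log x ^ C := Real.rpow_pos_of_pos hlogpos C
  have h4B : 0 < Real.log x ^ (4 * B) := Real.rpow_pos_of_pos hlogpos _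
  have hsmall' : Real.log x ^ (4 * B) * F c x A 1 0 0 ≤ x ^ 2 / Real.log x ^ (C + 1) := by
    calc Real.log x ^ (4 * B) * F c x A 1 0 0
        ≤ Real.log x ^ (4 * B) * (x ^ 2 / Real.log x ^ (C + 4 * B + 1)) := by gcongr
      _ = x ^ 2 / Real.log x ^ (C + 1) := by
          rw [hpow1]; field_simp
  have hhalf : x ^ 2 / Real.log x ^ (C + 1) ≤ x ^ 2 / Real.log x ^ C / 2 := by
    rw [hpow2, div_div, div_le_div_iff₀ (by positivity) (by positivity)]
    have : x ^ 2 * (Real.log x ^ C * 2) ≤ x ^ 2 * (Real.log x ^ C * Real.log x) := by gcongr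
    linarith
  unfold lhs
  rw [← hQ, ← hsplit]
  linarith [hlarge, hsmall, hsmall', hhalf]

/-- (o) **`DilatedTableChowla ↔ TableChowla ∧ LargeDilations B`** for every `B ≥ 0`: beyond the
sibling crux stmt-Parity-14270, the whole content of stmt-Parity-14271 is the band of dilations
`(log x)^B < q ≤ x^{δ/2}` above every fixed power of `log x`. -/
theorem crux_iff_table_and_largeDilations {B : ℝ} (hB : 0 ≤ B) :
    DilatedTableChowla ↔ TableChowla ∧ LargeDilations B :=
  ⟨fun h => ⟨crux_imp_tableChowla h, crux_imp_largeDilations h B⟩,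
    fun h => crux_of_table_and_largeDilations hB h.1 h.2⟩


/-! ## §16 (n) TARGETS — the registered skeleton `Lines/positivity-quarantine.lean` (sha 493e31f6…) and its four stubs

(cycle 3, gen-3 seat.)  The lead's line composes four stubs into the crux, sorry-free:
`SmallConductorsZeroFree → FewBadConductors → OnePointTransfer → GenericAffineTable → crux`
(Z1, Z2, ★, C⁺).  This section copies the skeleton's §1–§2 definitions VERBATIM (namespace `PQ`;
`Cruxes/…` files are not importable) and records what the disprover can say about each stub.

**Verdicts.**
* (C⁺) `GenericAffineTable` — NOT separately refutable: `crux_imp_genericAffineTable :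
  DilatedTableChowla → GenericAffineTable` (T4a, via Markov §11 at exponent `2C`, threshold
  `K = (log x)^C`; the one-point hypothesis is not even used: `crux_imp_pointwiseOffSparse`).
  So any kill of (C⁺) kills the crux; conversely (C⁺) is at least as hard as the SIBLING crux:
  `genericAffineTable_imp_tableChowla : GenericAffineTable → TableChowla` UNCONDITIONALLY (T4b),
  because `q = 1` is never exceptional (`Σ_{E'} 1/q ≤ (log x)^{-C} < 1`) and its one-point
  hypothesis `OnePointData 1 x B κ` is a THEOREM (`onePointData_one`, T4c: Siegel–Walfisz for `λ` in
  progressions, tree `SiegelWalfiszMoebius_holds.liouville_progression`, expanded over residue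
  classes; axioms standard).  Net: `DilatedTableChowla → GenericAffineTable → TableChowla`, and with
  the skeleton's composition `(Z1) ∧ (Z2) ∧ (★) ⊢ GenericAffineTable ↔ DilatedTableChowla`: the line
  RELOCATES the two-point content exactly (no loss, no gain), its value being the one-point
  hypothesis handed to the (C⁺) prover.  The hypothesis `OnePointData` is NOT load-bearing for the
  TRUTH of (C⁺) (the crux gives (C⁺) without it) — it is a proof aid only.
* (Z1) `SmallConductorsZeroFree`, (Z2) `FewBadConductors` — true in print (classical region +
  Siegel; Bombieri's log-free density), no formal loophole found: `K' ≤ 0` makes the box lie in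
  `re s > 1` where Mathlib's non-vanishing applies (`boxZeroFree_of_nonpos`,
  `smallConductorsZeroFree_nonpos_slice`); `θ ≤ 0` leaves only `d = 1` (`fewBadConductors_theta_nonpos_slice`);
  `n = 0` is vacuous on both sides (`∀ [NeZero 0]`); `S ∌ 0` automatically; `d = 1` is `ζ`
  (`LFunction_modOne_eq`), excluded near `s = 1` by `s ≠ 1` and the classical region.
* (★) `OnePointTransfer` — true in print; CONSTANT BOOKKEEPING for the lead (checked twice, the
  first version of this note was wrong): with `η = K' log log x/log x`, moduli `n ≤ x^{1/24+o(1)}`,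
  `T = (log x)^{K''}`, `y ≥ x^{1/2}`: the Borel–Carathéodory route named in the stub's docstring
  CLOSES provided the disc is centred at `1 + εη + it` as written there (radius `R → (1+ε)η`,
  evaluation radius `r = 2εη` reaching `σ = 1 − εη`; `A(R) = max log|L| ≤ η log(nT) + O(log log x)`,
  `|log L(1+εη+it)| ≤ log(1/(εη)) + O(1)`): `|1/L(1−εη+it)| ≤ (log x)^{εK'/(6(1−ε)) + O_ε(1)}`
  against the contour gain `y^{-εη} ≤ (log x)^{-εK'/2}` — net saving
  `(log x)^{-εK'(1/2 − 1/(6(1−ε))) + O(1)}`, positive for `ε < 2/3`, e.g. `ε = 1/2`: `(log x)^{-K'/12}`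
  (so `K' ≈ 12(B+4)`, `K'' ≥ B+3` for the Perron error `y log² y/T`).  Centring the disc at `1 + η`
  instead only TIES (loss `(1+ε)K'/(12(1−ε))` = gain `K'/4` at `ε = 1/2`) — avoid.  Alternative with
  a slightly better constant and only the LOCAL box `|γ − t| ≤ 1`: the Montgomery–Vaughan Thm 6.7 /
  11.4 DIFFERENCING argument run with the wide box as hypothesis — at `s₁ = 1 + η + it`,
  `Σ_ρ Re 1/(s₁−ρ) = Re L'/L(s₁) + ½ log(n(|t|+2)) + O(1) ≤ (½ + o(1)) log(nT)`, hence
  `Σ_{|γ|≤T} 1/|s₁−ρ|² ≤ log(nT)/(4η)`, and for `1 − η/2 ≤ σ ≤ 1 + η`: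
  `|L'/L(s) − L'/L(s₁)| ≤ 6η Σ 1/|s₁−ρ|² ≤ (3/2) log(nT)`; integrating over the segment:
  `|1/L(1−η/2+it)| ≤ (log x)^{3K'/32 + 1 + o(1)}` against `y^{-η/2} ≤ (log x)^{-K'/4}`: net
  `(log x)^{-5K'/32 + O(1)}`.  Tree anchors: `DirichletZFR.exists_inv_LFunction_bounds` (MV Thm 11.4 —
  same proof, narrow region), `ClassicalZFRInvBound`, `DirichletLFunctionInverseBound`.  A prover
  choosing `K' ≤ 0` in (★) gets `BoxGeneric` for free at EVERY `q` (`boxGeneric_of_nonpos`) and is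
  then asking for unconditional `(log x)^B` cancellation of `λχ` at power-of-`x` conductors —
  Landau–Siegel territory; so `K' > 0`.
* No stub is an instance of a landed refutation (`ledger negatives --problem Parity` =
  {14832, 9541, 4218}) or of §4/§6/§7/§8/§15 here.

**Targets broken: 0/4.  Near-misses: none.**  (payload.targets/stuck_stubs were empty at arm time;
the registered stubs were attacked proactively.) -/

namespace PQ

/-- Verbatim copy of the skeleton's `boxEdge`. -/
noncomputable def boxEdge (x K' : ℝ) : ℝ := 1 - K' * Real.log (Real.log x) / Real.log x

/-- Verbatim copy of the skeleton's `BoxZeroFree`. -/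
def BoxZeroFree (n : ℕ) (x K' H : ℝ) : Prop :=
  ∀ [NeZero n], ∀ χ : DirichletCharacter ℂ n, ∀ s : ℂ,
    boxEdge x K' < s.re → |s.im| ≤ H → s ≠ 1 → DirichletCharacter.LFunction χ s ≠ 0

/-- Verbatim copy of the skeleton's `BoxGeneric`. -/
def BoxGeneric (q : ℕ) (x K' K'' κ : ℝ) : Prop :=
  ∀ n : ℕ, q ∣ n → (n : ℝ) ≤ q * Real.log x ^ κ → BoxZeroFree n x K' (Real.log x ^ K'')

/-- Verbatim copy of the skeleton's `OnePointData`. -/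
def OnePointData (q : ℕ) (x B κ : ℝ) : Prop :=
  ∀ n : ℕ, q ∣ n → (n : ℝ) ≤ q * Real.log x ^ κ → ∀ [NeZero n], ∀ χ : DirichletCharacter ℂ n,
    ∀ y : ℝ, x ^ (1 / 2 : ℝ) ≤ y → y ≤ x ^ 2 →
      ‖∑ k ∈ Finset.Icc 1 ⌊y⌋₊, (ArithmeticFunction.liouville k : ℂ) * χ (k : ZMod n)‖ ≤
        y / Real.log x ^ B

/-- Verbatim copy of the skeleton's (Z1). -/
def SmallConductorsZeroFree : Prop :=
  ∀ K K' K'' : ℝ, ∃ x₀ : ℝ, ∀ x : ℝ, x₀ ≤ x →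
    ∀ d : ℕ, 1 ≤ d → (d : ℝ) ≤ Real.log x ^ K → BoxZeroFree d x K' (Real.log x ^ K'')

/-- Verbatim copy of the skeleton's (Z2). -/
def FewBadConductors : Prop :=
  ∀ θ K' K'' : ℝ, ∃ E₀ x₀ : ℝ, ∀ x : ℝ, x₀ ≤ x →
    ∃ S : Finset ℕ, (S.card : ℝ) ≤ Real.log x ^ E₀ ∧
      (∀ s ∈ S, ¬ BoxZeroFree s x K' (Real.log x ^ K'')) ∧
      ∀ d : ℕ, 1 ≤ d → (d : ℝ) ≤ x ^ θ → ¬ BoxZeroFree d x K' (Real.log x ^ K'') → ∃ s ∈ S, s ∣ d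

/-- Verbatim copy of the skeleton's (★). -/
def OnePointTransfer : Prop :=
  ∀ B κ : ℝ, 0 < κ → ∃ K' K'' x₀ : ℝ, ∀ x : ℝ, x₀ ≤ x →
    ∀ q : ℕ, 1 ≤ q → (q : ℝ) ≤ x ^ (1 / 24 : ℝ) → BoxGeneric q x K' K'' κ → OnePointData q x B κ

/-- Verbatim copy of the skeleton's (C⁺) (HARDEST stub). -/
def GenericAffineTable : Prop :=
  ∀ c : ℤ, c ≠ 0 → ∀ δ : ℝ, 0 < δ → δ ≤ 1 / 12 → ∀ C : ℝ, 0 < C → ∃ B κ : ℝ, 0 < κ ∧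
    ∃ x₀ : ℝ, ∀ x : ℝ, x₀ ≤ x → ∀ A : ℝ, x ^ δ ≤ A → A ≤ x ^ (1 / 3 + δ) → ∀ u v : ℕ → ℕ,
      ∃ E' : Finset ℕ, (∑ q ∈ E', ((q : ℝ))⁻¹) ≤ (Real.log x ^ C)⁻¹ ∧
        ∀ q : ℕ, 1 ≤ q → q ≤ ⌊x ^ (δ / 2)⌋₊ → q ∉ E' → OnePointData q x B κ →
          (q : ℝ) ^ 4 *
            (∑ a ∈ (Finset.Ioc ⌊A⌋₊ ⌊2 * A⌋₊).filter (fun a : ℕ => a ≡ u q [MOD q]),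
              ∑ a' ∈ (Finset.Ioc ⌊A⌋₊ ⌊2 * A⌋₊).filter (fun a' : ℕ => a' ≡ u q [MOD q]),
                (∑ b ∈ (Finset.Icc 1 ⌊x / A⌋₊).filter (fun b : ℕ => b ≡ v q [MOD q]),
                  (ArithmeticFunction.liouville (Int.toNat ((a : ℤ) * b + c)) : ℝ) *
                    (ArithmeticFunction.liouville (Int.toNat ((a' : ℤ) * b + c)) : ℝ)) ^ 2)
            ≤ x ^ 2 / Real.log x ^ C

/-- The block expression of `GenericAffineTable` is §0's `F` (definitional, as in the skeleton). -/
theorem genericAffineTable_iff : GenericAffineTable ↔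
    ∀ c : ℤ, c ≠ 0 → ∀ δ : ℝ, 0 < δ → δ ≤ 1 / 12 → ∀ C : ℝ, 0 < C → ∃ B κ : ℝ, 0 < κ ∧
      ∃ x₀ : ℝ, ∀ x : ℝ, x₀ ≤ x → ∀ A : ℝ, x ^ δ ≤ A → A ≤ x ^ (1 / 3 + δ) → ∀ u v : ℕ → ℕ,
        ∃ E' : Finset ℕ, (∑ q ∈ E', ((q : ℝ))⁻¹) ≤ (Real.log x ^ C)⁻¹ ∧
          ∀ q : ℕ, 1 ≤ q → q ≤ ⌊x ^ (δ / 2)⌋₊ → q ∉ E' → OnePointData q x B κ →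
            (q : ℝ) ^ 4 * F c x A q (u q) (v q) ≤ x ^ 2 / Real.log x ^ C :=
  Iff.rfl

/-- Dropping a hypothesis only weakens: `PointwiseOffSparse → GenericAffineTable` (any `B`, `κ = 1`). -/
theorem genericAffineTable_of_pointwiseOffSparse (h : PointwiseOffSparse) : GenericAffineTable := by
  intro c hc δ hδ hδ' C hC
  obtain ⟨x₀, hx₀⟩ := h c hc δ hδ hδ' C hC
  refine ⟨0, 1, one_pos, x₀, fun x hx A hA1 hA2 u v => ?_⟩
  obtain ⟨E', hE', hpt⟩ := hx₀ x hx A hA1 hA2 u v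
  exact ⟨E', hE', fun q hq1 hq2 hqE _ => hpt q hq1 hq2 hqE⟩

/-- **T4a (corollary). `DilatedTableChowla → GenericAffineTable`**: the hardest stub (C⁺) is
IMPLIED by the crux outright, one-point hypothesis or not. -/
theorem crux_imp_genericAffineTable (h : DilatedTableChowla) : GenericAffineTable :=
  genericAffineTable_of_pointwiseOffSparse (crux_imp_pointwiseOffSparse h)

/-- **T4c. The one-point data at `q = 1` is a THEOREM of the tree** (Siegel–Walfisz for `λ` in
progressions, `SiegelWalfiszMoebius_holds.liouville_progression`, expanded over residue classes):
for all `B`, `κ > 0` and all large `x`, `OnePointData 1 x B κ`. -/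
theorem onePointData_one (B κ : ℝ) (hκ : 0 < κ) :
    ∃ x₀ : ℝ, ∀ x : ℝ, x₀ ≤ x → OnePointData 1 x B κ := by
  set B₁ : ℝ := max B 0 + κ + 1 with hB₁
  have hB₁0 : 0 ≤ B₁ := by rw [hB₁]; positivity
  obtain ⟨C₀, hC₀⟩ :=
    Literature.NumberTheory.LFunctions.SiegelWalfiszMoebius_holds.liouville_progression
      (A := κ + 1) (by positivity) B₁
  set C₁ : ℝ := max C₀ 0 with hC₁
  have hC₁0 : 0 ≤ C₁ := le_max_right _ _
  set M : ℝ := max ((2 : ℝ) ^ (κ + 1)) (C₁ * (2 : ℝ) ^ B₁) with hM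
  refine ⟨max (Real.exp (max M 2)) 16, fun x hx => ?_⟩
  have hx16 : (16 : ℝ) ≤ x := le_trans (le_max_right _ _) hx
  have hxpos : 0 < x := by linarith
  have hxexp : Real.exp (max M 2) ≤ x := le_trans (le_max_left _ _) hx
  have hlogM : max M 2 ≤ Real.log x := by
    rw [Real.le_log_iff_exp_le hxpos]; exact hxexp
  have hlog2 : 2 ≤ Real.log x := le_trans (le_max_right _ _) hlogM
  have hlogpos : 0 < Real.log x := by linarith
  have hM1 : (2 : ℝ) ^ (κ + 1) ≤ Real.log x := le_trans (le_trans (le_max_left _ _) (le_max_left _ _)) hlogM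
  have hM2 : C₁ * (2 : ℝ) ^ B₁ ≤ Real.log x := le_trans (le_trans (le_max_right _ _) (le_max_left _ _)) hlogM
  intro n _ hn _ χ y hy1 _
  rw [Nat.cast_one, one_mul] at hn
  -- y ≥ √x ≥ 4
  have hsqrt : (4 : ℝ) ≤ x ^ (1 / 2 : ℝ) := by
    have h16 : (16 : ℝ) ^ (1 / 2 : ℝ) ≤ x ^ (1 / 2 : ℝ) :=
      Real.rpow_le_rpow (by norm_num) hx16 (by norm_num)
    have : (16 : ℝ) ^ (1 / 2 : ℝ) = 4 := by
      rw [show (16 : ℝ) = 4 ^ (2 : ℝ) by norm_num, ← Real.rpow_mul (by norm_num)]; norm_num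
    linarith [this]
  have hy4 : (4 : ℝ) ≤ y := hsqrt.trans hy1
  have hy2 : (2 : ℝ) ≤ y := by linarith
  have hypos : 0 < y := by linarith
  -- log y ≥ (log x)/2
  have hlogy : Real.log x / 2 ≤ Real.log y := by
    have := Real.log_le_log (Real.rpow_pos_of_pos hxpos _) hy1
    rwa [Real.log_rpow hxpos, show (1 / 2 : ℝ) * Real.log x = Real.log x / 2 by ring] at this
  have hlogy1 : 1 ≤ Real.log y := by linarith
  have hlogypos : 0 < Real.log y := by linarith
  -- the modulus is in the Siegel–Walfisz range at height y: n ≤ (log y)^(κ+1)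
  have hnA : (n : ℝ) ≤ Real.log y ^ (κ + 1) := by
    calc (n : ℝ) ≤ Real.log x ^ κ := hn
      _ ≤ Real.log x ^ κ * (Real.log x / (2 : ℝ) ^ (κ + 1)) := by
          have : 1 ≤ Real.log x / (2 : ℝ) ^ (κ + 1) := by
            rw [le_div_iff₀ (by positivity)]; linarith
          have h0 : 0 ≤ Real.log x ^ κ := (Real.rpow_pos_of_pos hlogpos κ).le
          nlinarith
      _ = (Real.log x / 2) ^ (κ + 1) := by
          rw [Real.div_rpow hlogpos.le (by norm_num), Real.rpow_add hlogpos, Real.rpow_one]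
          ring
      _ ≤ Real.log y ^ (κ + 1) := Real.rpow_le_rpow (by positivity) hlogy (by positivity)
  have hn1 : 1 ≤ n := Nat.pos_of_ne_zero (NeZero.ne n)
  -- split over residue classes
  have hfib := (Finset.sum_fiberwise (Finset.Icc 1 ⌊y⌋₊) (fun k : ℕ => (k : ZMod n))
    (fun k : ℕ => (ArithmeticFunction.liouville k : ℂ) * χ (k : ZMod n))).symm
  rw [hfib]
  have hclass : ∀ a : ZMod n,
      ‖∑ k ∈ (Finset.Icc 1 ⌊y⌋₊).filter (fun k : ℕ => (k : ZMod n) = a),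
          (ArithmeticFunction.liouville k : ℂ) * χ (k : ZMod n)‖ ≤ C₁ * y / Real.log y ^ B₁ := by
    intro a
    have hrw : ∑ k ∈ (Finset.Icc 1 ⌊y⌋₊).filter (fun k : ℕ => (k : ZMod n) = a),
        (ArithmeticFunction.liouville k : ℂ) * χ (k : ZMod n)
        = χ a * (((∑ k ∈ (Finset.Icc 1 ⌊y⌋₊).filter (fun k : ℕ => (k : ZMod n) = a),
            (ArithmeticFunction.liouville k : ℝ)) : ℝ) : ℂ) := by
      push_cast
      rw [Finset.mul_sum]
      refine Finset.sum_congr rfl fun k hk => ?_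
      rw [(Finset.mem_filter.1 hk).2]; ring
    rw [hrw, norm_mul, Complex.norm_real, Real.norm_eq_abs]
    have hχ : ‖χ a‖ ≤ 1 := DirichletCharacter.norm_le_one χ a
    have hT := hC₀ y hy2 n hn1 hnA a
    have hT' : |∑ k ∈ (Finset.Icc 1 ⌊y⌋₊).filter (fun k : ℕ => (k : ZMod n) = a),
        (ArithmeticFunction.liouville k : ℝ)| ≤ C₁ * y / Real.log y ^ B₁ := by
      refine hT.trans ?_
      have hp : 0 < Real.log y ^ B₁ := Real.rpow_pos_of_pos hlogypos _
      rw [div_le_div_iff_of_pos_right hp]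
      exact mul_le_mul_of_nonneg_right (le_max_left _ _) hypos.le
    have h0 : 0 ≤ C₁ * y / Real.log y ^ B₁ := by positivity
    calc ‖χ a‖ * |∑ k ∈ (Finset.Icc 1 ⌊y⌋₊).filter (fun k : ℕ => (k : ZMod n) = a),
          (ArithmeticFunction.liouville k : ℝ)|
        ≤ 1 * (C₁ * y / Real.log y ^ B₁) := by
          gcongr
      _ = C₁ * y / Real.log y ^ B₁ := one_mul _
  -- sum the classes: n of them
  have hsum : ‖∑ a : ZMod n, ∑ k ∈ (Finset.Icc 1 ⌊y⌋₊).filter (fun k : ℕ => (k : ZMod n) = a),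
        (ArithmeticFunction.liouville k : ℂ) * χ (k : ZMod n)‖ ≤ n * (C₁ * y / Real.log y ^ B₁) := by
    refine (norm_sum_le _ _).trans ?_
    calc ∑ a : ZMod n, ‖∑ k ∈ (Finset.Icc 1 ⌊y⌋₊).filter (fun k : ℕ => (k : ZMod n) = a),
            (ArithmeticFunction.liouville k : ℂ) * χ (k : ZMod n)‖
        ≤ ∑ _a : ZMod n, C₁ * y / Real.log y ^ B₁ := Finset.sum_le_sum fun a _ => hclass a
      _ = n * (C₁ * y / Real.log y ^ B₁) := by
          rw [Finset.sum_const, Finset.card_univ, ZMod.card, nsmul_eq_mul]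
  refine hsum.trans ?_
  -- numerics: n · C₁ y/(log y)^B₁ ≤ (log x)^κ · C₁ y · 2^B₁/(log x)^B₁ ≤ y/(log x)^(max B 0) ≤ y/(log x)^B
  have hly : (Real.log x / 2) ^ B₁ ≤ Real.log y ^ B₁ :=
    Real.rpow_le_rpow (by positivity) hlogy hB₁0
  have hlx2 : 0 < (Real.log x / 2) ^ B₁ := Real.rpow_pos_of_pos (by positivity) _
  have step1 : (n : ℝ) * (C₁ * y / Real.log y ^ B₁) ≤
      Real.log x ^ κ * (C₁ * y / (Real.log x / 2) ^ B₁) := by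
    have h1 : C₁ * y / Real.log y ^ B₁ ≤ C₁ * y / (Real.log x / 2) ^ B₁ :=
      div_le_div_of_nonneg_left (by positivity) hlx2 hly
    have h2 : 0 ≤ C₁ * y / Real.log y ^ B₁ := by positivity
    calc (n : ℝ) * (C₁ * y / Real.log y ^ B₁) ≤ Real.log x ^ κ * (C₁ * y / Real.log y ^ B₁) :=
          mul_le_mul_of_nonneg_right hn h2
      _ ≤ Real.log x ^ κ * (C₁ * y / (Real.log x / 2) ^ B₁) :=
          mul_le_mul_of_nonneg_left h1 (Real.rpow_pos_of_pos hlogpos κ).le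
  have step2 : Real.log x ^ κ * (C₁ * y / (Real.log x / 2) ^ B₁) =
      (C₁ * (2 : ℝ) ^ B₁) * y / Real.log x ^ (max B 0 + 1) := by
    rw [Real.div_rpow hlogpos.le (by norm_num)]
    have e : Real.log x ^ B₁ = Real.log x ^ κ * Real.log x ^ (max B 0 + 1) := by
      rw [← Real.rpow_add hlogpos]; congr 1; rw [hB₁]; ring
    rw [e]
    have hk : 0 < Real.log x ^ κ := Real.rpow_pos_of_pos hlogpos κ
    have hm : 0 < Real.log x ^ (max B 0 + 1) := Real.rpow_pos_of_pos hlogpos _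
    have h2 : 0 < (2 : ℝ) ^ B₁ := Real.rpow_pos_of_pos (by norm_num) _
    field_simp
  have step3 : (C₁ * (2 : ℝ) ^ B₁) * y / Real.log x ^ (max B 0 + 1) ≤ y / Real.log x ^ (max B 0) := by
    rw [Real.rpow_add hlogpos, Real.rpow_one]
    have hm : 0 < Real.log x ^ (max B 0) := Real.rpow_pos_of_pos hlogpos _
    rw [div_le_div_iff₀ (by positivity) hm]
    have : C₁ * (2 : ℝ) ^ B₁ * y * Real.log x ^ max B 0 ≤ Real.log x * y * Real.log x ^ max B 0 := by
      gcongr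
    nlinarith [this]
  have step4 : y / Real.log x ^ (max B 0) ≤ y / Real.log x ^ B := by
    apply div_le_div_of_nonneg_left hypos.le (Real.rpow_pos_of_pos hlogpos B)
    exact Real.rpow_le_rpow_of_exponent_le (by linarith) (le_max_left _ _)
  calc (n : ℝ) * (C₁ * y / Real.log y ^ B₁)
      ≤ Real.log x ^ κ * (C₁ * y / (Real.log x / 2) ^ B₁) := step1
    _ = (C₁ * (2 : ℝ) ^ B₁) * y / Real.log x ^ (max B 0 + 1) := step2
    _ ≤ y / Real.log x ^ (max B 0) := step3
    _ ≤ y / Real.log x ^ B := step4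

/-- **T4b. `GenericAffineTable → TableChowla` UNCONDITIONALLY**: `q = 1` is never exceptional
(`Σ_{q∈E'} 1/q ≤ (log x)^{-C} < 1`), its one-point hypothesis is the theorem `onePointData_one`,
and the `q = 1` block is the plain table. So the hardest stub CONTAINS the sibling crux
stmt-Parity-14270, with no analytic input left over. -/
theorem genericAffineTable_imp_tableChowla (h : GenericAffineTable) : TableChowla := by
  intro c hc δ hδ hδ' C hC
  obtain ⟨B, κ, hκ, x₀, hx₀⟩ := h c hc δ hδ hδ' C hC
  obtain ⟨x₁, hx₁⟩ := onePointData_one B κ hκ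
  refine ⟨max (max x₀ x₁) 3, fun x hx A hA1 hA2 => ?_⟩
  have hx0 : x₀ ≤ x := le_trans (le_trans (le_max_left _ _) (le_max_left _ _)) hx
  have hx1 : x₁ ≤ x := le_trans (le_trans (le_max_right _ _) (le_max_left _ _)) hx
  have hx3 : (3 : ℝ) ≤ x := le_trans (le_max_right _ _) hx
  have hlog1 : 1 < Real.log x := by
    rw [Real.lt_log_iff_exp_lt (by linarith)]
    have := Real.exp_one_lt_d9
    linarith
  obtain ⟨E', hE', hpt⟩ := hx₀ x hx0 A hA1 hA2 (fun _ => 0) (fun _ => 0)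
  have h1 : (1 : ℕ) ∉ E' := by
    intro h1
    have hge : (1 : ℝ) ≤ ∑ q ∈ E', ((q : ℝ))⁻¹ := by
      have := Finset.single_le_sum (f := fun q : ℕ => ((q : ℝ))⁻¹)
        (fun q _ => inv_nonneg.2 (Nat.cast_nonneg q)) h1
      simpa using this
    have hlt : (Real.log x ^ C)⁻¹ < 1 := inv_lt_one_of_one_lt₀ (Real.one_lt_rpow hlog1 hC)
    linarith
  have hQ : 1 ≤ ⌊x ^ (δ / 2)⌋₊ :=
    Nat.le_floor (by simpa using Real.one_le_rpow (by linarith : (1 : ℝ) ≤ x) (by linarith : 0 ≤ δ / 2))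
  have key : ((1 : ℕ) : ℝ) ^ 4 * F c x A 1 0 0 ≤ x ^ 2 / Real.log x ^ C :=
    hpt 1 le_rfl hQ h1 (hx₁ x hx1)
  rw [Nat.cast_one, one_pow, one_mul, F_one_eq_table] at key
  exact key

/-! ### Degenerate-parameter probes of (Z1), (Z2), (★): no formal loophole -/

/-- For `K' ≤ 0` and `x ≥ e` the Linnik box lies in `re s > 1`, where no `L(s,χ)` vanishes:
`BoxZeroFree` is then free (Mathlib's non-vanishing on `re s ≥ 1`). -/
theorem boxZeroFree_of_nonpos {K' : ℝ} (hK' : K' ≤ 0) {x : ℝ} (hx : Real.exp 1 ≤ x) (n : ℕ)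
    (H : ℝ) : BoxZeroFree n x K' H := by
  intro _ χ s hs _ hs1
  have hxpos : 0 < x := lt_of_lt_of_le (Real.exp_pos 1) hx
  have hlog1 : 1 ≤ Real.log x := by rwa [Real.le_log_iff_exp_le hxpos]
  have hll : 0 ≤ Real.log (Real.log x) := Real.log_nonneg hlog1
  have hedge : 1 ≤ boxEdge x K' := by
    unfold boxEdge
    have : K' * Real.log (Real.log x) / Real.log x ≤ 0 :=
      div_nonpos_of_nonpos_of_nonneg (mul_nonpos_of_nonpos_of_nonneg hK' hll) (by linarith)
    linarith
  exact DirichletCharacter.LFunction_ne_zero_of_one_le_re χ (Or.inr hs1) (by linarith)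

/-- The `K' ≤ 0` slice of (Z1) is a theorem (so (Z1) has content only for `K' > 0`). -/
theorem smallConductorsZeroFree_nonpos_slice {K' : ℝ} (hK' : K' ≤ 0) (K K'' : ℝ) :
    ∃ x₀ : ℝ, ∀ x : ℝ, x₀ ≤ x →
      ∀ d : ℕ, 1 ≤ d → (d : ℝ) ≤ Real.log x ^ K → BoxZeroFree d x K' (Real.log x ^ K'') :=
  ⟨Real.exp 1, fun _ hx d _ _ => boxZeroFree_of_nonpos hK' hx d _⟩

/-- With `K' ≤ 0` EVERY dilation is box-generic: a prover who instantiates (★) with `K' ≤ 0` is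
left to prove `OnePointData q x B κ` for all `q ≤ x^{1/24}` unconditionally (Landau–Siegel-hard). -/
theorem boxGeneric_of_nonpos {K' : ℝ} (hK' : K' ≤ 0) {x : ℝ} (hx : Real.exp 1 ≤ x) (q : ℕ)
    (K'' κ : ℝ) : BoxGeneric q x K' K'' κ :=
  fun n _ _ => boxZeroFree_of_nonpos hK' hx n _

/-- The `θ ≤ 0` slice of (Z2) is a theorem (`d ≤ x^θ ≤ 1` forces `d = 1`; `S = ∅` or `{1}`). -/
theorem fewBadConductors_theta_nonpos_slice {θ : ℝ} (hθ : θ ≤ 0) (K' K'' : ℝ) :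
    ∃ E₀ x₀ : ℝ, ∀ x : ℝ, x₀ ≤ x →
      ∃ S : Finset ℕ, (S.card : ℝ) ≤ Real.log x ^ E₀ ∧
        (∀ s ∈ S, ¬ BoxZeroFree s x K' (Real.log x ^ K'')) ∧
        ∀ d : ℕ, 1 ≤ d → (d : ℝ) ≤ x ^ θ → ¬ BoxZeroFree d x K' (Real.log x ^ K'') →
          ∃ s ∈ S, s ∣ d := by
  refine ⟨0, 1, fun x hx => ?_⟩
  have hd1 : ∀ d : ℕ, 1 ≤ d → (d : ℝ) ≤ x ^ θ → d = 1 := by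
    intro d hd hdx
    have hx1 : x ^ θ ≤ 1 := Real.rpow_le_one_of_one_le_of_nonpos hx hθ
    have : (d : ℝ) ≤ 1 := hdx.trans hx1
    have : d ≤ 1 := by exact_mod_cast this
    omega
  by_cases hb : BoxZeroFree 1 x K' (Real.log x ^ K'')
  · refine ⟨∅, by simp [Real.rpow_zero], by simp, fun d hd hdx hbad => ?_⟩
    obtain rfl := hd1 d hd hdx
    exact (hbad hb).elim
  · refine ⟨{1}, by simp [Real.rpow_zero], by simpa using hb, fun d hd hdx _ => ⟨1, by simp, one_dvd d⟩⟩

end PQ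

end Summit.Parity.GeneralizedHardyLittlewood.Cruxes.DilatedTableChowla.Disproof
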